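import Literature.Computability.Complexity.StackAlgOne
import HarnessLib

/-!
# The base search (small prime factors / an element of large order) on the stack machine

Literature / complexity toolkit, continuing `StackAlgOne.lean` (Harvey's Algorithm 1 on the
machine).  Harvey's deterministic factoring algorithm (arXiv:2010.05450) needs two number-theoretic
subroutines besides the search: Prop. 6 (all prime factors `≤ M` by Pollard–Strassen) and Prop. 8
(an `α` of multiplicative order `> D`, Hittmeir).  Both are replaced here by ONE machine built from
Algorithm 1 — a baby-step/giant-step collision test per base `α = 2, 3, …` — whose outcomes are
certified by elementary group theory:

* per base (`d = 2^e`): the giant steps `v_j = α^{(j+1)d}` (`sfVals`), Algorithm 1 against the baby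
  steps `α^i` (`c = 1`, `m = d`, `k = e + 2`); outcome "factor" (a proper divisor), "clear"
  (no `v_j ≡ α^i` modulo any prime factor: then `α^x ≠ 1 (mod p)` for every prime `p ∣ N` and all
  `1 ≤ x ≤ d²`, `sfBase_clear_pow_ne_one` — this certifies both "no prime factor `p ≤ d² + 1`"
  (Fermat) and "`ord_N(α) > d²`"), or an exact hit `α^{(h+1)d} = α^i` in `ℤ/N`, i.e. `α^{e*} = 1`
  with `e* = (h+1)d − i ∈ [1, d²]` (`sfBase_exact_pow_eq_one`);
* on an exact hit, the casework over the divisor pairs `(t, e*/t)`, `t ≤ d` (`sfDivs`, `divRun`):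
  either some `gcd(α^u − 1, N)` is a proper divisor, or the least `u ∣ e*` with `α^u = 1` is the
  order `K` of `α` modulo `N` AND modulo every prime factor `q`, whence `K ∣ q − 1`
  (**`divRun_none_order`**); the modulus `L := lcm(L, K)` (`sfLcm`) of the congruence
  `q ≡ 1 (mod L)` satisfied by every prime factor; once `L ≥ LB`, trial division of the class
  `1 (mod L)` up to `M` (`sfClass`) finds a factor or certifies that every prime factor `≤ M` is
  `N` itself;
* the loop over `B` bases (`sfSearch`, **`runs_sfSearch`**: the registers at the end are
  `u.sfAt 0 (sfRun N e LB M B)` within `sfSearchCost n e M LB B` steps) and its meaning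
  (**`sfRun_spec`**): result code `1` = proper factor, `2` = clear at the base on `BLA`,
  `3` = class exhausted, none = bases exhausted with every `a ≤ B + 1` satisfying `a^L = 1`,
  `L ≤ LB` (the input of the counting argument that bounds the number of bases).

All control is by flag-guarded fixed-count loops (`whenNot`, `whenCons`, `Com.pop`) and `NS.ite`
casework; every theorem is proved, no named facts.

## References

* D. Harvey, *An exponent one-fifth algorithm for deterministic integer factorisation*,
  Math. Comp. 90 (2021) 2937–2950, §§3–4 (Props. 6, 8 are what this machine replaces; Algorithm 1
  is what it runs) / arXiv:2010.05450. [Harvey2021]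
* M. Hittmeir, *A babystep-giantstep method for faster deterministic integer factorization*,
  Math. Comp. 87 (2018) 2915–2935 (order computation by collisions). (Folklore material, fully
  proved here.)
-/

namespace Literature.Computability.Complexity

open _root_.Computability SProg

namespace Com

variable {β : Type} [DecidableEq β] (h : HReg ↪ β)

/-! ### The base search (small factors / large order): per-base passes

For a base `α` and `d = 2^e`: the giant steps `v_j = α^{jd}` (`j = 1 … d`), Algorithm 1 against the
baby steps `α^i` (`i < d`, shift `c = 1`), and on an exact hit `α^{(h+1)d} ≡ α^{i}` the exponent
`e* = (h+1)d − i` with `α^{e*} ≡ 1`, the casework over the divisor pairs `(t, e*/t)`, `t ≤ d`, the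
`lcm` update of the modulus `L` of the congruence `q ≡ 1 (mod L)` satisfied by every prime factor,
and the trial division of the class `1 (mod L)`. -/

section BaseSearch

/-- The giant-step values `β^{j+1} mod N`, `j < d` (`β = α^d`). [folklore] -/
def sfValList (N β d : ℕ) : List ℕ := (List.range d).map fun j => β ^ (j + 1) % N

/-- `sfValList_succ`. [folklore] -/
theorem sfValList_succ (N β d : ℕ) : sfValList N β (d + 1) = sfValList N β d ++ [β ^ (d + 1) % N] := by
  simp [sfValList, List.range_succ]

/-- One giant step: `cur := cur · β`, a copy emitted. [folklore] -/
def sfValBody : Com (EReg ⊕ β) :=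
  ((NS.ofList [.mulMod (h .X6) (h .X5) (h (.g (.f (.n (.v .MD))))), .copy (h .X6) (h .X2)] : NS β).com) ;;
  emit (Sum.inr (h .X2)) (Sum.inr (h .L4))

/-- The giant steps onto `A1V`: `X4 := 2^e`, `β := α^{2^e}`, `cur := 1`, `d` rounds, pour. [folklore] -/
def sfVals : Com (EReg ⊕ β) :=
  pow2Into (rGH h) (h .X4) (h .A1P) ;;
  (((NS.ofList [.powMod (h .X5) (h .BLA) (h .X4) (h (.g (.f (.n (.v .MD))))), .const (h .X6) (encodeNat 1)] : NS β).com) ;;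
  (nToUnary (h .U1) (h .X4) ;;
  (countLoop (Sum.inr (h .U1)) (sfValBody h) ;;
  (pour (Sum.inr (h .L4)) (Sum.inr (h .A1V)) ;;
  ((NS.ofList [.clear (h .X4), .clear (h .X5), .clear (h .X6)] : NS β).com)))))

/-- Cost of the giant steps. [folklore] -/
def sfValsCost (n e : ℕ) : ℕ :=
  (n * (16 * e + 21) + 3 * e + 7) + 1913 * (n + 1) ^ 3 + ((e + 1) * (16 * 2 ^ e + 21) + 5) + (2 ^ e * (1000 * (n + 1) ^ 3 + 2) + 1) +
    (3 * (2 ^ e * (2 * n)) + 1)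

/-- **The giant steps.** [folklore] -/
theorem runs_sfVals {N n e α : ℕ} (hN1 : 1 < N) (hn : (encodeNat N).length + 1 ≤ n) (hen : e + 2 ≤ n) (T : Regs β) (hI : DrvInv (rGH h) N T)
    (u : HSlots) (hαN : α < N) (hbla : u.bla = encodeNat α) (ha1p : u.a1p = encodeNat e)
    (hx2 : u.x2 = []) (hx4 : u.x4 = []) (hx5 : u.x5 = []) (hx6 : u.x6 = []) (hu1 : u.u1 = []) (hl4 : u.l4 = []) (ha1v : u.a1v = []) :
    Runs (sfVals h) (base (hSt h T u)) (base (hSt h T { u with a1v := encVec (sfValList N (α ^ 2 ^ e % N) (2 ^ e)) })) (sfValsCost n e) := by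
  have hhq : ∀ {i j : HReg}, i ≠ j → h i ≠ h j := fun hij => hq_ne h hij
  obtain ⟨hMD, -, -, -, -, -, -, -, -, -, hU, -, -, -, -, -, -, -⟩ := id hI
  have hN0 : 0 < N := by omega
  set c := (n + 1) ^ 3 with hc3
  have hc1 : n + 1 ≤ c := by
    rw [hc3]; calc n + 1 = (n + 1) ^ 1 := (pow_one _).symm
      _ ≤ (n + 1) ^ 3 := Nat.pow_le_pow_right (by omega) (by omega)
  have rdMD : ∀ u' : HSlots, hSt h T u' (h (.g (.f (.n (.v .MD))))) = encodeNat N := fun u' => by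
    rw [hSt_gv h T u' (by decide) (by decide) (by decide) (by decide) (by decide) (by decide)]; exact hMD
  have rdU : ∀ u' : HSlots, hSt h T u' (h (.g (.f (.n (.v .U))))) = [] := fun u' => by
    rw [hSt_gv h T u' (by decide) (by decide) (by decide) (by decide) (by decide) (by decide)]; exact hU
  have hlN : (encodeNat N).length ≤ n := by omega
  have hlα : (encodeNat α).length ≤ n := (Brick.length_encodeNat_mono hαN.le).trans hlN
  have hle : (encodeNat e).length ≤ n := (length_encodeNat_le_succ (le_two_pow_self e)).trans (by omega)
  have hl2e : (encodeNat (2 ^ e)).length ≤ n := by rw [encodeNat_two_pow]; simp; omega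
  have e1 : encodeNat 1 = [true] := by simpa using encodeNat_two_pow 0
  have hl1n : (encodeNat 1).length ≤ n := by rw [e1]; simp only [List.length_cons, List.length_nil]; omega
  set β' := α ^ 2 ^ e % N with hβ0
  have hβN : β' < N := Nat.mod_lt _ hN0
  have hlβ : (encodeNat β').length ≤ n := (Brick.length_encodeNat_mono hβN.le).trans hlN
  have hlpow : ∀ j, (encodeNat (β' ^ j % N)).length ≤ n := fun j => (Brick.length_encodeNat_mono (Nat.mod_lt _ hN0).le).trans hlN
  let u1 : HSlots := { u with x4 := encodeNat (2 ^ e) }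
  have h1 : Runs (pow2Into (rGH h) (h .X4) (h .A1P)) (base (hSt h T u)) (base (hSt h T u1)) (n * (16 * e + 21) + 3 * e + 7) := by
    have hne : h .X4 ≠ h .A1P := hhq (by decide)
    have hneU : h .X4 ≠ (rGH h) (.f (.n (.v .U))) := (rGH_ne h .X4 (fun _ e => HReg.noConfusion e) _).symm
    have r1 : hSt h T u (h .A1P) = encodeNat e := by rw [hSt_A1P]; exact ha1p
    have r2 : hSt h T u (h .X4) = [] := by rw [hSt_X4]; exact hx4
    refine (runs_pow2Into (rGH h) hneU hne hle (hSt h T u) r1 r2 (rdU u)).of_eq ?_ le_rfl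
    rw [update_hSt_X4]
  let u2 : HSlots := { u1 with x5 := encodeNat β', x6 := encodeNat 1 }
  have h2 : Runs ((NS.ofList [.powMod (h .X5) (h .BLA) (h .X4) (h (.g (.f (.n (.v .MD))))), .const (h .X6) (encodeNat 1)] : NS β).com)
      (base (hSt h T u1)) (base (hSt h T u2)) (1904 * c) := by
    refine NS.runs_of_eq (N := n) _ _ ?_ ?_ (by simp [hc3])
    · simp (config := { decide := true }) only [NS.ofList, NS.ok, NOp.ok, NS.eval, NOp.eval, hSt_X4, hSt_X5, hSt_X6, hSt_BLA, update_hSt_X5, u1, hx5, hx6, hbla,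
        rdMD, bitsToNat_encodeNat, ne_eq, EmbeddingLike.apply_eq_iff_eq, List.length_nil, zero_le, and_self, hlα, hl2e, hlN, hN1, hl1n, not_false_eq_true]
    · simp [u1, u2, hx5, hx6, hbla, rdMD, hβ0]
  let vst : ℕ → HSlots := fun i => { u2 with u1 := List.replicate i true, x6 := encodeNat (β' ^ (2 ^ e - i) % N), l4 := outRev ((sfValList N β' (2 ^ e - i)).map encodeNat) }
  have h3 : Runs (nToUnary (h .U1) (h .X4)) (base (hSt h T u2)) (base (hSt h T (vst (2 ^ e)))) ((e + 1) * (16 * 2 ^ e + 21) + 5) := by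
    refine (runs_nToUnary (h .U1) (h .X4) (hSt h T u2) (by simp [u2, u1, hu1])).of_eq ?_ ?_
    · simp [u2, u1, vst, hl4, sfValList, Nat.mod_eq_of_lt hN1]
    · simp only [hSt_X4, u2, u1, bitsToNat_encodeNat]; exact toUnary_cost_le le_rfl
  have hbody : ∀ i, i + 1 ≤ 2 ^ e → Runs (sfValBody h) (base (hSt h T { vst (i + 1) with u1 := List.replicate i true })) (base (hSt h T (vst i))) (1000 * c) := by
    intro i hi
    set j := 2 ^ e - (i + 1) with hj0
    have hj1 : 2 ^ e - i = j + 1 := by omega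
    let ua : HSlots := { vst (i + 1) with u1 := List.replicate i true }
    let ub : HSlots := { ua with x6 := encodeNat (β' ^ (j + 1) % N), x2 := encodeNat (β' ^ (j + 1) % N) }
    have g1 : Runs ((NS.ofList [.mulMod (h .X6) (h .X5) (h (.g (.f (.n (.v .MD))))), .copy (h .X6) (h .X2)] : NS β).com) (base (hSt h T ua)) (base (hSt h T ub)) (953 * c) := by
      refine NS.runs_of_eq (N := n) _ _ ?_ ?_ (by simp [hc3])
      · have hpow : β' ^ j % N * β' % N = β' ^ (j + 1) % N := by rw [pow_succ, Nat.mod_mul_mod]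
        simp (config := { decide := true }) only [NS.ofList, NS.ok, NOp.ok, NS.eval, NOp.eval, hSt_X5, hSt_X6, update_hSt_X6, ua, vst, u2, u1, hx2,
          ← hj0, rdMD, bitsToNat_encodeNat, ne_eq, EmbeddingLike.apply_eq_iff_eq, and_self, hlβ, hlpow, hlN, hN0, not_false_eq_true, hpow]
      · have hpow : β' ^ j % N * β' % N = β' ^ (j + 1) % N := by rw [pow_succ, Nat.mod_mul_mod]
        simp [ua, ub, vst, u2, u1, hx2, ← hj0, rdMD, hpow]
    have g2 : Runs (emit (Sum.inr (h .X2)) (Sum.inr (h .L4))) (base (hSt h T ub)) (base (hSt h T (vst i))) (4 * n + 3) := by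
      refine (runs_emit (h := (Sum.inr (h .X2) : EReg ⊕ β)) (o := Sum.inr (h .L4)) (by simp [hhq]) (base (hSt h T ub))).of_eq ?_ ?_
      · simp [ub, ua, vst, u2, u1, hx2, ← hj0, hj1, sfValList_succ, List.map_append, outRev_append]
      · simp only [nst_inr, hSt_X2, ub]; have := hlpow (j + 1); omega
    exact (g1.seq g2).mono (by omega)
  have hL := runs_countLoop (U := (Sum.inr (h .U1) : EReg ⊕ β)) (body := sfValBody h) (fun i R => i ≤ 2 ^ e ∧ R = base (hSt h T (vst i))) (1000 * c)
    (by
      rintro i R ⟨hi, rfl⟩ -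
      have : Function.update (base (hSt h T (vst (i + 1)))) (Sum.inr (h .U1)) (List.replicate i true) = base (hSt h T { vst (i + 1) with u1 := List.replicate i true }) := by
        simp [vst]
      rw [this]
      exact ⟨_, hbody i hi, by simp [vst], by omega, rfl⟩)
    (2 ^ e) (base (hSt h T (vst (2 ^ e)))) ⟨le_rfl, rfl⟩ (by simp [vst])
  obtain ⟨R', hR, -, -, rfl⟩ := hL
  set V := sfValList N β' (2 ^ e) with hV0
  have hVN : ∀ x ∈ V, x < N := fun x hx => by
    simp only [hV0, sfValList, List.mem_map, List.mem_range] at hx; obtain ⟨j, -, rfl⟩ := hx; exact Nat.mod_lt _ hN0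
  have hVl : V.length = 2 ^ e := by simp [hV0, sfValList]
  have hrev : (outRev (V.map encodeNat)).reverse = encVec V := by rw [reverse_outRev]; rfl
  have hlo : (outRev (V.map encodeNat)).length ≤ 2 ^ e * (2 * n) := by
    rw [← List.length_reverse, hrev, ← hVl]; exact length_encVec_le_of_lt hVN hn
  have p1 : Runs (pour (Sum.inr (h .L4)) (Sum.inr (h .A1V))) (base (hSt h T (vst 0))) (base (hSt h T { vst 0 with l4 := [], a1v := encVec V })) (3 * (2 ^ e * (2 * n)) + 1) := by
    refine (runs_opour (a := h .L4) (b := h .A1V) (hhq (by decide)) (hSt h T (vst 0))).of_eq ?_ ?_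
    · simp [vst, u2, u1, hrev, ha1v, ← hV0]
    · simp only [hSt_L4, vst, Nat.sub_zero, ← hV0]; omega
  have p2 : Runs ((NS.ofList [.clear (h .X4), .clear (h .X5), .clear (h .X6)] : NS β).com) (base (hSt h T { vst 0 with l4 := [], a1v := encVec V }))
      (base (hSt h T { u with a1v := encVec V })) (9 * c) := by
    refine NS.runs_of_eq (N := n) _ _ ?_ ?_ (by simp [hc3])
    · simp only [NS.ofList, NS.ok, NOp.ok, NS.eval, NOp.eval, hSt_X4, hSt_X5, hSt_X6, update_hSt_X4, update_hSt_X5, vst, u2, u1, Nat.sub_zero, and_true]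
      exact ⟨hl2e, hlβ, hlpow _⟩
    · simp [vst, u2, u1, hx4, hx5, hx6, hu1, hl4]
  refine (h1.seq (h2.seq (h3.seq (hR.seq (p1.seq p2))))).of_eq rfl ?_
  simp only [sfValsCost, ← hc3]; omega

/-! #### The exponent `e*` and the casework over its divisors -/

/-- The gcd `g_u = gcd(α^u − 1 mod N, N)`. [folklore] -/
def powGcd (N α u : ℕ) : ℕ := Nat.gcd ((α ^ u % N + N - 1) % N) N

/-- One divisor `u` of `e*`: nothing (`g_u = 1`), a smaller `K` (`g_u = N`, `u < K`), or a factor. [folklore] -/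
def procSpec (N α u : ℕ) (K : ℕ) : ℕ × Option ℕ :=
  if powGcd N α u = 1 then (K, none) else if powGcd N α u = N then (if u < K then u else K, none) else (K, some (powGcd N α u))

/-- One round `t` of the divisor casework. [folklore] -/
def sfDivStep (N α es t : ℕ) (s : ℕ × Option ℕ) : ℕ × Option ℕ :=
  match s.2 with
  | some _ => s
  | none =>
    if es % t = 0 then
      match procSpec N α t s.1 with
      | (K1, some g) => (K1, some g)
      | (K1, none) => procSpec N α (es / t) K1
    else s

/-- The casework over `t = 1, …, j`. [folklore] -/
def divRun (N α es : ℕ) : ℕ → ℕ × Option ℕ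
  | 0 => (es, none)
  | j + 1 => sfDivStep N α es (j + 1) (divRun N α es j)

/-- The exponent `e* = (h+1)·2^e − i` of the exact hit, the initial `K = e*`, `t = 1`, the count `2^e`. [folklore] -/
def sfEstar : Com (EReg ⊕ β) :=
  pow2Into (rGH h) (h .X4) (h .A1P) ;;
  (((NS.ofList [.succ (h .X2) (h .A1I), .mul (h .X3) (h .X2) (h .X4), .sub (h .SFE) (h .X3) (h .BLG), .clear (h .X2), .clear (h .X3),
      .copy (h .SFE) (h .SFK), .const (h .SFT) (encodeNat 1)] : NS β).com) ;;
  (nToUnary (h .U1) (h .X4) ;; (NS.op (.clear (h .X4)) : NS β).com))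

/-- The residue `α^u − 1 mod N` into `X5` (`X1 = 1`). [folklore] -/
def sfPowSub (U : HReg) : NS β :=
  NS.ofList [.powMod (h .X3) (h .BLA) (h U) (h (.g (.f (.n (.v .MD))))), .add (h .X5) (h .X3) (h (.g (.f (.n (.v .MD))))), .sub (h .X6) (h .X5) (h .X1),
    .clear (h .X3), .clear (h .X5), .divMod (h .X3) (h .X5) (h .X6) (h (.g (.f (.n (.v .MD))))), .clear (h .X3), .clear (h .X6)]

/-- The casework on `g_u` in `X3`: `1`: nothing; `N`: `K := min(K, u)`; else the factor. [folklore] -/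
def sfCaseK (U : HReg) : NS β :=
  NS.seq (NS.op (.eq (h .X5) (h .X3) (h .X1) (h .L2)))
    (NS.ite (h .X5) NS.nop
      (NS.seq (NS.op (.eq (h .X6) (h .X3) (h (.g (.f (.n (.v .MD))))) (h .L2)))
        (NS.ite (h .X6)
          (NS.seq (NS.op (.cmp (h .FL2) (h U) (h .SFK))) (NS.ite (h .FL2) NS.nop (NS.seq (NS.op (.clear (h .SFK))) (NS.op (.copy (h U) (h .SFK))))))
          (NS.seq (NS.op (.copy (h .X3) (h .SFR))) (NS.op (.const (h .SFBETA) [true]))))))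

/-- Processing one divisor `u` (in register `U`), guarded by the found flag `SFBETA`. [folklore] -/
def sfProc (U : HReg) : Com (EReg ⊕ β) :=
  whenNot h .SFBETA ((sfPowSub h U).com ;; (nGcd (h .X3) (h .X5) (h (.g (.f (.n (.v .MD))))) ;;
    ((NS.op (.clear (h .X5)) : NS β).com ;; ((sfCaseK h U).com ;; (NS.op (.clear (h .X3)) : NS β).com))))

/-- One round of the divisor casework: divisibility of `e*` by `t`, the pair `(t, e*/t)`, `t := t + 1`. [folklore] -/
def sfDivBody : Com (EReg ⊕ β) :=
  ((NS.ofList [.divMod (h .X2) (h .X3) (h .SFE) (h .SFT), .eq (h .X5) (h .X3) (h .FL1) (h .L2), .clear (h .X3)] : NS β).com) ;;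
  (Com.pop (Sum.inr (h .X5)) (sfProc h .SFT ;; sfProc h .X2) skip skip ;;
  ((NS.ofList [.clear (h .X2), .succ (h .X3) (h .SFT), .clear (h .SFT), .move (h .X3) (h .SFT)] : NS β).com))

/-- The divisor casework: `e*`, then `2^e` rounds. [folklore] -/
def sfDivs : Com (EReg ⊕ β) :=
  sfEstar h ;; (countLoop (Sum.inr (h .U1)) (sfDivBody h) ;; (NS.op (.clear (h .SFT)) : NS β).com)

/-- An optional numeral over a default. [folklore] -/
def optUpd (d : List Bool) : Option ℕ → List Bool
  | none => d
  | some x => encodeNat x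

/-- An optional flag over a default. [folklore] -/
def optFlag (d : List Bool) : Option ℕ → List Bool
  | none => d
  | some _ => [true]

/-- `optUpd_none`. [folklore] -/
@[simp] theorem optUpd_none (d : List Bool) : optUpd d none = d := rfl
/-- `optUpd_some`. [folklore] -/
@[simp] theorem optUpd_some (d : List Bool) (x : ℕ) : optUpd d (some x) = encodeNat x := rfl
/-- `optFlag_none`. [folklore] -/
@[simp] theorem optFlag_none (d : List Bool) : optFlag d none = d := rfl
/-- `optFlag_some`. [folklore] -/
@[simp] theorem optFlag_some (d : List Bool) (x : ℕ) : optFlag d (some x) = [true] := rfl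

/-- `powGcd` is at most `N`. [folklore] -/
theorem powGcd_le {N : ℕ} (hN : 0 < N) (α u : ℕ) : powGcd N α u ≤ N := Nat.gcd_le_right _ hN

/-- **The exponent of the exact hit.** [folklore] -/
theorem runs_sfEstar {N n e h₀ i₀ : ℕ} (hen : 2 * e + 4 ≤ n) (T : Regs β) (hI : DrvInv (rGH h) N T)
    (u : HSlots) (hh₀ : h₀ < 2 ^ e) (hi₀ : i₀ < 2 ^ e) (ha1i : u.a1i = encodeNat h₀) (hblg : u.blg = encodeNat i₀) (ha1p : u.a1p = encodeNat e)
    (hx2 : u.x2 = []) (hx3 : u.x3 = []) (hx4 : u.x4 = []) (hu1 : u.u1 = []) (hsfe : u.sfe = []) (hsfk : u.sfk = []) (hsft : u.sft = []) :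
    Runs (sfEstar h) (base (hSt h T u))
      (base (hSt h T { u with sfe := encodeNat ((h₀ + 1) * 2 ^ e - i₀), sfk := encodeNat ((h₀ + 1) * 2 ^ e - i₀), sft := encodeNat 1, u1 := List.replicate (2 ^ e) true }))
      ((n * (16 * e + 21) + 3 * e + 7) + 436 * (n + 1) ^ 3 + ((e + 1) * (16 * 2 ^ e + 21) + 5) + 3 * (n + 1) ^ 3) := by
  have hhq : ∀ {i j : HReg}, i ≠ j → h i ≠ h j := fun hij => hq_ne h hij
  obtain ⟨-, -, -, -, -, -, -, -, -, -, hU, -, -, -, -, -, -, -⟩ := id hI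
  set c := (n + 1) ^ 3 with hc3
  have rdU : ∀ u' : HSlots, hSt h T u' (h (.g (.f (.n (.v .U))))) = [] := fun u' => by
    rw [hSt_gv h T u' (by decide) (by decide) (by decide) (by decide) (by decide) (by decide)]; exact hU
  have hle : (encodeNat e).length ≤ n := (length_encodeNat_le_succ (le_two_pow_self e)).trans (by omega)
  have hl2k : ∀ x, x ≤ 2 ^ (2 * e) → (encodeNat x).length ≤ n := fun x hx => length_le_of_le_two_pow_two_mul hx hen
  have h22 : 2 ^ e * 2 ^ e = 2 ^ (2 * e) := by rw [← pow_add, two_mul]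
  have hprod : (h₀ + 1) * 2 ^ e ≤ 2 ^ (2 * e) := by rw [← h22]; exact Nat.mul_le_mul_right _ hh₀
  have e1 : encodeNat 1 = [true] := by simpa using encodeNat_two_pow 0
  have hl1n : (encodeNat 1).length ≤ n := by rw [e1]; simp only [List.length_cons, List.length_nil]; omega
  have hl2e : (encodeNat (2 ^ e)).length ≤ n := by rw [encodeNat_two_pow]; simp; omega
  have hlh : (encodeNat h₀).length ≤ n := hl2k _ (by nlinarith [Nat.one_le_two_pow (n := e)])
  have hlh1 : (encodeNat (h₀ + 1)).length ≤ n := hl2k _ (by nlinarith [Nat.one_le_two_pow (n := e)])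
  have hli : (encodeNat i₀).length ≤ n := hl2k _ (by nlinarith [Nat.one_le_two_pow (n := e)])
  have hlp : (encodeNat ((h₀ + 1) * 2 ^ e)).length ≤ n := hl2k _ hprod
  have hles : (encodeNat ((h₀ + 1) * 2 ^ e - i₀)).length ≤ n := hl2k _ ((Nat.sub_le _ _).trans hprod)
  have hile : i₀ ≤ (h₀ + 1) * 2 ^ e := by nlinarith
  let u1 : HSlots := { u with x4 := encodeNat (2 ^ e) }
  have h1 : Runs (pow2Into (rGH h) (h .X4) (h .A1P)) (base (hSt h T u)) (base (hSt h T u1)) (n * (16 * e + 21) + 3 * e + 7) := by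
    have hne : h .X4 ≠ h .A1P := hhq (by decide)
    have hneU : h .X4 ≠ (rGH h) (.f (.n (.v .U))) := (rGH_ne h .X4 (fun _ e => HReg.noConfusion e) _).symm
    have r1 : hSt h T u (h .A1P) = encodeNat e := by rw [hSt_A1P]; exact ha1p
    have r2 : hSt h T u (h .X4) = [] := by rw [hSt_X4]; exact hx4
    refine (runs_pow2Into (rGH h) hneU hne hle (hSt h T u) r1 r2 (rdU u)).of_eq ?_ le_rfl
    rw [update_hSt_X4]
  let u2 : HSlots := { u1 with sfe := encodeNat ((h₀ + 1) * 2 ^ e - i₀), sfk := encodeNat ((h₀ + 1) * 2 ^ e - i₀), sft := encodeNat 1 }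
  have h2 : Runs ((NS.ofList [.succ (h .X2) (h .A1I), .mul (h .X3) (h .X2) (h .X4), .sub (h .SFE) (h .X3) (h .BLG), .clear (h .X2), .clear (h .X3),
      .copy (h .SFE) (h .SFK), .const (h .SFT) (encodeNat 1)] : NS β).com) (base (hSt h T u1)) (base (hSt h T u2)) (436 * c) := by
    refine NS.runs_of_eq (N := n) _ _ ?_ ?_ (by simp [hc3])
    · simp (config := { decide := true }) only [NS.ofList, NS.ok, NOp.ok, NS.eval, NOp.eval, hSt_X2, hSt_X3, hSt_X4, hSt_A1I, hSt_SFE, hSt_BLG, hSt_SFK, hSt_SFT,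
        update_hSt_X2, update_hSt_X3, update_hSt_SFE, update_hSt_SFK, u1, hx2, hx3, ha1i, hblg, hsfe, hsfk, hsft, bitsToNat_encodeNat, ne_eq,
        EmbeddingLike.apply_eq_iff_eq, List.length_nil, zero_le, and_self, hlh, hlh1, hl2e, hlp, hli, hles, hl1n, hile, not_false_eq_true]
    · simp [u1, u2, hx2, hx3, ha1i, hblg, hsfe, hsfk, hsft]
  have h3 : Runs (nToUnary (h .U1) (h .X4)) (base (hSt h T u2)) (base (hSt h T { u2 with u1 := List.replicate (2 ^ e) true })) ((e + 1) * (16 * 2 ^ e + 21) + 5) := by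
    refine (runs_nToUnary (h .U1) (h .X4) (hSt h T u2) (by simp [u2, u1, hu1])).of_eq ?_ ?_
    · simp [u2, u1]
    · simp only [hSt_X4, u2, u1, bitsToNat_encodeNat]; exact toUnary_cost_le le_rfl
  have h4 : Runs ((NS.op (.clear (h .X4)) : NS β).com) (base (hSt h T { u2 with u1 := List.replicate (2 ^ e) true }))
      (base (hSt h T { u with sfe := encodeNat ((h₀ + 1) * 2 ^ e - i₀), sfk := encodeNat ((h₀ + 1) * 2 ^ e - i₀), sft := encodeNat 1, u1 := List.replicate (2 ^ e) true })) (3 * c) := by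
    refine NS.runs_of_eq (N := n) _ _ (by simp only [NS.ok, NOp.ok, hSt_X4, u2, u1]; exact hl2e) ?_ (by simp [hc3])
    simp [u2, u1, hx4]
  exact ((h1.seq (h2.seq (h3.seq h4))).of_eq rfl (by rw [hc3]; omega))

/-- **Processing one divisor**, `u` in `SFT`. [folklore] -/
theorem runs_sfProc_SFT {N n e α uu K : ℕ} (hN1 : 1 < N) (hn : (encodeNat N).length + 1 ≤ n) (hen : 2 * e + 4 ≤ n) (T : Regs β) (hI : DrvInv (rGH h) N T)
    (v : HSlots) (hαN : α < N) (hbla : v.bla = encodeNat α) (hU : v.sft = encodeNat uu) (huu : uu ≤ 2 ^ (2 * e)) (hsfk : v.sfk = encodeNat K) (hK : K ≤ 2 ^ (2 * e))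
    (hx1 : v.x1 = encodeNat 1) (hx3 : v.x3 = []) (hx5 : v.x5 = []) (hx6 : v.x6 = []) (hfl2 : v.fl2 = []) (hl2 : v.l2 = []) (hsfbeta : v.sfbeta = []) (hsfr : v.sfr = []) :
    Runs (sfProc h .SFT) (base (hSt h T v))
      (base (hSt h T { v with sfk := encodeNat (procSpec N α uu K).1, sfr := optUpd v.sfr (procSpec N α uu K).2, sfbeta := optFlag v.sfbeta (procSpec N α uu K).2 }))
      (3800 * (n + 1) ^ 3) := by
  have hhq : ∀ {i j : HReg}, i ≠ j → h i ≠ h j := fun hij => hq_ne h hij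
  obtain ⟨hMD, -, -, -, -, -, -, -, -, -, -, -, -, -, -, -, -, -⟩ := id hI
  have hN0 : 0 < N := by omega
  have hN1' : N ≠ 1 := by omega
  set c := (n + 1) ^ 3 with hc3
  have hc1 : n + 1 ≤ c := by
    rw [hc3]; calc n + 1 = (n + 1) ^ 1 := (pow_one _).symm
      _ ≤ (n + 1) ^ 3 := Nat.pow_le_pow_right (by omega) (by omega)
  have rdMD : ∀ u' : HSlots, hSt h T u' (h (.g (.f (.n (.v .MD))))) = encodeNat N := fun u' => by
    rw [hSt_gv h T u' (by decide) (by decide) (by decide) (by decide) (by decide) (by decide)]; exact hMD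
  have hlN : (encodeNat N).length ≤ n := by omega
  have hlα : (encodeNat α).length ≤ n := (Brick.length_encodeNat_mono hαN.le).trans hlN
  have hl2k : ∀ x, x ≤ 2 ^ (2 * e) → (encodeNat x).length ≤ n := fun x hx => length_le_of_le_two_pow_two_mul hx hen
  have hluu : (encodeNat uu).length ≤ n := hl2k _ huu
  have hlK : (encodeNat K).length ≤ n := hl2k _ hK
  have e1 : encodeNat 1 = [true] := by simpa using encodeNat_two_pow 0
  have hl1n : (encodeNat 1).length ≤ n := by rw [e1]; simp only [List.length_cons, List.length_nil]; omega
  have hl2N : ∀ x, x ≤ 2 * N → (encodeNat x).length ≤ n := fun x hx =>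
    (Brick.length_encodeNat_mono hx).trans (by rw [encodeNat_two_mul _ hN0]; simp only [List.length_cons]; omega)
  set x := α ^ uu % N with hx0
  have hxN : x < N := Nat.mod_lt _ hN0
  have hlx : (encodeNat x).length ≤ n := (Brick.length_encodeNat_mono hxN.le).trans hlN
  have hl3 : (encodeNat (x + N)).length ≤ n := hl2N _ (by omega)
  have hl4 : (encodeNat (x + N - 1)).length ≤ n := hl2N _ (by omega)
  have hl5 : (encodeNat ((x + N - 1) / N)).length ≤ n := hl2N _ ((Nat.div_le_self _ _).trans (by omega))
  set r := (x + N - 1) % N with hr0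
  have hlr : (encodeNat r).length ≤ n := (Brick.length_encodeNat_mono (Nat.mod_lt _ hN0).le).trans hlN
  have hg0 : powGcd N α uu = Nat.gcd r N := by rw [powGcd, hr0, hx0]
  have hlg : (encodeNat (Nat.gcd r N)).length ≤ n := (Brick.length_encodeNat_mono (Nat.gcd_le_right _ hN0)).trans hlN
  have hone : 1 ≤ x + N := by omega
  -- the residue and its gcd
  let v1 : HSlots := { v with x5 := encodeNat r }
  have h1 : Runs (sfPowSub h .SFT).com (base (hSt h T v)) (base (hSt h T v1)) (2398 * c) := by
    refine NS.runs_of_eq (N := n) _ _ ?_ ?_ (by simp [hc3, sfPowSub])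
    · simp (config := { decide := true }) only [sfPowSub, NS.ofList, NS.ok, NOp.ok, NS.eval, NOp.eval, hSt_X1, hSt_X3, hSt_X5, hSt_X6, hSt_BLA, hSt_SFT,
        update_hSt_X3, update_hSt_X5, update_hSt_X6, hx1, hx3, hx5, hx6, hbla, hU, rdMD, bitsToNat_encodeNat, ne_eq, EmbeddingLike.apply_eq_iff_eq,
        List.length_nil, zero_le, and_self, hlα, hluu, hlN, hN1, hN0, hlx, hl3, hl4, hl5, hl1n, hone, ← hx0, not_false_eq_true]
    · simp [sfPowSub, v1, hx1, hx3, hx5, hx6, hbla, hU, rdMD, ← hx0, ← hr0]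
  let v2 : HSlots := { v with x3 := encodeNat (Nat.gcd r N) }
  have h2a : Runs (nGcd (h .X3) (h .X5) (h (.g (.f (.n (.v .MD)))))) (base (hSt h T v1)) (base (Function.update (hSt h T v1) (h .X3) (encodeNat (Nat.gcd r N)))) (1000 * c) := by
    have g1 := runs_nGcd (h .X3) (h .X5) (h (.g (.f (.n (.v .MD))))) (hSt h T v1) (x := r) (y := N) (n := n) (by simp [v1]) (rdMD v1) hlr hlN (by simp [v1, hx3])
    exact g1.of_eq rfl (by simp [hc3])
  have h2b : Runs ((NS.op (.clear (h .X5)) : NS β).com) (base (Function.update (hSt h T v1) (h .X3) (encodeNat (Nat.gcd r N)))) (base (hSt h T v2)) (3 * c) := by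
    rw [update_hSt_X3]
    refine NS.runs_of_eq (N := n) _ _ (by simp only [NS.ok, NOp.ok, hSt_X5, v1]; exact hlr) (by simp [v1, v2, hx5]) (by simp [hc3])
  -- the casework
  let v3 : HSlots := { v2 with sfk := encodeNat (procSpec N α uu K).1, sfr := optUpd v.sfr (procSpec N α uu K).2, sfbeta := optFlag v.sfbeta (procSpec N α uu K).2 }
  have h3 : Runs (sfCaseK h .SFT).com (base (hSt h T v2)) (base (hSt h T v3)) (350 * c) := by
    by_cases hg1 : Nat.gcd r N = 1
    · have hps : procSpec N α uu K = (K, none) := by simp [procSpec, hg0, hg1]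
      refine NS.runs_of_eq (N := n) _ _ ?_ ?_ ?_
      · simp (config := { decide := true }) only [sfCaseK, NS.ok, NOp.ok, NS.eval, NOp.eval, hSt_X1, hSt_X3, hSt_X5, hSt_L2, update_hSt_X5, v2, hx1, hx5, hl2,
          bitsToNat_encodeNat, hg1, ne_eq, EmbeddingLike.apply_eq_iff_eq, and_self, hl1n, not_false_eq_true, decide_true, flag_true, true_and, true_or]
      · simp [sfCaseK, v2, v3, hx1, hx5, hl2, hg1, hps, hsfk]
      · simp [hc3, sfCaseK]
    · by_cases hgN : Nat.gcd r N = N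
      · by_cases hlt : uu < K
        · have hps : procSpec N α uu K = (uu, none) := by simp [procSpec, hg0, hgN, hN1', hlt]
          have hnle : ¬ K ≤ uu := by omega
          refine NS.runs_of_eq (N := n) _ _ ?_ ?_ ?_
          · simp (config := { decide := true }) only [sfCaseK, NS.ok, NOp.ok, NS.eval, NOp.eval, hSt_X1, hSt_X3, hSt_X5, hSt_X6, hSt_L2, hSt_FL2, hSt_SFK, hSt_SFT,
              hSt_SFR, update_hSt_X5, update_hSt_X6, update_hSt_FL2, update_hSt_SFK, rdMD, v2, hx1, hx5, hx6, hl2, hfl2, hsfk, hU, hsfr, hsfbeta,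
              bitsToNat_encodeNat, hgN, hN1', hnle, ne_eq, EmbeddingLike.apply_eq_iff_eq, and_self, hl1n, hlN, hluu, hlK, not_false_eq_true, decide_true, decide_false,
              flag_true, flag_false, true_and, and_true, false_or, or_false, false_and, List.length_cons, List.length_nil]
            try omega
          · simp [sfCaseK, v2, v3, hx1, hx5, hx6, hl2, hfl2, hsfk, hU, hgN, hN1', hnle, hps, rdMD]
          · simp [hc3, sfCaseK]
        · have hps : procSpec N α uu K = (K, none) := by simp [procSpec, hg0, hgN, hN1', hlt]
          have hle : K ≤ uu := by omega
          refine NS.runs_of_eq (N := n) _ _ ?_ ?_ ?_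
          · simp (config := { decide := true }) only [sfCaseK, NS.ok, NOp.ok, NS.eval, NOp.eval, hSt_X1, hSt_X3, hSt_X5, hSt_X6, hSt_L2, hSt_FL2, hSt_SFK, hSt_SFT,
              update_hSt_X5, update_hSt_X6, update_hSt_FL2, rdMD, v2, hx1, hx5, hx6, hl2, hfl2, hsfk, hU,
              bitsToNat_encodeNat, hgN, hN1', hle, ne_eq, EmbeddingLike.apply_eq_iff_eq, and_self, hl1n, hlN, hluu, hlK, not_false_eq_true, decide_true, decide_false,
              flag_true, flag_false, true_and, and_true, false_or, true_or, List.length_cons, List.length_nil]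
          · simp [sfCaseK, v2, v3, hx1, hx5, hx6, hl2, hfl2, hsfk, hU, hgN, hN1', hle, hps, rdMD]
          · simp [hc3, sfCaseK]
      · have hps : procSpec N α uu K = (K, some (Nat.gcd r N)) := by simp [procSpec, hg0, hg1, hgN]
        refine NS.runs_of_eq (N := n) _ _ ?_ ?_ ?_
        · simp (config := { decide := true }) only [sfCaseK, NS.ok, NOp.ok, NS.eval, NOp.eval, hSt_X1, hSt_X3, hSt_X5, hSt_X6, hSt_L2, hSt_SFBETA, hSt_SFR,
            update_hSt_X5, update_hSt_X6, update_hSt_SFR, rdMD, v2, hx1, hx5, hx6, hl2, hsfbeta,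
            bitsToNat_encodeNat, hg1, hgN, ne_eq, EmbeddingLike.apply_eq_iff_eq, and_self, hl1n, hlN, hlg, not_false_eq_true, decide_false,
            flag_false, true_and, and_true, false_or, List.length_cons, List.length_nil, zero_le]
          omega
        · simp [sfCaseK, v2, v3, hx1, hx5, hx6, hl2, hsfbeta, hsfr, hg1, hgN, hps, hsfk, rdMD]
        · simp [hc3, sfCaseK]
  have h4 : Runs ((NS.op (.clear (h .X3)) : NS β).com) (base (hSt h T v3))
      (base (hSt h T { v with sfk := encodeNat (procSpec N α uu K).1, sfr := optUpd v.sfr (procSpec N α uu K).2, sfbeta := optFlag v.sfbeta (procSpec N α uu K).2 })) (3 * c) := by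
    refine NS.runs_of_eq (N := n) _ _ (by simp only [NS.ok, NOp.ok, hSt_X3, v3, v2]; exact hlg) (by simp [v3, v2, hx3]) (by simp [hc3])
  refine (runs_whenNot_nil h (hSt h T v) (by rw [hSt_SFBETA]; exact hsfbeta) (h1.seq (h2a.seq (h2b.seq (h3.seq h4))))).mono ?_
  omega

/-- Processing one divisor when a factor was already found: nothing. [folklore] -/
theorem runs_sfProc_SFT_found (T : Regs β) (v : HSlots) (hsfbeta : v.sfbeta = [true]) : Runs (sfProc h .SFT) (base (hSt h T v)) (base (hSt h T v)) (1 + 2) :=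
  runs_whenNot_true h _ _ (by rw [hSt_SFBETA]; exact hsfbeta)

/-- **Processing one divisor**, `u` in `X2`. [folklore] -/
theorem runs_sfProc_X2 {N n e α uu K : ℕ} (hN1 : 1 < N) (hn : (encodeNat N).length + 1 ≤ n) (hen : 2 * e + 4 ≤ n) (T : Regs β) (hI : DrvInv (rGH h) N T)
    (v : HSlots) (hαN : α < N) (hbla : v.bla = encodeNat α) (hU : v.x2 = encodeNat uu) (huu : uu ≤ 2 ^ (2 * e)) (hsfk : v.sfk = encodeNat K) (hK : K ≤ 2 ^ (2 * e))
    (hx1 : v.x1 = encodeNat 1) (hx3 : v.x3 = []) (hx5 : v.x5 = []) (hx6 : v.x6 = []) (hfl2 : v.fl2 = []) (hl2 : v.l2 = []) (hsfbeta : v.sfbeta = []) (hsfr : v.sfr = []) :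
    Runs (sfProc h .X2) (base (hSt h T v))
      (base (hSt h T { v with sfk := encodeNat (procSpec N α uu K).1, sfr := optUpd v.sfr (procSpec N α uu K).2, sfbeta := optFlag v.sfbeta (procSpec N α uu K).2 }))
      (3800 * (n + 1) ^ 3) := by
  have hhq : ∀ {i j : HReg}, i ≠ j → h i ≠ h j := fun hij => hq_ne h hij
  obtain ⟨hMD, -, -, -, -, -, -, -, -, -, -, -, -, -, -, -, -, -⟩ := id hI
  have hN0 : 0 < N := by omega
  have hN1' : N ≠ 1 := by omega
  set c := (n + 1) ^ 3 with hc3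
  have hc1 : n + 1 ≤ c := by
    rw [hc3]; calc n + 1 = (n + 1) ^ 1 := (pow_one _).symm
      _ ≤ (n + 1) ^ 3 := Nat.pow_le_pow_right (by omega) (by omega)
  have rdMD : ∀ u' : HSlots, hSt h T u' (h (.g (.f (.n (.v .MD))))) = encodeNat N := fun u' => by
    rw [hSt_gv h T u' (by decide) (by decide) (by decide) (by decide) (by decide) (by decide)]; exact hMD
  have hlN : (encodeNat N).length ≤ n := by omega
  have hlα : (encodeNat α).length ≤ n := (Brick.length_encodeNat_mono hαN.le).trans hlN
  have hl2k : ∀ x, x ≤ 2 ^ (2 * e) → (encodeNat x).length ≤ n := fun x hx => length_le_of_le_two_pow_two_mul hx hen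
  have hluu : (encodeNat uu).length ≤ n := hl2k _ huu
  have hlK : (encodeNat K).length ≤ n := hl2k _ hK
  have e1 : encodeNat 1 = [true] := by simpa using encodeNat_two_pow 0
  have hl1n : (encodeNat 1).length ≤ n := by rw [e1]; simp only [List.length_cons, List.length_nil]; omega
  have hl2N : ∀ x, x ≤ 2 * N → (encodeNat x).length ≤ n := fun x hx =>
    (Brick.length_encodeNat_mono hx).trans (by rw [encodeNat_two_mul _ hN0]; simp only [List.length_cons]; omega)
  set x := α ^ uu % N with hx0
  have hxN : x < N := Nat.mod_lt _ hN0
  have hlx : (encodeNat x).length ≤ n := (Brick.length_encodeNat_mono hxN.le).trans hlN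
  have hl3 : (encodeNat (x + N)).length ≤ n := hl2N _ (by omega)
  have hl4 : (encodeNat (x + N - 1)).length ≤ n := hl2N _ (by omega)
  have hl5 : (encodeNat ((x + N - 1) / N)).length ≤ n := hl2N _ ((Nat.div_le_self _ _).trans (by omega))
  set r := (x + N - 1) % N with hr0
  have hlr : (encodeNat r).length ≤ n := (Brick.length_encodeNat_mono (Nat.mod_lt _ hN0).le).trans hlN
  have hg0 : powGcd N α uu = Nat.gcd r N := by rw [powGcd, hr0, hx0]
  have hlg : (encodeNat (Nat.gcd r N)).length ≤ n := (Brick.length_encodeNat_mono (Nat.gcd_le_right _ hN0)).trans hlN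
  have hone : 1 ≤ x + N := by omega
  -- the residue and its gcd
  let v1 : HSlots := { v with x5 := encodeNat r }
  have h1 : Runs (sfPowSub h .X2).com (base (hSt h T v)) (base (hSt h T v1)) (2398 * c) := by
    refine NS.runs_of_eq (N := n) _ _ ?_ ?_ (by simp [hc3, sfPowSub])
    · simp (config := { decide := true }) only [sfPowSub, NS.ofList, NS.ok, NOp.ok, NS.eval, NOp.eval, hSt_X1, hSt_X3, hSt_X5, hSt_X6, hSt_BLA, hSt_X2,
        update_hSt_X3, update_hSt_X5, update_hSt_X6, hx1, hx3, hx5, hx6, hbla, hU, rdMD, bitsToNat_encodeNat, ne_eq, EmbeddingLike.apply_eq_iff_eq,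
        List.length_nil, zero_le, and_self, hlα, hluu, hlN, hN1, hN0, hlx, hl3, hl4, hl5, hl1n, hone, ← hx0, not_false_eq_true]
    · simp [sfPowSub, v1, hx1, hx3, hx5, hx6, hbla, hU, rdMD, ← hx0, ← hr0]
  let v2 : HSlots := { v with x3 := encodeNat (Nat.gcd r N) }
  have h2a : Runs (nGcd (h .X3) (h .X5) (h (.g (.f (.n (.v .MD)))))) (base (hSt h T v1)) (base (Function.update (hSt h T v1) (h .X3) (encodeNat (Nat.gcd r N)))) (1000 * c) := by
    have g1 := runs_nGcd (h .X3) (h .X5) (h (.g (.f (.n (.v .MD))))) (hSt h T v1) (x := r) (y := N) (n := n) (by simp [v1]) (rdMD v1) hlr hlN (by simp [v1, hx3])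
    exact g1.of_eq rfl (by simp [hc3])
  have h2b : Runs ((NS.op (.clear (h .X5)) : NS β).com) (base (Function.update (hSt h T v1) (h .X3) (encodeNat (Nat.gcd r N)))) (base (hSt h T v2)) (3 * c) := by
    rw [update_hSt_X3]
    refine NS.runs_of_eq (N := n) _ _ (by simp only [NS.ok, NOp.ok, hSt_X5, v1]; exact hlr) (by simp [v1, v2, hx5]) (by simp [hc3])
  -- the casework
  let v3 : HSlots := { v2 with sfk := encodeNat (procSpec N α uu K).1, sfr := optUpd v.sfr (procSpec N α uu K).2, sfbeta := optFlag v.sfbeta (procSpec N α uu K).2 }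
  have h3 : Runs (sfCaseK h .X2).com (base (hSt h T v2)) (base (hSt h T v3)) (350 * c) := by
    by_cases hg1 : Nat.gcd r N = 1
    · have hps : procSpec N α uu K = (K, none) := by simp [procSpec, hg0, hg1]
      refine NS.runs_of_eq (N := n) _ _ ?_ ?_ ?_
      · simp (config := { decide := true }) only [sfCaseK, NS.ok, NOp.ok, NS.eval, NOp.eval, hSt_X1, hSt_X3, hSt_X5, hSt_L2, update_hSt_X5, v2, hx1, hx5, hl2,
          bitsToNat_encodeNat, hg1, ne_eq, EmbeddingLike.apply_eq_iff_eq, and_self, hl1n, not_false_eq_true, decide_true, flag_true, true_and, true_or]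
      · simp [sfCaseK, v2, v3, hx1, hx5, hl2, hg1, hps, hsfk]
      · simp [hc3, sfCaseK]
    · by_cases hgN : Nat.gcd r N = N
      · by_cases hlt : uu < K
        · have hps : procSpec N α uu K = (uu, none) := by simp [procSpec, hg0, hgN, hN1', hlt]
          have hnle : ¬ K ≤ uu := by omega
          refine NS.runs_of_eq (N := n) _ _ ?_ ?_ ?_
          · simp (config := { decide := true }) only [sfCaseK, NS.ok, NOp.ok, NS.eval, NOp.eval, hSt_X1, hSt_X3, hSt_X5, hSt_X6, hSt_L2, hSt_FL2, hSt_SFK, hSt_X2,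
              hSt_SFR, update_hSt_X5, update_hSt_X6, update_hSt_FL2, update_hSt_SFK, rdMD, v2, hx1, hx5, hx6, hl2, hfl2, hsfk, hU, hsfr, hsfbeta,
              bitsToNat_encodeNat, hgN, hN1', hnle, ne_eq, EmbeddingLike.apply_eq_iff_eq, and_self, hl1n, hlN, hluu, hlK, not_false_eq_true, decide_true, decide_false,
              flag_true, flag_false, true_and, and_true, false_or, or_false, false_and, List.length_cons, List.length_nil]
            try omega
          · simp [sfCaseK, v2, v3, hx1, hx5, hx6, hl2, hfl2, hsfk, hU, hgN, hN1', hnle, hps, rdMD]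
          · simp [hc3, sfCaseK]
        · have hps : procSpec N α uu K = (K, none) := by simp [procSpec, hg0, hgN, hN1', hlt]
          have hle : K ≤ uu := by omega
          refine NS.runs_of_eq (N := n) _ _ ?_ ?_ ?_
          · simp (config := { decide := true }) only [sfCaseK, NS.ok, NOp.ok, NS.eval, NOp.eval, hSt_X1, hSt_X3, hSt_X5, hSt_X6, hSt_L2, hSt_FL2, hSt_SFK, hSt_X2,
              update_hSt_X5, update_hSt_X6, update_hSt_FL2, rdMD, v2, hx1, hx5, hx6, hl2, hfl2, hsfk, hU,
              bitsToNat_encodeNat, hgN, hN1', hle, ne_eq, EmbeddingLike.apply_eq_iff_eq, and_self, hl1n, hlN, hluu, hlK, not_false_eq_true, decide_true, decide_false,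
              flag_true, flag_false, true_and, and_true, false_or, true_or, List.length_cons, List.length_nil]
          · simp [sfCaseK, v2, v3, hx1, hx5, hx6, hl2, hfl2, hsfk, hU, hgN, hN1', hle, hps, rdMD]
          · simp [hc3, sfCaseK]
      · have hps : procSpec N α uu K = (K, some (Nat.gcd r N)) := by simp [procSpec, hg0, hg1, hgN]
        refine NS.runs_of_eq (N := n) _ _ ?_ ?_ ?_
        · simp (config := { decide := true }) only [sfCaseK, NS.ok, NOp.ok, NS.eval, NOp.eval, hSt_X1, hSt_X3, hSt_X5, hSt_X6, hSt_L2, hSt_SFBETA, hSt_SFR,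
            update_hSt_X5, update_hSt_X6, update_hSt_SFR, rdMD, v2, hx1, hx5, hx6, hl2, hsfbeta,
            bitsToNat_encodeNat, hg1, hgN, ne_eq, EmbeddingLike.apply_eq_iff_eq, and_self, hl1n, hlN, hlg, not_false_eq_true, decide_false,
            flag_false, true_and, and_true, false_or, List.length_cons, List.length_nil, zero_le]
          omega
        · simp [sfCaseK, v2, v3, hx1, hx5, hx6, hl2, hsfbeta, hsfr, hg1, hgN, hps, hsfk, rdMD]
        · simp [hc3, sfCaseK]
  have h4 : Runs ((NS.op (.clear (h .X3)) : NS β).com) (base (hSt h T v3))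
      (base (hSt h T { v with sfk := encodeNat (procSpec N α uu K).1, sfr := optUpd v.sfr (procSpec N α uu K).2, sfbeta := optFlag v.sfbeta (procSpec N α uu K).2 })) (3 * c) := by
    refine NS.runs_of_eq (N := n) _ _ (by simp only [NS.ok, NOp.ok, hSt_X3, v3, v2]; exact hlg) (by simp [v3, v2, hx3]) (by simp [hc3])
  refine (runs_whenNot_nil h (hSt h T v) (by rw [hSt_SFBETA]; exact hsfbeta) (h1.seq (h2a.seq (h2b.seq (h3.seq h4))))).mono ?_
  omega

/-- Processing one divisor when a factor was already found: nothing. [folklore] -/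
theorem runs_sfProc_X2_found (T : Regs β) (v : HSlots) (hsfbeta : v.sfbeta = [true]) : Runs (sfProc h .X2) (base (hSt h T v)) (base (hSt h T v)) (1 + 2) :=
  runs_whenNot_true h _ _ (by rw [hSt_SFBETA]; exact hsfbeta)

/-- The new `K` of one divisor is the old one or the divisor. [folklore] -/
theorem procSpec_fst_or (N α u K : ℕ) : (procSpec N α u K).1 = K ∨ (procSpec N α u K).1 = u := by
  unfold procSpec; split_ifs <;> simp

/-- The factor flag of one divisor. [folklore] -/
theorem procSpec_snd (N α u K : ℕ) : (procSpec N α u K).2 = none ∨ (procSpec N α u K).2 = some (powGcd N α u) := by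
  unfold procSpec; split_ifs <;> simp

/-- `K` stays below `e*` along the casework (`e* ≥ 1`). [folklore] -/
theorem divRun_fst_le (N α : ℕ) {es : ℕ} (hes : 1 ≤ es) : ∀ j, (divRun N α es j).1 ≤ es
  | 0 => le_rfl
  | j + 1 => by
    have ih := divRun_fst_le N α hes j
    rw [divRun]
    generalize divRun N α es j = s at ih ⊢
    obtain ⟨K, f⟩ := s
    simp only at ih
    unfold sfDivStep
    cases f with
    | some g => simpa using ih
    | none =>
      simp only
      split_ifs with hd
      · have ht : j + 1 ≤ es := Nat.le_of_dvd (by omega) (Nat.dvd_of_mod_eq_zero hd)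
        have hq : es / (j + 1) ≤ es := Nat.div_le_self _ _
        rcases procSpec_fst_or N α (j + 1) K with h1 | h1 <;>
          rcases procSpec_snd N α (j + 1) K with h2 | h2
        · rw [show procSpec N α (j + 1) K = ((procSpec N α (j + 1) K).1, (procSpec N α (j + 1) K).2) from rfl, h1, h2]
          simp only
          rcases procSpec_fst_or N α (es / (j + 1)) K with h3 | h3 <;> omega
        · rw [show procSpec N α (j + 1) K = ((procSpec N α (j + 1) K).1, (procSpec N α (j + 1) K).2) from rfl, h1, h2]
          simpa using ih
        · rw [show procSpec N α (j + 1) K = ((procSpec N α (j + 1) K).1, (procSpec N α (j + 1) K).2) from rfl, h1, h2]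
          simp only
          rcases procSpec_fst_or N α (es / (j + 1)) (j + 1) with h3 | h3 <;> omega
        · rw [show procSpec N α (j + 1) K = ((procSpec N α (j + 1) K).1, (procSpec N α (j + 1) K).2) from rfl, h1, h2]
          simpa using ht
      · simpa using ih

/-- `K` stays positive along the casework (`e* ≥ 1`). [folklore] -/
theorem divRun_fst_pos (N α : ℕ) {es : ℕ} (hes : 1 ≤ es) : ∀ j, 1 ≤ (divRun N α es j).1
  | 0 => hes
  | j + 1 => by
    have ih := divRun_fst_pos N α hes j
    rw [divRun]
    generalize divRun N α es j = s at ih ⊢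
    obtain ⟨K, f⟩ := s
    simp only at ih
    unfold sfDivStep
    cases f with
    | some g => simpa using ih
    | none =>
      simp only
      split_ifs with hd
      · have ht : j + 1 ≤ es := Nat.le_of_dvd (by omega) (Nat.dvd_of_mod_eq_zero hd)
        have hq : 1 ≤ es / (j + 1) := Nat.div_pos ht (by omega)
        rcases procSpec_fst_or N α (j + 1) K with h1 | h1 <;>
          rcases procSpec_snd N α (j + 1) K with h2 | h2
        · rw [show procSpec N α (j + 1) K = ((procSpec N α (j + 1) K).1, (procSpec N α (j + 1) K).2) from rfl, h1, h2]
          simp only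
          rcases procSpec_fst_or N α (es / (j + 1)) K with h3 | h3 <;> omega
        · rw [show procSpec N α (j + 1) K = ((procSpec N α (j + 1) K).1, (procSpec N α (j + 1) K).2) from rfl, h1, h2]
          simpa using ih
        · rw [show procSpec N α (j + 1) K = ((procSpec N α (j + 1) K).1, (procSpec N α (j + 1) K).2) from rfl, h1, h2]
          simp only
          rcases procSpec_fst_or N α (es / (j + 1)) (j + 1) with h3 | h3 <;> omega
        · rw [show procSpec N α (j + 1) K = ((procSpec N α (j + 1) K).1, (procSpec N α (j + 1) K).2) from rfl, h1, h2]
          simp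
      · simpa using ih

/-- **One round of the divisor casework.** [folklore] -/
theorem runs_sfDivBody {N n e α es t K : ℕ} {fnd : Option ℕ} (hN1 : 1 < N) (hn : (encodeNat N).length + 1 ≤ n) (hen : 2 * e + 4 ≤ n) (T : Regs β) (hI : DrvInv (rGH h) N T)
    (v : HSlots) (hαN : α < N) (hbla : v.bla = encodeNat α) (ht1 : 1 ≤ t) (htk : t ≤ 2 ^ (2 * e)) (hes : es ≤ 2 ^ (2 * e)) (hK : K ≤ 2 ^ (2 * e))
    (hsft : v.sft = encodeNat t) (hsfe : v.sfe = encodeNat es) (hsfk : v.sfk = encodeNat K) (hsfr : v.sfr = optUpd [] fnd) (hsfbeta : v.sfbeta = optFlag [] fnd)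
    (hx1 : v.x1 = encodeNat 1) (hx2 : v.x2 = []) (hx3 : v.x3 = []) (hx5 : v.x5 = []) (hx6 : v.x6 = []) (hfl1 : v.fl1 = []) (hfl2 : v.fl2 = []) (hl2 : v.l2 = []) :
    Runs (sfDivBody h) (base (hSt h T v))
      (base (hSt h T { v with sft := encodeNat (t + 1), sfk := encodeNat (sfDivStep N α es t (K, fnd)).1, sfr := optUpd [] (sfDivStep N α es t (K, fnd)).2,
                              sfbeta := optFlag [] (sfDivStep N α es t (K, fnd)).2 })) (8200 * (n + 1) ^ 3) := by
  have hhq : ∀ {i j : HReg}, i ≠ j → h i ≠ h j := fun hij => hq_ne h hij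
  have hN0 : 0 < N := by omega
  set c := (n + 1) ^ 3 with hc3
  have hc1 : n + 1 ≤ c := by
    rw [hc3]; calc n + 1 = (n + 1) ^ 1 := (pow_one _).symm
      _ ≤ (n + 1) ^ 3 := Nat.pow_le_pow_right (by omega) (by omega)
  have hl2k : ∀ x, x ≤ 2 ^ (2 * e) → (encodeNat x).length ≤ n := fun x hx => length_le_of_le_two_pow_two_mul hx hen
  have hlt : (encodeNat t).length ≤ n := hl2k _ htk
  have hlt1 : (encodeNat (t + 1)).length ≤ n :=
    (Brick.length_encodeNat_mono (show t + 1 ≤ 2 ^ (2 * e + 1) by rw [pow_succ]; have := Nat.one_le_two_pow (n := 2 * e); omega)).trans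
      (by rw [encodeNat_two_pow]; simp; omega)
  have hles : (encodeNat es).length ≤ n := hl2k _ hes
  have hlq : (encodeNat (es / t)).length ≤ n := hl2k _ ((Nat.div_le_self _ _).trans hes)
  have hlrm : (encodeNat (es % t)).length ≤ n := hl2k _ ((Nat.mod_lt _ (by omega)).le.trans htk)
  have hqle : es / t ≤ 2 ^ (2 * e) := (Nat.div_le_self _ _).trans hes
  -- divisibility
  let v1 : HSlots := { v with x2 := encodeNat (es / t), x5 := flag (decide (es % t = 0)) }
  have g1 : Runs ((NS.ofList [.divMod (h .X2) (h .X3) (h .SFE) (h .SFT), .eq (h .X5) (h .X3) (h .FL1) (h .L2), .clear (h .X3)] : NS β).com)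
      (base (hSt h T v)) (base (hSt h T v1)) (470 * c) := by
    refine NS.runs_of_eq (N := n) _ _ ?_ ?_ (by simp [hc3])
    · simp (config := { decide := true }) only [NS.ofList, NS.ok, NOp.ok, NS.eval, NOp.eval, hSt_X2, hSt_X3, hSt_X5, hSt_SFE, hSt_SFT, hSt_FL1, hSt_L2,
        update_hSt_X2, update_hSt_X3, update_hSt_X5, hx2, hx3, hx5, hsfe, hsft, hfl1, hl2, bitsToNat_encodeNat, ne_eq, EmbeddingLike.apply_eq_iff_eq,
        List.length_nil, zero_le, and_self, hles, hlt, hlrm, not_false_eq_true, true_and, and_true]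
      omega
    · simp [v1, hx3, hx5, hsfe, hsft, hfl1]
  -- the tail
  have g3 : ∀ (w : HSlots) (K' : ℕ) (f' : Option ℕ), w.x2 = encodeNat (es / t) → w.x3 = [] → w.sft = encodeNat t →
      Runs ((NS.ofList [.clear (h .X2), .succ (h .X3) (h .SFT), .clear (h .SFT), .move (h .X3) (h .SFT)] : NS β).com) (base (hSt h T w))
        (base (hSt h T { w with x2 := [], sft := encodeNat (t + 1) })) (86 * c) := by
    intro w K' f' e2 e3 e4
    refine NS.runs_of_eq (N := n) _ _ ?_ ?_ (by simp [hc3])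
    · simp (config := { decide := true }) only [NS.ofList, NS.ok, NOp.ok, NS.eval, NOp.eval, hSt_X2, hSt_X3, hSt_SFT, update_hSt_X2, update_hSt_X3, update_hSt_SFT,
        e2, e3, e4, bitsToNat_encodeNat, ne_eq, EmbeddingLike.apply_eq_iff_eq, List.length_nil, zero_le, and_self, hlq, hlt, hlt1, not_false_eq_true]
    · simp [e3, e4]
  by_cases hd : es % t = 0
  · -- divisible: the pair (t, es / t)
    have hflag : v1.x5 = [true] := by simp [v1, hd]
    let v1' : HSlots := { v1 with x5 := [] }
    have hpop : ∀ {R' : Regs (EReg ⊕ β)} {B : ℕ}, Runs (sfProc h .SFT ;; sfProc h .X2) (base (hSt h T v1')) R' B →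
        Runs (Com.pop (Sum.inr (h .X5)) (sfProc h .SFT ;; sfProc h .X2) skip skip) (base (hSt h T v1)) R' (B + 2) := fun hb =>
      Runs.opop_true _ _ (by rw [hSt_X5]; exact hflag) (by rw [update_hSt_X5]; exact hb)
    cases hf : fnd with
    | some g =>
      rw [hf] at hsfr hsfbeta
      have p1 := runs_sfProc_SFT_found h T v1' (by simp [v1', v1, hsfbeta])
      have p2 := runs_sfProc_X2_found h T v1' (by simp [v1', v1, hsfbeta])
      have hstep : sfDivStep N α es t (K, some g) = (K, some g) := by simp [sfDivStep]
      refine (g1.seq ((hpop (p1.seq p2)).seq (g3 v1' K (some g) (by simp [v1', v1]) (by simp [v1', v1, hx3]) (by simp [v1', v1, hsft])))).of_eq ?_ ?_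
      · simp [v1', v1, hx2, hx5, hstep, hsfk, hsfr, hsfbeta]
      · omega
    | none =>
      rw [hf] at hsfr hsfbeta
      simp only [optUpd_none, optFlag_none] at hsfr hsfbeta
      have p1 := runs_sfProc_SFT h hN1 hn hen T hI v1' hαN (by simp [v1', v1, hbla]) (by simp [v1', v1, hsft]) htk (by simp [v1', v1, hsfk]) hK
        (by simp [v1', v1, hx1]) (by simp [v1', v1, hx3]) (by simp [v1']) (by simp [v1', v1, hx6]) (by simp [v1', v1, hfl2]) (by simp [v1', v1, hl2])
        (by simp [v1', v1, hsfbeta]) (by simp [v1', v1, hsfr])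
      set s1 := procSpec N α t K with hs1
      let v2 : HSlots := { v1' with sfk := encodeNat s1.1, sfr := optUpd [] s1.2, sfbeta := optFlag [] s1.2 }
      have hp1 : Runs (sfProc h .SFT) (base (hSt h T v1')) (base (hSt h T v2)) (3800 * c) := by
        refine p1.of_eq ?_ le_rfl; simp [v2, v1', v1, hsfr, hsfbeta]
      have hK1 : s1.1 ≤ 2 ^ (2 * e) := by rcases procSpec_fst_or N α t K with h1 | h1 <;> rw [hs1, h1] <;> assumption
      cases hs2 : s1.2 with
      | some g =>
        have p2 := runs_sfProc_X2_found h T v2 (by simp [v2, hs2])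
        have hstep : sfDivStep N α es t (K, none) = (s1.1, some g) := by
          simp only [sfDivStep, hd, if_true]
          rw [show procSpec N α t K = (s1.1, s1.2) from rfl, hs2]
        refine (g1.seq ((hpop (hp1.seq p2)).seq (g3 v2 s1.1 (some g) (by simp [v2, v1', v1]) (by simp [v2, v1', v1, hx3]) (by simp [v2, v1', v1, hsft])))).of_eq ?_ ?_
        · simp [v2, v1', v1, hx2, hx5, hstep, hs2]
        · omega
      | none =>
        have p2 := runs_sfProc_X2 h hN1 hn hen T hI v2 hαN (by simp [v2, v1', v1, hbla]) (by simp [v2, v1', v1]) hqle (by simp [v2]) hK1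
          (by simp [v2, v1', v1, hx1]) (by simp [v2, v1', v1, hx3]) (by simp [v2, v1']) (by simp [v2, v1', v1, hx6]) (by simp [v2, v1', v1, hfl2]) (by simp [v2, v1', v1, hl2])
          (by simp [v2, hs2]) (by simp [v2, hs2])
        have hstep : sfDivStep N α es t (K, none) = procSpec N α (es / t) s1.1 := by
          simp only [sfDivStep, hd, if_true]
          rw [show procSpec N α t K = (s1.1, s1.2) from rfl, hs2]
        refine (g1.seq ((hpop (hp1.seq p2)).seq (g3 _ s1.1 none (by simp [v2, v1', v1]) (by simp [v2, v1', v1, hx3]) (by simp [v2, v1', v1, hsft])))).of_eq ?_ ?_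
        · simp [v2, v1', v1, hx2, hx5, hstep, hs2]
        · omega
  · -- not divisible: nothing
    have hflag : v1.x5 = [] := by simp [v1, hd]
    have hpop : Runs (Com.pop (Sum.inr (h .X5)) (sfProc h .SFT ;; sfProc h .X2) skip skip) (base (hSt h T v1)) (base (hSt h T v1)) (0 + 2) :=
      Runs.opop_nil _ _ (by rw [hSt_X5]; exact hflag) (Runs.skip _)
    have hstep : sfDivStep N α es t (K, fnd) = (K, fnd) := by
      cases fnd with
      | some g => simp [sfDivStep]
      | none => simp [sfDivStep, hd]
    refine (g1.seq (hpop.seq (g3 v1 K fnd (by simp [v1]) (by simp [v1, hx3]) (by simp [v1, hsft])))).of_eq ?_ ?_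
    · simp [v1, hx2, hx5, hstep, hsfk, hsfr, hsfbeta, hd]
    · omega

/-- Cost of the divisor casework. [folklore] -/
def sfDivsCost (n e : ℕ) : ℕ :=
  ((n * (16 * e + 21) + 3 * e + 7) + 436 * (n + 1) ^ 3 + ((e + 1) * (16 * 2 ^ e + 21) + 5) + 3 * (n + 1) ^ 3) + (2 ^ e * (8200 * (n + 1) ^ 3 + 2) + 1) + 3 * (n + 1) ^ 3

/-- **The divisor casework** on the exponent of the exact hit. [folklore] -/
theorem runs_sfDivs {N n e α h₀ i₀ : ℕ} (hN1 : 1 < N) (hn : (encodeNat N).length + 1 ≤ n) (hen : 2 * e + 4 ≤ n) (T : Regs β) (hI : DrvInv (rGH h) N T)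
    (u : HSlots) (hαN : α < N) (hbla : u.bla = encodeNat α) (hh₀ : h₀ < 2 ^ e) (hi₀ : i₀ < 2 ^ e)
    (ha1i : u.a1i = encodeNat h₀) (hblg : u.blg = encodeNat i₀) (ha1p : u.a1p = encodeNat e)
    (hx1 : u.x1 = encodeNat 1) (hx2 : u.x2 = []) (hx3 : u.x3 = []) (hx4 : u.x4 = []) (hx5 : u.x5 = []) (hx6 : u.x6 = []) (hfl1 : u.fl1 = []) (hfl2 : u.fl2 = [])
    (hl2 : u.l2 = []) (hu1 : u.u1 = []) (hsfe : u.sfe = []) (hsfk : u.sfk = []) (hsft : u.sft = []) (hsfr : u.sfr = []) (hsfbeta : u.sfbeta = []) :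
    Runs (sfDivs h) (base (hSt h T u))
      (base (hSt h T { u with sfe := encodeNat ((h₀ + 1) * 2 ^ e - i₀), sfk := encodeNat (divRun N α ((h₀ + 1) * 2 ^ e - i₀) (2 ^ e)).1,
                              sfr := optUpd [] (divRun N α ((h₀ + 1) * 2 ^ e - i₀) (2 ^ e)).2, sfbeta := optFlag [] (divRun N α ((h₀ + 1) * 2 ^ e - i₀) (2 ^ e)).2 }))
      (sfDivsCost n e) := by
  set c := (n + 1) ^ 3 with hc3
  set es := (h₀ + 1) * 2 ^ e - i₀ with hes0
  have h22 : 2 ^ e * 2 ^ e = 2 ^ (2 * e) := by rw [← pow_add, two_mul]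
  have hes : es ≤ 2 ^ (2 * e) := by rw [hes0, ← h22]; exact (Nat.sub_le _ _).trans (Nat.mul_le_mul_right _ hh₀)
  have hes1 : 1 ≤ es := by
    rw [hes0]; have : 2 ^ e ≤ (h₀ + 1) * 2 ^ e := Nat.le_mul_of_pos_left _ (by omega); omega
  have hek : 2 ^ e ≤ 2 ^ (2 * e) := Nat.pow_le_pow_right (by omega) (by omega)
  have h1 := runs_sfEstar h hen T hI u hh₀ hi₀ ha1i hblg ha1p hx2 hx3 hx4 hu1 hsfe hsfk hsft
  rw [← hes0] at h1
  let dst : ℕ → HSlots := fun j =>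
    { u with sfe := encodeNat es, u1 := List.replicate (2 ^ e - j) true, sft := encodeNat (j + 1), sfk := encodeNat (divRun N α es j).1, sfr := optUpd [] (divRun N α es j).2, sfbeta := optFlag [] (divRun N α es j).2 }
  have hstart : ({ u with sfe := encodeNat es, sfk := encodeNat es, sft := encodeNat 1, u1 := List.replicate (2 ^ e) true } : HSlots) = dst 0 := by
    simp [dst, divRun, hsfr, hsfbeta]
  rw [hstart] at h1
  have hbody : ∀ j, j + 1 ≤ 2 ^ e → Runs (sfDivBody h) (base (hSt h T { dst j with u1 := List.replicate (2 ^ e - (j + 1)) true })) (base (hSt h T (dst (j + 1)))) (8200 * c) := by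
    intro j hj
    have hK := divRun_fst_le N α hes1 j
    refine (runs_sfDivBody h (es := es) (t := j + 1) (K := (divRun N α es j).1) (fnd := (divRun N α es j).2) hN1 hn hen T hI _ hαN (by simp [dst, hbla]) (by omega)
      (by omega) hes (hK.trans hes) (by simp [dst]) (by simp [dst]) (by simp [dst]) (by simp [dst]) (by simp [dst]) (by simp [dst, hx1]) (by simp [dst, hx2])
      (by simp [dst, hx3]) (by simp [dst, hx5]) (by simp [dst, hx6]) (by simp [dst, hfl1]) (by simp [dst, hfl2]) (by simp [dst, hl2])).of_eq ?_ le_rfl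
    simp [dst, divRun]
  have hL := runs_countLoop (U := (Sum.inr (h .U1) : EReg ⊕ β)) (body := sfDivBody h) (fun i R => i ≤ 2 ^ e ∧ R = base (hSt h T (dst (2 ^ e - i)))) (8200 * c)
    (by
      rintro i R ⟨hi, rfl⟩ -
      have : Function.update (base (hSt h T (dst (2 ^ e - (i + 1))))) (Sum.inr (h .U1)) (List.replicate i true) =
          base (hSt h T { dst (2 ^ e - (i + 1)) with u1 := List.replicate (2 ^ e - (2 ^ e - (i + 1) + 1)) true }) := by
        have : 2 ^ e - (2 ^ e - (i + 1) + 1) = i := by omega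
        simp [dst, this]
      rw [this]
      refine ⟨_, hbody (2 ^ e - (i + 1)) (by omega), ?_, by omega, ?_⟩
      · have : 2 ^ e - (2 ^ e - (i + 1) + 1) = i := by omega
        simp [dst, this]
      · have : 2 ^ e - (i + 1) + 1 = 2 ^ e - i := by omega
        rw [this])
    (2 ^ e) (base (hSt h T (dst 0))) ⟨le_rfl, by simp⟩ (by simp [dst])
  obtain ⟨R', hR, -, -, rfl⟩ := hL
  simp only [Nat.sub_zero] at hR
  have hl : (encodeNat (2 ^ e + 1)).length ≤ n :=
    (Brick.length_encodeNat_mono (show 2 ^ e + 1 ≤ 2 ^ (2 * e + 1) by rw [pow_succ]; omega)).trans (by rw [encodeNat_two_pow]; simp; omega)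
  have h3 : Runs ((NS.op (.clear (h .SFT)) : NS β).com) (base (hSt h T (dst (2 ^ e))))
      (base (hSt h T { u with sfe := encodeNat es, sfk := encodeNat (divRun N α es (2 ^ e)).1, sfr := optUpd [] (divRun N α es (2 ^ e)).2, sfbeta := optFlag [] (divRun N α es (2 ^ e)).2 })) (3 * c) := by
    refine NS.runs_of_eq (N := n) _ _ (by simp only [NS.ok, NOp.ok, hSt_SFT, dst]; exact hl) ?_ (by simp [hc3])
    simp [dst, hu1, hsft]
  refine (h1.seq (hR.seq h3)).of_eq rfl ?_
  simp only [sfDivsCost, ← hc3]; omega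

/-! #### The modulus `L := lcm(L, K)` and the trial division of the class `1 (mod L)` -/

/-- `L := (L / gcd(L, K)) · K`. [folklore] -/
def sfLcm : Com (EReg ⊕ β) :=
  nGcd (h .X2) (h .SFL) (h .SFK) ;;
  ((NS.ofList [.divMod (h .X3) (h .X4) (h .SFL) (h .X2), .clear (h .SFL), .mul (h .SFL) (h .X3) (h .SFK), .clear (h .X2), .clear (h .X3), .clear (h .X4),
      .clear (h .SFK)] : NS β).com)

/-- **The `lcm` update.** [folklore] -/
theorem runs_sfLcm {n L K : ℕ} (T : Regs β) (u : HSlots) (hL : 1 ≤ L) (hlL : (encodeNat L).length ≤ n) (hlK : (encodeNat K).length ≤ n)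
    (hsfl : u.sfl = encodeNat L) (hsfk : u.sfk = encodeNat K) (hx2 : u.x2 = []) (hx3 : u.x3 = []) (hx4 : u.x4 = []) :
    Runs (sfLcm h) (base (hSt h T u)) (base (hSt h T { u with sfl := encodeNat (Nat.lcm L K), sfk := [] })) (1000 * (n + 1) ^ 3 + 635 * (n + 1) ^ 3) := by
  have hhq : ∀ {i j : HReg}, i ≠ j → h i ≠ h j := fun hij => hq_ne h hij
  set c := (n + 1) ^ 3 with hc3
  set g := Nat.gcd L K with hg0
  have hg1 : 1 ≤ g := Nat.gcd_pos_of_pos_left _ (by omega)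
  have hgL : g ∣ L := Nat.gcd_dvd_left _ _
  have hlg : (encodeNat g).length ≤ n := (Brick.length_encodeNat_mono (Nat.le_of_dvd (by omega) hgL)).trans hlL
  have hlq : (encodeNat (L / g)).length ≤ n := (Brick.length_encodeNat_mono (Nat.div_le_self _ _)).trans hlL
  have hlcm : L / g * K = Nat.lcm L K := by
    rw [Nat.lcm, hg0, Nat.div_mul_right_comm (Nat.gcd_dvd_left L K) K]
  have h1 := runs_nGcd (h .X2) (h .SFL) (h .SFK) (hSt h T u) (x := L) (y := K) (n := n) (by rw [hSt_SFL]; exact hsfl) (by rw [hSt_SFK]; exact hsfk) hlL hlK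
    (by rw [hSt_X2, hx2]; simp)
  rw [update_hSt_X2, ← hg0] at h1
  have h2 : Runs ((NS.ofList [.divMod (h .X3) (h .X4) (h .SFL) (h .X2), .clear (h .SFL), .mul (h .SFL) (h .X3) (h .SFK), .clear (h .X2), .clear (h .X3), .clear (h .X4),
      .clear (h .SFK)] : NS β).com) (base (hSt h T { u with x2 := encodeNat g })) (base (hSt h T { u with sfl := encodeNat (Nat.lcm L K), sfk := [] })) (635 * c) := by
    refine NS.runs_of_eq (N := n) _ _ ?_ ?_ (by simp [hc3])
    · have hl0 : (encodeNat (L % g)).length ≤ n := (Brick.length_encodeNat_mono ((Nat.mod_lt _ (by omega)).le.trans (Nat.le_of_dvd (by omega) hgL))).trans hlL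
      simp (config := { decide := true }) only [NS.ofList, NS.ok, NOp.ok, NS.eval, NOp.eval, hSt_X2, hSt_X3, hSt_X4, hSt_SFL, hSt_SFK, update_hSt_X3, update_hSt_X4,
        update_hSt_SFL, update_hSt_X2, hsfl, hsfk, hx3, hx4, bitsToNat_encodeNat, ne_eq, EmbeddingLike.apply_eq_iff_eq, List.length_nil, zero_le, and_self,
        hlL, hlK, hlg, hlq, hl0, hlcm, not_false_eq_true, true_and, and_true]
      omega
    · simp [hsfl, hsfk, hx2, hx3, hx4, hlcm]
  exact (h1.seq h2).of_eq rfl (by simp [hc3])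

/-- The first `x` in `1 … X` whose candidate `1 + xL` is a proper divisor of `N`. [folklore] -/
def classHit (N L : ℕ) (x : ℕ) : Bool := decide (N % (1 + (x + 1) * L) = 0 ∧ 1 + (x + 1) * L < N)

/-- One candidate of the class: `q := q + L`, `N mod q`, and if `q ∣ N`, `q < N`: the factor. [folklore] -/
def sfClassBody : Com (EReg ⊕ β) :=
  whenNot h .SFBETA
    ((NS.seq (NS.ofList [.add (h .X2) (h .SFCAND) (h .SFL), .clear (h .SFCAND), .move (h .X2) (h .SFCAND),
        .divMod (h .X2) (h .X3) (h (.g (.f (.n (.v .MD))))) (h .SFCAND), .eq (h .X5) (h .X3) (h .FL1) (h .L2), .clear (h .X2), .clear (h .X3)])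
      (NS.ite (h .X5) (NS.seq (NS.op (.cmp (h .X6) (h .SFCAND) (h (.g (.f (.n (.v .MD))))))) (NS.ite (h .X6) NS.nop
        (NS.seq (NS.op (.copy (h .SFCAND) (h .SFR))) (NS.op (.const (h .SFBETA) [true]))))) NS.nop) : NS β).com)

/-- The trial division of the class `1 (mod L)` up to `SFM`: `X := SFM / L` candidates, then the result
code `SFD := 1` (factor) or `3` (none) and the stop flag `SFDIVS`. [folklore] -/
def sfClass : Com (EReg ⊕ β) :=
  ((NS.ofList [.divMod (h .X2) (h .X3) (h .SFM) (h .SFL), .clear (h .X3), .const (h .SFCAND) (encodeNat 1)] : NS β).com) ;;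
  (nToUnary (h .U1) (h .X2) ;;
  ((NS.op (.clear (h .X2)) : NS β).com ;;
  (countLoop (Sum.inr (h .U1)) (sfClassBody h) ;;
  (NS.seq (NS.ofList [.clear (h .SFCAND), .copy (h .SFBETA) (h .X5), .const (h .SFDIVS) [true]])
    (NS.ite (h .X5) (NS.op (.const (h .SFD) (encodeNat 1))) (NS.op (.const (h .SFD) (encodeNat 3)))) : NS β).com)))

/-- The state of the class search after `x` candidates, `i` rounds to go: searching. [folklore] -/
def HSlots.srchC (u : HSlots) (L i x : ℕ) : HSlots := { u with u1 := List.replicate i true, sfcand := encodeNat (1 + x * L) }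

/-- The state of the class search after the hit at `x₀`, `i` rounds to go. [folklore] -/
def HSlots.fndC (u : HSlots) (L i x₀ : ℕ) : HSlots :=
  { u with u1 := List.replicate i true, sfcand := encodeNat (1 + (x₀ + 1) * L), sfr := encodeNat (1 + (x₀ + 1) * L), sfbeta := [true] }

/-- **One candidate of the class.** [folklore] -/
theorem runs_sfClassBody {N n L M i x : ℕ} (hN1 : 1 < N) (hn : (encodeNat N).length + 1 ≤ n) (T : Regs β) (hI : DrvInv (rGH h) N T) (u : HSlots)
    (hL : 1 ≤ L) (hlM1 : (encodeNat (M + 1)).length ≤ n) (hx : (x + 1) * L ≤ M) (hsfl : u.sfl = encodeNat L)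
    (hx2 : u.x2 = []) (hx3 : u.x3 = []) (hx5 : u.x5 = []) (hx6 : u.x6 = []) (hfl1 : u.fl1 = []) (hl2 : u.l2 = []) (hsfr : u.sfr = []) (hsfbeta : u.sfbeta = []) :
    Runs (sfClassBody h) (base (hSt h T (u.srchC L i x)))
      (base (hSt h T (if classHit N L x then u.fndC L i x else u.srchC L i (x + 1)))) (630 * (n + 1) ^ 3) := by
  have hhq : ∀ {i j : HReg}, i ≠ j → h i ≠ h j := fun hij => hq_ne h hij
  obtain ⟨hMD, -, -, -, -, -, -, -, -, -, -, -, -, -, -, -, -, -⟩ := id hI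
  have hN0 : 0 < N := by omega
  set c := (n + 1) ^ 3 with hc3
  have hc1 : n + 1 ≤ c := by
    rw [hc3]; calc n + 1 = (n + 1) ^ 1 := (pow_one _).symm
      _ ≤ (n + 1) ^ 3 := Nat.pow_le_pow_right (by omega) (by omega)
  have rdMD : ∀ u' : HSlots, hSt h T u' (h (.g (.f (.n (.v .MD))))) = encodeNat N := fun u' => by
    rw [hSt_gv h T u' (by decide) (by decide) (by decide) (by decide) (by decide) (by decide)]; exact hMD
  have hlN : (encodeNat N).length ≤ n := by omega
  set q := 1 + (x + 1) * L with hq0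
  have hq1 : 1 + x * L + L = q := by rw [hq0]; ring
  have hqM : q ≤ M + 1 := by omega
  have hlq : (encodeNat q).length ≤ n := (Brick.length_encodeNat_mono hqM).trans hlM1
  have hlq' : (encodeNat (1 + x * L)).length ≤ n := (Brick.length_encodeNat_mono (show 1 + x * L ≤ M + 1 by nlinarith)).trans hlM1
  have hlL : (encodeNat L).length ≤ n := (Brick.length_encodeNat_mono (show L ≤ M + 1 by nlinarith)).trans hlM1
  have hq0' : 0 < q := by omega
  have hlqq : (encodeNat (N / q)).length ≤ n := (Brick.length_encodeNat_mono (Nat.div_le_self _ _)).trans hlN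
  have hlr : (encodeNat (N % q)).length ≤ n := (Brick.length_encodeNat_mono ((Nat.mod_lt _ hq0').le.trans hqM)).trans hlM1
  have hstart : hSt h T (u.srchC L i x) (h .SFBETA) = [] := by simp [HSlots.srchC, hsfbeta]
  have e0 : encodeNat 0 = [] := rfl
  by_cases hdiv : N % q = 0
  · by_cases hlt : q < N
    · have hhit : classHit N L x = true := by simp [classHit, ← hq0, hdiv, hlt]
      have hnle : ¬ N ≤ q := by omega
      rw [hhit, if_pos rfl]
      refine (runs_whenNot_nil h _ hstart (NS.runs_of_eq (N := n) _ _ ?_ ?_ le_rfl)).mono ?_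
      · simp (config := { decide := true }) only [NS.ofList, NS.ok, NOp.ok, NS.eval, NOp.eval, hSt_X2, hSt_X3, hSt_X5, hSt_X6, hSt_SFCAND, hSt_SFL, hSt_FL1, hSt_L2,
          hSt_SFR, hSt_SFBETA, update_hSt_X2, update_hSt_X3, update_hSt_X5, update_hSt_X6, update_hSt_SFCAND, update_hSt_SFR, HSlots.srchC, hsfl, hx2, hx3, hx5, hx6,
          hfl1, hl2, hsfr, hsfbeta, rdMD, bitsToNat_encodeNat, bitsToNat_nil, List.append_nil, e0, or_false, ne_eq, EmbeddingLike.apply_eq_iff_eq, List.length_nil, zero_le, and_self, hq1, hlq, hlq', hlL, hlN,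
          hq0', hlqq, hdiv, hnle, not_false_eq_true, decide_true, decide_false, flag_true, flag_false, true_and, and_true, false_or, List.length_cons]
        try omega
      · simp [HSlots.srchC, HSlots.fndC, hsfl, hx2, hx3, hx5, hx6, hfl1, hl2, hsfr, hsfbeta, rdMD, hq1, hdiv, hnle, ← hq0]
      · norm_num [NS.cost, NOp.cost, NS.ofList]; omega
    · have hhit : classHit N L x = false := by simp [classHit, ← hq0, hlt]
      have hle : N ≤ q := by omega
      rw [hhit]
      simp only [Bool.false_eq_true, if_false]
      refine (runs_whenNot_nil h _ hstart (NS.runs_of_eq (N := n) _ _ ?_ ?_ le_rfl)).mono ?_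
      · simp (config := { decide := true }) only [NS.ofList, NS.ok, NOp.ok, NS.eval, NOp.eval, hSt_X2, hSt_X3, hSt_X5, hSt_X6, hSt_SFCAND, hSt_SFL, hSt_FL1, hSt_L2,
          hSt_SFR, update_hSt_X2, update_hSt_X3, update_hSt_X5, update_hSt_X6, update_hSt_SFCAND, HSlots.srchC, hsfl, hx2, hx3, hx5, hx6,
          hfl1, hl2, hsfr, hsfbeta, rdMD, bitsToNat_encodeNat, bitsToNat_nil, List.append_nil, e0, or_false, ne_eq, EmbeddingLike.apply_eq_iff_eq, List.length_nil, zero_le, and_self, hq1, hlq, hlq', hlL, hlN,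
          hq0', hlqq, hdiv, hle, not_false_eq_true, decide_true, flag_true, true_and, and_true, true_or, List.length_cons]
        try omega
      · simp [HSlots.srchC, hsfl, hx2, hx3, hx5, hx6, hfl1, hl2, rdMD, hq1, hdiv, hle, ← hq0]
      · norm_num [NS.cost, NOp.cost, NS.ofList]; omega
  · have hhit : classHit N L x = false := by simp [classHit, ← hq0, hdiv]
    rw [hhit]
    simp only [Bool.false_eq_true, if_false]
    refine (runs_whenNot_nil h _ hstart (NS.runs_of_eq (N := n) _ _ ?_ ?_ le_rfl)).mono ?_
    · simp (config := { decide := true }) only [NS.ofList, NS.ok, NOp.ok, NS.eval, NOp.eval, hSt_X2, hSt_X3, hSt_X5, hSt_SFCAND, hSt_SFL, hSt_FL1, hSt_L2,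
        update_hSt_X2, update_hSt_X3, update_hSt_X5, update_hSt_SFCAND, HSlots.srchC, hsfl, hx2, hx3, hx5, hfl1, hl2, rdMD, bitsToNat_encodeNat, bitsToNat_nil, List.append_nil, ne_eq,
        EmbeddingLike.apply_eq_iff_eq, List.length_nil, zero_le, and_self, hq1, hlq, hlq', hlL, hlN, hq0', hlqq, hlr, hdiv, not_false_eq_true, decide_false,
        flag_false, true_and, and_true, or_true, List.length_cons]
      try omega
    · simp [HSlots.srchC, hsfl, hx2, hx3, hx5, hfl1, hl2, rdMD, hq1, hdiv, ← hq0]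
    · norm_num [NS.cost, NOp.cost, NS.ofList]; omega

/-- The registers after the class search. [folklore] -/
def HSlots.classRes (u : HSlots) (N L X : ℕ) : HSlots :=
  match firstHit (classHit N L) X with
  | none => { u with sfcand := [], sfdivs := [true], sfd := encodeNat 3 }
  | some x₀ => { u with sfcand := [], sfdivs := [true], sfd := encodeNat 1, sfr := encodeNat (1 + (x₀ + 1) * L), sfbeta := [true] }

/-- Cost of the class search. [folklore] -/
def sfClassCost (n M L : ℕ) : ℕ := 386 * (n + 1) ^ 3 + ((encodeNat (M / L)).length * (16 * (M / L) + 21) + 5) + (M / L * (630 * (n + 1) ^ 3 + 2) + 1)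

/-- **The trial division of the class `1 (mod L)`.** [folklore] -/
theorem runs_sfClass {N n L M : ℕ} (hN1 : 1 < N) (hn : (encodeNat N).length + 1 ≤ n) (T : Regs β) (hI : DrvInv (rGH h) N T) (u : HSlots)
    (hL : 1 ≤ L) (hlM1 : (encodeNat (M + 1)).length ≤ n) (hlL : (encodeNat L).length ≤ n) (hsfm : u.sfm = encodeNat M) (hsfl : u.sfl = encodeNat L)
    (hx2 : u.x2 = []) (hx3 : u.x3 = []) (hx5 : u.x5 = []) (hx6 : u.x6 = []) (hfl1 : u.fl1 = []) (hl2 : u.l2 = []) (hu1 : u.u1 = [])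
    (hsfcand : u.sfcand = []) (hsfr : u.sfr = []) (hsfbeta : u.sfbeta = []) (hsfdivs : u.sfdivs = []) (hsfd : u.sfd = []) :
    Runs (sfClass h) (base (hSt h T u)) (base (hSt h T (u.classRes N L (M / L)))) (sfClassCost n M L) := by
  have hhq : ∀ {i j : HReg}, i ≠ j → h i ≠ h j := fun hij => hq_ne h hij
  have hN0 : 0 < N := by omega
  set c := (n + 1) ^ 3 with hc3
  have hc1 : n + 1 ≤ c := by
    rw [hc3]; calc n + 1 = (n + 1) ^ 1 := (pow_one _).symm
      _ ≤ (n + 1) ^ 3 := Nat.pow_le_pow_right (by omega) (by omega)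
  set X := M / L with hX0
  have hXL : X * L ≤ M := Nat.div_mul_le_self _ _
  have hlM : (encodeNat M).length ≤ n := (Brick.length_encodeNat_mono (Nat.le_succ _)).trans hlM1
  have hlX : (encodeNat X).length ≤ n := (Brick.length_encodeNat_mono ((Nat.div_le_self _ _).trans (Nat.le_succ _))).trans hlM1
  have hlr : (encodeNat (M % L)).length ≤ n := (Brick.length_encodeNat_mono ((Nat.mod_le _ _).trans (Nat.le_succ _))).trans hlM1
  have e1 : encodeNat 1 = [true] := by simpa using encodeNat_two_pow 0
  have hl1n : (encodeNat 1).length ≤ n := by rw [e1]; simp only [List.length_cons, List.length_nil]; omega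
  have e3 : encodeNat 3 = [true, true] := by decide
  have h1len : 1 ≤ (encodeNat N).length := by
    have := Brick.length_encodeNat_mono (show 1 ≤ N by omega); rw [e1] at this; simpa using this
  have hl3n : (encodeNat 3).length ≤ n := by rw [e3]; simp only [List.length_cons, List.length_nil]; omega
  -- initialisation
  let u0 : HSlots := { u with x2 := encodeNat X, sfcand := encodeNat 1 }
  have h0 : Runs ((NS.ofList [.divMod (h .X2) (h .X3) (h .SFM) (h .SFL), .clear (h .X3), .const (h .SFCAND) (encodeNat 1)] : NS β).com)
      (base (hSt h T u)) (base (hSt h T u0)) (357 * c) := by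
    refine NS.runs_of_eq (N := n) _ _ ?_ ?_ (by simp [hc3])
    · simp (config := { decide := true }) only [NS.ofList, NS.ok, NOp.ok, NS.eval, NOp.eval, hSt_X2, hSt_X3, hSt_SFM, hSt_SFL, hSt_SFCAND, update_hSt_X2, update_hSt_X3,
        hx2, hx3, hsfm, hsfl, hsfcand, bitsToNat_encodeNat, ne_eq, EmbeddingLike.apply_eq_iff_eq, List.length_nil, zero_le, and_self, hlM, hlL, hlr, hl1n,
        not_false_eq_true, true_and, and_true]
      omega
    · simp [u0, hx3, hsfm, hsfl, hsfcand, hX0]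
  have h1 : Runs (nToUnary (h .U1) (h .X2)) (base (hSt h T u0)) (base (hSt h T { u0 with u1 := List.replicate X true })) ((encodeNat X).length * (16 * X + 21) + 5) := by
    refine (runs_nToUnary (h .U1) (h .X2) (hSt h T u0) (by simp [u0, hu1])).of_eq ?_ ?_
    · simp [u0]
    · simp only [hSt_X2, u0, bitsToNat_encodeNat]; exact le_rfl
  let ub : HSlots := { u with sfcand := encodeNat 1 }
  have h2 : Runs ((NS.op (.clear (h .X2)) : NS β).com) (base (hSt h T { u0 with u1 := List.replicate X true })) (base (hSt h T (ub.srchC L X 0))) (3 * c) := by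
    refine NS.runs_of_eq (N := n) _ _ (by simp only [NS.ok, NOp.ok, hSt_X2, u0]; exact hlX) ?_ (by simp [hc3])
    simp [u0, ub, HSlots.srchC, hx2]
  -- the loop
  have hbodyB : ∀ i x, x + 1 ≤ X → Runs (sfClassBody h) (base (hSt h T (ub.srchC L i x)))
      (base (hSt h T (if classHit N L x then ub.fndC L i x else ub.srchC L i (x + 1)))) (630 * c) := fun i x hx =>
    runs_sfClassBody h hN1 hn T hI ub hL hlM1 (by nlinarith) (by simp [ub, hsfl]) (by simp [ub, hx2]) (by simp [ub, hx3]) (by simp [ub, hx5]) (by simp [ub, hx6])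
      (by simp [ub, hfl1]) (by simp [ub, hl2]) (by simp [ub, hsfr]) (by simp [ub, hsfbeta])
  have hbodyA : ∀ i x₀, Runs (sfClassBody h) (base (hSt h T (ub.fndC L i x₀))) (base (hSt h T (ub.fndC L i x₀))) (1 + 2) :=
    fun i x₀ => runs_whenNot_true h _ _ (by simp [HSlots.fndC])
  have hL := runs_countLoop (U := (Sum.inr (h .U1) : EReg ⊕ β)) (body := sfClassBody h)
    (fun i R => (firstHit (classHit N L) (X - i) = none ∧ i ≤ X ∧ R = base (hSt h T (ub.srchC L i (X - i)))) ∨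
      (∃ x₀, firstHit (classHit N L) (X - i) = some x₀ ∧ i ≤ X ∧ R = base (hSt h T (ub.fndC L i x₀))))
    (630 * c)
    (by
      rintro i R (⟨hfh, him, rfl⟩ | ⟨x₀, hfh, him, rfl⟩) -
      · have hupd : Function.update (base (hSt h T (ub.srchC L (i + 1) (X - (i + 1))))) (Sum.inr (h .U1)) (List.replicate i true) =
            base (hSt h T (ub.srchC L i (X - (i + 1)))) := by simp [HSlots.srchC]
        rw [hupd]
        refine ⟨_, hbodyB i (X - (i + 1)) (by omega), ?_, ?_⟩
        · split_ifs <;> simp [HSlots.srchC, HSlots.fndC]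
        · have hj : X - i = X - (i + 1) + 1 := by omega
          rw [hj, firstHit_succ_of_none hfh]
          by_cases hp : classHit N L (X - (i + 1)) = true
          · right; exact ⟨X - (i + 1), by simp [hp], by omega, by simp [hp]⟩
          · left; exact ⟨by simp [hp], by omega, by simp [hp]⟩
      · have hupd : Function.update (base (hSt h T (ub.fndC L (i + 1) x₀))) (Sum.inr (h .U1)) (List.replicate i true) = base (hSt h T (ub.fndC L i x₀)) := by
          simp [HSlots.fndC]
        rw [hupd]
        refine ⟨_, (hbodyA i x₀).mono (by omega), by simp [HSlots.fndC], ?_⟩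
        right
        have hj : X - i = X - (i + 1) + 1 := by omega
        exact ⟨x₀, by rw [hj, firstHit_succ_of_some hfh], by omega, rfl⟩)
    X (base (hSt h T (ub.srchC L X 0))) (Or.inl ⟨by simp [firstHit], le_rfl, by simp⟩) (by simp [HSlots.srchC])
  obtain ⟨R', hR, -, hP⟩ := hL
  simp only [Nat.sub_zero] at hP
  -- the final code
  have hfin : ∀ (v : HSlots) (cand fb : List Bool), v.sfcand = cand → cand.length ≤ n → v.sfbeta = fb → (fb = [] ∨ fb = [true]) → v.sfdivs = [] → v.sfd = [] → v.x5 = [] →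
      Runs ((NS.seq (NS.ofList [.clear (h .SFCAND), .copy (h .SFBETA) (h .X5), .const (h .SFDIVS) [true]])
        (NS.ite (h .X5) (NS.op (.const (h .SFD) (encodeNat 1))) (NS.op (.const (h .SFD) (encodeNat 3)))) : NS β).com) (base (hSt h T v))
        (base (hSt h T { v with sfcand := [], sfdivs := [true], sfd := if fb = [true] then encodeNat 1 else encodeNat 3 })) (26 * c) := by
    intro v cand fb e1' e1l e2 e2v e3' e4 e5
    rcases e2v with rfl | rfl
    · refine NS.runs_of_eq (N := n) _ _ ?_ ?_ (by simp [hc3])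
      · simp (config := { decide := true }) only [NS.ofList, NS.ok, NOp.ok, NS.eval, NOp.eval, hSt_SFCAND, hSt_SFBETA, hSt_X5, hSt_SFDIVS, hSt_SFD,
          update_hSt_SFCAND, update_hSt_X5, update_hSt_SFDIVS, e1', e2, e3', e4, e5, ne_eq, EmbeddingLike.apply_eq_iff_eq, List.length_nil, List.append_nil, zero_le, and_self,
          e1l, hl3n, not_false_eq_true, true_and, and_true, List.length_cons, or_true]
        omega
      · simp [e2, e3', e4, e5]
    · refine NS.runs_of_eq (N := n) _ _ ?_ ?_ (by simp [hc3])
      · simp (config := { decide := true }) only [NS.ofList, NS.ok, NOp.ok, NS.eval, NOp.eval, hSt_SFCAND, hSt_SFBETA, hSt_X5, hSt_SFDIVS, hSt_SFD,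
          update_hSt_SFCAND, update_hSt_X5, update_hSt_SFDIVS, e1', e2, e3', e4, e5, ne_eq, EmbeddingLike.apply_eq_iff_eq, List.length_nil, List.append_nil, zero_le, and_self,
          e1l, hl1n, not_false_eq_true, true_and, and_true, List.length_cons, true_or]
        omega
      · simp [e2, e3', e4, e5]
  rcases hP with ⟨hfh, -, rfl⟩ | ⟨x₀, hfh, -, rfl⟩
  · have hlc : (encodeNat (1 + X * L)).length ≤ n := (Brick.length_encodeNat_mono (by omega)).trans hlM1
    have hf := hfin (ub.srchC L 0 X) (encodeNat (1 + X * L)) [] (by simp [HSlots.srchC]) hlc (by simp [HSlots.srchC, ub, hsfbeta]) (Or.inl rfl)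
      (by simp [HSlots.srchC, ub, hsfdivs]) (by simp [HSlots.srchC, ub, hsfd]) (by simp [HSlots.srchC, ub, hx5])
    refine (h0.seq (h1.seq (h2.seq (hR.seq hf)))).of_eq ?_ ?_
    · simp only [HSlots.classRes, hfh]
      simp [HSlots.srchC, ub, hu1]
    · simp only [sfClassCost, ← hc3, ← hX0]; omega
  · rcases firstHit_spec (classHit N L) X with ⟨hnone, -⟩ | ⟨x₁, hsome, hx₁, -, -⟩
    · rw [hfh] at hnone; exact absurd hnone (by simp)
    rw [hfh] at hsome
    obtain rfl : x₀ = x₁ := Option.some.inj hsome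
    have hlc : (encodeNat (1 + (x₀ + 1) * L)).length ≤ n := (Brick.length_encodeNat_mono (by nlinarith)).trans hlM1
    have hf := hfin (ub.fndC L 0 x₀) (encodeNat (1 + (x₀ + 1) * L)) [true] (by simp [HSlots.fndC]) hlc (by simp [HSlots.fndC]) (Or.inr rfl)
      (by simp [HSlots.fndC, ub, hsfdivs]) (by simp [HSlots.fndC, ub, hsfd]) (by simp [HSlots.fndC, ub, hx5])
    refine (h0.seq (h1.seq (h2.seq (hR.seq hf)))).of_eq ?_ ?_
    · simp only [HSlots.classRes, hfh]
      simp [HSlots.fndC, ub, hu1]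
    · simp only [sfClassCost, ← hc3, ← hX0]; omega

/-! #### The per-base procedure: set-up, Algorithm 1, dispatch -/

/-- Run `X` if the register `R` is non-empty (it is kept), else `Y`. [folklore] -/
def whenCons (R : HReg) (X Y : Com (EReg ⊕ β)) : Com (EReg ⊕ β) :=
  Com.pop (Sum.inr (h R)) (Com.push (Sum.inr (h R)) true ;; X) (Com.push (Sum.inr (h R)) false ;; X) Y

/-- `whenCons` on an empty register. [folklore] -/
theorem runs_whenCons_nil (R : HReg) (X : Com (EReg ⊕ β)) {Y : Com (EReg ⊕ β)} (T'' : Regs β) (hR : T'' (h R) = []) {R' : Regs (EReg ⊕ β)} {B : ℕ}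
    (hb : Runs Y (base T'') R' B) : Runs (whenCons h R X Y) (base T'') R' (B + 2) :=
  Runs.opop_nil _ _ hR hb

/-- `whenCons` on a non-empty register. [folklore] -/
theorem runs_whenCons_cons (R : HReg) {X : Com (EReg ⊕ β)} (Y : Com (EReg ⊕ β)) (T'' : Regs β) {bb : Bool} {w : List Bool} (hR : T'' (h R) = bb :: w)
    {R' : Regs (EReg ⊕ β)} {B : ℕ} (hb : Runs X (base T'') R' B) : Runs (whenCons h R X Y) (base T'') R' (1 + B + 2) := by
  have hrestore : ∀ b' : Bool, Function.update (base (Function.update T'' (h R) w)) (Sum.inr (h R)) (b' :: (base (Function.update T'' (h R) w)) (Sum.inr (h R))) =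
      base (Function.update T'' (h R) (b' :: w)) := fun b' => by
    simp only [nst_inr, Function.update_self, update_nst_inr]; congr 1
    funext r; by_cases hr : r = h R
    · subst hr; simp
    · simp [hr]
  have hT : ∀ b' : Bool, bb = b' → Function.update T'' (h R) (b' :: w) = T'' := fun b' hb' => by
    subst hb'; funext r; by_cases hr : r = h R
    · subst hr; simp [hR]
    · simp [hr]
  cases bb with
  | true =>
    refine Runs.opop_true _ _ hR (((Runs.push _ _ _).of_eq (hrestore true) le_rfl).seq ?_)
    rw [hT true rfl]; exact hb
  | false =>
    refine Runs.opop_false _ _ hR (((Runs.push _ _ _).of_eq (hrestore false) le_rfl).seq ?_)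
    rw [hT false rfl]; exact hb

/-- A positive numeral is a non-empty word. [folklore] -/
theorem encodeNat_eq_cons {x : ℕ} (hx : 0 < x) : ∃ bb w, encodeNat x = bb :: w := by
  cases hq : encodeNat x with
  | nil => have := bitsToNat_encodeNat x; rw [hq, bitsToNat_nil] at this; omega
  | cons bb w => exact ⟨bb, w, rfl⟩

/-- The set-up of Algorithm 1 for the base: values, shift `1`, `m = 2^e`, `k = e + 2`. [folklore] -/
def sfSetup : Com (EReg ⊕ β) :=
  sfVals h ;; (((NS.op (.const (h .A1C) (encodeNat 1))) : NS β).com ;; (pow2Into (rGH h) (h .BLM) (h .A1P) ;;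
    ((NS.ofList [.copy (h .A1P) (h .X2), .succ (h .X3) (h .X2), .succ (h .BLK) (h .X3), .clear (h .X2), .clear (h .X3)] : NS β).com)))

/-- Cost of the set-up. [folklore] -/
def sfSetupCost (n e : ℕ) : ℕ := sfValsCost n e + (4 * (n + 1) ^ 3 + ((n * (16 * e + 21) + 3 * e + 7) + 163 * (n + 1) ^ 3))

/-- **The set-up.** [folklore] -/
theorem runs_sfSetup {N n e α : ℕ} (hN1 : 1 < N) (hn : (encodeNat N).length + 1 ≤ n) (hen : e + 3 ≤ n) (T : Regs β) (hI : DrvInv (rGH h) N T)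
    (u : HSlots) (hαN : α < N) (hbla : u.bla = encodeNat α) (ha1p : u.a1p = encodeNat e)
    (hx2 : u.x2 = []) (hx3 : u.x3 = []) (hx4 : u.x4 = []) (hx5 : u.x5 = []) (hx6 : u.x6 = []) (hu1 : u.u1 = []) (hl4 : u.l4 = []) (ha1v : u.a1v = [])
    (ha1c : u.a1c = []) (hblm : u.blm = []) (hblk : u.blk = []) :
    Runs (sfSetup h) (base (hSt h T u))
      (base (hSt h T { u with a1v := encVec (sfValList N (α ^ 2 ^ e % N) (2 ^ e)), a1c := encodeNat 1, blm := encodeNat (2 ^ e), blk := encodeNat (e + 2) })) (sfSetupCost n e) := by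
  have hhq : ∀ {i j : HReg}, i ≠ j → h i ≠ h j := fun hij => hq_ne h hij
  obtain ⟨-, -, -, -, -, -, -, -, -, -, hU, -, -, -, -, -, -, -⟩ := id hI
  set c := (n + 1) ^ 3 with hc3
  have rdU : ∀ u' : HSlots, hSt h T u' (h (.g (.f (.n (.v .U))))) = [] := fun u' => by
    rw [hSt_gv h T u' (by decide) (by decide) (by decide) (by decide) (by decide) (by decide)]; exact hU
  have e1 : encodeNat 1 = [true] := by simpa using encodeNat_two_pow 0
  have hl1n : (encodeNat 1).length ≤ n := by rw [e1]; simp only [List.length_cons, List.length_nil]; omega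
  have hle : (encodeNat e).length ≤ n := (length_encodeNat_le_succ (le_two_pow_self e)).trans (by omega)
  have hle1 : (encodeNat (e + 1)).length ≤ n := (length_encodeNat_le_succ (show e + 1 ≤ 2 ^ (e + 1) from (le_two_pow_self _))).trans (by omega)
  have h1 := runs_sfVals h hN1 hn (by omega) T hI u hαN hbla ha1p hx2 hx4 hx5 hx6 hu1 hl4 ha1v
  set V := sfValList N (α ^ 2 ^ e % N) (2 ^ e)
  let u1 : HSlots := { u with a1v := encVec V }
  let u2 : HSlots := { u1 with a1c := encodeNat 1 }
  have h2 : Runs ((NS.op (.const (h .A1C) (encodeNat 1)) : NS β).com) (base (hSt h T u1)) (base (hSt h T u2)) (4 * c) := by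
    refine NS.runs_of_eq (N := n) _ _ ?_ (by simp [u1, u2]) (by simp [hc3])
    simp only [NS.ok, NOp.ok, hSt_A1C, u1, ha1c, List.length_nil]; exact ⟨by omega, hl1n⟩
  let u3 : HSlots := { u2 with blm := encodeNat (2 ^ e) }
  have h3 : Runs (pow2Into (rGH h) (h .BLM) (h .A1P)) (base (hSt h T u2)) (base (hSt h T u3)) (n * (16 * e + 21) + 3 * e + 7) := by
    have hne : h .BLM ≠ h .A1P := hhq (by decide)
    have hneU : h .BLM ≠ (rGH h) (.f (.n (.v .U))) := (rGH_ne h .BLM (fun _ e => HReg.noConfusion e) _).symm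
    have r1 : hSt h T u2 (h .A1P) = encodeNat e := by rw [hSt_A1P]; exact ha1p
    have r2 : hSt h T u2 (h .BLM) = [] := by rw [hSt_BLM]; exact hblm
    refine (runs_pow2Into (rGH h) hneU hne hle (hSt h T u2) r1 r2 (rdU u2)).of_eq ?_ le_rfl
    rw [update_hSt_BLM]
  have h4 : Runs ((NS.ofList [.copy (h .A1P) (h .X2), .succ (h .X3) (h .X2), .succ (h .BLK) (h .X3), .clear (h .X2), .clear (h .X3)] : NS β).com) (base (hSt h T u3))
      (base (hSt h T { u with a1v := encVec V, a1c := encodeNat 1, blm := encodeNat (2 ^ e), blk := encodeNat (e + 2) })) (163 * c) := by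
    refine NS.runs_of_eq (N := n) _ _ ?_ ?_ (by simp [hc3])
    · simp (config := { decide := true }) only [NS.ofList, NS.ok, NOp.ok, NS.eval, NOp.eval, hSt_A1P, hSt_X2, hSt_X3, hSt_BLK, update_hSt_X2, update_hSt_X3, update_hSt_BLK,
        u3, u2, u1, ha1p, hx2, hx3, hblk, bitsToNat_encodeNat, List.append_nil, ne_eq, EmbeddingLike.apply_eq_iff_eq, List.length_nil, zero_le, and_self, hle, hle1,
        not_false_eq_true]
    · simp [u3, u2, u1, ha1p, hx2, hx3, hblk]
  refine (h1.seq (h2.seq (h3.seq h4))).of_eq rfl ?_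
  simp only [sfSetupCost, ← hc3]; omega

/-- The factor branch after Algorithm 1: record it, code `1`, stop. [folklore] -/
def sfF : Com (EReg ⊕ β) :=
  ((NS.ofList [.move (h .A1G) (h .SFR), .const (h .SFD) (encodeNat 1), .const (h .SFDIVS) [true], .const (h .SFBETA) [true],
      .clear (h .BLFP), .clear (h .BLG), .clear (h .A1AI), .clear (h .A1I)] : NS β).com)

/-- The "clear" branch: code `2`, stop (the base stays on `BLA`). [folklore] -/
def sfC : Com (EReg ⊕ β) :=
  ((NS.ofList [.clear (h .BLG), .const (h .SFD) (encodeNat 2), .const (h .SFDIVS) [true]] : NS β).com)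

/-- After the divisor casework found a factor: code `1`, stop. [folklore] -/
def sfF2 : Com (EReg ⊕ β) :=
  ((NS.ofList [.const (h .SFD) (encodeNat 1), .const (h .SFDIVS) [true], .clear (h .SFK)] : NS β).com)

/-- The `lcm` update, the threshold test, and the class search when `L ≥ LB`. [folklore] -/
def sfLL : Com (EReg ⊕ β) :=
  sfLcm h ;; (((NS.op (.cmp (h .X5) (h .SFL) (h .SFBMAX))) : NS β).com ;; Com.pop (Sum.inr (h .X5)) (sfClass h) skip skip)

/-- The exact-hit branch: the casework on `e*`, then factor or `lcm`/class. [folklore] -/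
def sfE : Com (EReg ⊕ β) :=
  ((NS.op (.const (h .X1) (encodeNat 1))) : NS β).com ;; (sfDivs h ;;
    (((NS.ofList [.clear (h .A1I), .clear (h .BLG), .clear (h .SFE), .clear (h .X1)] : NS β).com) ;; whenCons h .SFBETA (sfF2 h) (sfLL h)))

/-- The dispatch on the outcome of Algorithm 1. [folklore] -/
def sfDispatch : Com (EReg ⊕ β) :=
  whenCons h .A1G (sfF h) (Com.pop (Sum.inr (h .BLFP)) (Com.pop (Sum.inr (h .A1AI)) (sfE h) skip (sfC h)) skip (sfC h))

/-- The per-base procedure. [folklore] -/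
def sfBase : Com (EReg ⊕ β) :=
  sfSetup h ;; (alg1 h ;; (((NS.ofList [.clear (h .A1C), .clear (h .BLK)] : NS β).com) ;; sfDispatch h))

/-- The outcome of one base: whether the search stops, the result code (`1` factor, `2` clear,
`3` class exhausted, `0` continue), the new modulus `L`, the factor. [folklore] -/
structure SFOut where
  /-- the search stops -/ (stop : Bool)
  /-- result code -/ (code : ℕ)
  /-- the modulus of the congruence `q ≡ 1` -/ (L : ℕ)
  /-- the factor found -/ (fac : Option ℕ)

/-- The outcome of the exact-hit branch from the casework result `dr = (K, factor?)`. [folklore] -/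
def sfEOut (N L LB M : ℕ) (dr : ℕ × Option ℕ) : SFOut :=
  match dr.2 with
  | some g => ⟨true, 1, L, some g⟩
  | none =>
    if LB ≤ Nat.lcm L dr.1 then
      match firstHit (classHit N (Nat.lcm L dr.1)) (M / Nat.lcm L dr.1) with
      | some x₀ => ⟨true, 1, Nat.lcm L dr.1, some (1 + (x₀ + 1) * Nat.lcm L dr.1)⟩
      | none => ⟨true, 3, Nat.lcm L dr.1, none⟩
    else ⟨false, 0, Nat.lcm L dr.1, none⟩

/-- The outcome of the dispatch on the outcome `o` of Algorithm 1. [folklore] -/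
def sfDispOut (N α e L LB M : ℕ) (o : Option ℕ × Option ℕ × Option ℕ) : SFOut :=
  match o.1 with
  | some g => ⟨true, 1, L, some g⟩
  | none =>
    match o.2.1, o.2.2 with
    | none, _ => ⟨true, 2, L, none⟩
    | some _, none => ⟨true, 2, L, none⟩
    | some i₀, some h₀ => sfEOut N L LB M (divRun N α ((h₀ + 1) * 2 ^ e - i₀) (2 ^ e))

/-- The registers after the base, from its outcome. [folklore] -/
def HSlots.sfFinal (u : HSlots) (out : SFOut) : HSlots :=
  { u with a1v := [], a1c := [], blm := [], blk := [], l1 := [], x1 := [], fl2 := [], blout := [], ptk := [], ptu := [], blf := [],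
           a1g := [], blfp := [], blg := [], a1ai := [], a1i := [], sfe := [], sfk := [], sfcand := [],
           sfl := encodeNat out.L, sfd := encodeNat out.code, sfdivs := (if out.stop then [true] else []), sfr := encOpt out.fac, sfbeta := flagOpt out.fac }

/-- Monotonicity of the unary-conversion cost. [folklore] -/
theorem toUnaryCost_mono {X Y : ℕ} (h : X ≤ Y) : (encodeNat X).length * (16 * X + 21) + 5 ≤ (encodeNat Y).length * (16 * Y + 21) + 5 :=
  Nat.add_le_add_right (Nat.mul_le_mul (Brick.length_encodeNat_mono h) (by omega)) _

/-- `sfClassCost` decreases in `L`. [folklore] -/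
theorem sfClassCost_mono {n M L L' : ℕ} (hL : 1 ≤ L) (h : L ≤ L') : sfClassCost n M L' ≤ sfClassCost n M L := by
  unfold sfClassCost
  have hd : M / L' ≤ M / L := Nat.div_le_div_left h (by omega)
  have := toUnaryCost_mono hd
  have := Nat.mul_le_mul_right (630 * (n + 1) ^ 3 + 2) hd
  omega

/-- Cost of the exact-hit branch (with the class bound `LB ≥ 1`). [folklore] -/
def sfECost (n e M LB : ℕ) : ℕ := 4 * (n + 1) ^ 3 + sfDivsCost n e + 12 * (n + 1) ^ 3 + 3 + (1635 * (n + 1) ^ 3 + 56 * (n + 1) ^ 3 + (sfClassCost n M LB + 2))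

/-- **The exact-hit branch.** [folklore] -/
theorem runs_sfE {N n e α h₀ i₀ L LB M : ℕ} (hN1 : 1 < N) (hn : (encodeNat N).length + 1 ≤ n) (hen : 2 * e + 4 ≤ n) (T : Regs β) (hI : DrvInv (rGH h) N T)
    (u : HSlots) (hαN : α < N) (hbla : u.bla = encodeNat α) (hh₀ : h₀ < 2 ^ e) (hi₀ : i₀ < 2 ^ e) (hL : 1 ≤ L) (hLB : 1 ≤ LB)
    (hlLn : (encodeNat (L * 2 ^ (2 * e))).length ≤ n) (hlLB : (encodeNat LB).length ≤ n) (hlM1 : (encodeNat (M + 1)).length ≤ n)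
    (ha1i : u.a1i = encodeNat h₀) (hblg : u.blg = encodeNat i₀) (ha1p : u.a1p = encodeNat e) (hsfl : u.sfl = encodeNat L) (hsfbmax : u.sfbmax = encodeNat LB) (hsfm : u.sfm = encodeNat M)
    (hx1 : u.x1 = []) (hx2 : u.x2 = []) (hx3 : u.x3 = []) (hx4 : u.x4 = []) (hx5 : u.x5 = []) (hx6 : u.x6 = []) (hfl1 : u.fl1 = []) (hfl2 : u.fl2 = [])
    (hl2 : u.l2 = []) (hu1 : u.u1 = []) (hsfe : u.sfe = []) (hsfk : u.sfk = []) (hsft : u.sft = []) (hsfr : u.sfr = []) (hsfbeta : u.sfbeta = [])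
    (hsfcand : u.sfcand = []) (hsfdivs : u.sfdivs = []) (hsfd : u.sfd = []) :
    Runs (sfE h) (base (hSt h T u))
      (base (hSt h T (let out := sfEOut N L LB M (divRun N α ((h₀ + 1) * 2 ^ e - i₀) (2 ^ e));
        { u with a1i := [], blg := [], sfl := encodeNat out.L, sfd := encodeNat out.code, sfdivs := (if out.stop then [true] else []),
                 sfr := encOpt out.fac, sfbeta := flagOpt out.fac })))
      (sfECost n e M LB) := by
  have hhq : ∀ {i j : HReg}, i ≠ j → h i ≠ h j := fun hij => hq_ne h hij
  have hN0 : 0 < N := by omega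
  set c := (n + 1) ^ 3 with hc3
  have hc1 : n + 1 ≤ c := by
    rw [hc3]; calc n + 1 = (n + 1) ^ 1 := (pow_one _).symm
      _ ≤ (n + 1) ^ 3 := Nat.pow_le_pow_right (by omega) (by omega)
  have e1 : encodeNat 1 = [true] := by simpa using encodeNat_two_pow 0
  have hl1n : (encodeNat 1).length ≤ n := by rw [e1]; simp only [List.length_cons, List.length_nil]; omega
  set es := (h₀ + 1) * 2 ^ e - i₀ with hes0
  have h22 : 2 ^ e * 2 ^ e = 2 ^ (2 * e) := by rw [← pow_add, two_mul]
  have hes : es ≤ 2 ^ (2 * e) := by rw [hes0, ← h22]; exact (Nat.sub_le _ _).trans (Nat.mul_le_mul_right _ hh₀)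
  have hes1 : 1 ≤ es := by
    rw [hes0]; have : 2 ^ e ≤ (h₀ + 1) * 2 ^ e := Nat.le_mul_of_pos_left _ (by omega); omega
  have hl2k : ∀ x, x ≤ 2 ^ (2 * e) → (encodeNat x).length ≤ n := fun x hx => length_le_of_le_two_pow_two_mul hx hen
  set dr := divRun N α es (2 ^ e) with hdr0
  have hK : dr.1 ≤ 2 ^ (2 * e) := (divRun_fst_le N α hes1 (2 ^ e)).trans hes
  have hlK : (encodeNat dr.1).length ≤ n := hl2k _ hK
  have h2e0 : 1 ≤ 2 ^ (2 * e) := Nat.one_le_two_pow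
  have hlL : (encodeNat L).length ≤ n := (Brick.length_encodeNat_mono (Nat.le_mul_of_pos_right _ h2e0)).trans hlLn
  have hK1 : 1 ≤ dr.1 := divRun_fst_pos N α hes1 (2 ^ e)
  have hlcm_le : Nat.lcm L dr.1 ≤ L * 2 ^ (2 * e) :=
    (show Nat.lcm L dr.1 ≤ L * dr.1 from Nat.div_le_self _ _).trans (Nat.mul_le_mul_left _ hK)
  set L' := Nat.lcm L dr.1 with hL'0
  have hL'1 : 1 ≤ L' := Nat.pos_of_ne_zero (Nat.lcm_ne_zero (by omega) (by omega))
  have hLL' : L ≤ L' := Nat.le_of_dvd (by omega) (Nat.dvd_lcm_left _ _)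
  have hlL' : (encodeNat L').length ≤ n := (Brick.length_encodeNat_mono hlcm_le).trans hlLn
  -- X1 := 1, the casework, the clears
  let u0 : HSlots := { u with x1 := encodeNat 1 }
  have h0 : Runs ((NS.op (.const (h .X1) (encodeNat 1))) : NS β).com (base (hSt h T u)) (base (hSt h T u0)) (4 * c) := by
    refine NS.runs_of_eq (N := n) _ _ ?_ (by simp [u0]) (by simp [hc3])
    simp only [NS.ok, NOp.ok, hSt_X1, hx1, List.length_nil]; exact ⟨by omega, hl1n⟩
  have h1 := runs_sfDivs h hN1 hn hen T hI u0 hαN (by simp [u0, hbla]) hh₀ hi₀ (by simp [u0, ha1i]) (by simp [u0, hblg]) (by simp [u0, ha1p]) (by simp [u0])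
    (by simp [u0, hx2]) (by simp [u0, hx3]) (by simp [u0, hx4]) (by simp [u0, hx5]) (by simp [u0, hx6]) (by simp [u0, hfl1]) (by simp [u0, hfl2]) (by simp [u0, hl2])
    (by simp [u0, hu1]) (by simp [u0, hsfe]) (by simp [u0, hsfk]) (by simp [u0, hsft]) (by simp [u0, hsfr]) (by simp [u0, hsfbeta])
  rw [← hes0, ← hdr0] at h1
  let u1 : HSlots := { u0 with sfe := encodeNat es, sfk := encodeNat dr.1, sfr := optUpd [] dr.2, sfbeta := optFlag [] dr.2 }
  let u2 : HSlots := { u with a1i := [], blg := [], sfk := encodeNat dr.1, sfr := optUpd [] dr.2, sfbeta := optFlag [] dr.2 }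
  have h2 : Runs ((NS.ofList [.clear (h .A1I), .clear (h .BLG), .clear (h .SFE), .clear (h .X1)] : NS β).com) (base (hSt h T u1)) (base (hSt h T u2)) (12 * c) := by
    refine NS.runs_of_eq (N := n) _ _ ?_ ?_ (by simp [hc3])
    · simp only [NS.ofList, NS.ok, NOp.ok, NS.eval, NOp.eval, hSt_A1I, hSt_BLG, hSt_SFE, hSt_X1, update_hSt_A1I, update_hSt_BLG, update_hSt_SFE, u1, u0, ha1i, hblg, and_true]
      exact ⟨hl2k _ (by nlinarith [Nat.one_le_two_pow (n := e)]), hl2k _ (by nlinarith [Nat.one_le_two_pow (n := e)]), hl2k _ hes, hl1n⟩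
    · simp [u1, u2, u0, hx1, hsfe]
  cases hd2 : dr.2 with
  | some g =>
    -- a factor from the casework
    have h3 : Runs (sfF2 h) (base (hSt h T u2)) (base (hSt h T { u2 with sfd := encodeNat 1, sfdivs := [true], sfk := [] })) (11 * c) := by
      refine NS.runs_of_eq (N := n) _ _ ?_ (by simp [u2]) (by simp [hc3])
      simp (config := { decide := true }) only [NS.ofList, NS.ok, NOp.ok, NS.eval, NOp.eval, hSt_SFD, hSt_SFDIVS, hSt_SFK, update_hSt_SFD, update_hSt_SFDIVS, u2,
        hsfd, hsfdivs, List.length_nil, List.length_cons, zero_le, true_and, and_true, hl1n, hlK, and_self]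
      omega
    have hw := runs_whenCons_cons h .SFBETA (sfLL h) (hSt h T u2) (bb := true) (w := []) (by simp [u2, hd2]) h3
    refine (h0.seq (h1.seq (h2.seq hw))).of_eq ?_ ?_
    · simp only [sfEOut, hd2]
      simp [u2, hd2, encOpt, flagOpt, hsfk, hsfcand, hsfe, hx1, hsfl]
    · simp only [sfECost, ← hc3]; omega
  | none =>
    -- lcm, threshold, class
    have h3 := runs_sfLcm h (n := n) T u2 hL hlL hlK (by simp [u2, hsfl]) (by simp [u2]) (by simp [u2, hx2]) (by simp [u2, hx3]) (by simp [u2, hx4])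
    rw [← hL'0] at h3
    let u3 : HSlots := { u2 with sfl := encodeNat L', sfk := [] }
    let u4 : HSlots := { u3 with x5 := flag (decide (LB ≤ L')) }
    have h4 : Runs ((NS.op (.cmp (h .X5) (h .SFL) (h .SFBMAX))) : NS β).com (base (hSt h T u3)) (base (hSt h T u4)) (56 * c) := by
      refine NS.runs_of_eq (N := n) _ _ ?_ (by simp [u3, u4, u2, hsfbmax]) (by simp [hc3])
      simp only [NS.ok, NOp.ok, hSt_X5, hSt_SFL, hSt_SFBMAX, u3, u2, hx5, hsfbmax]; exact ⟨hlL', hlLB, trivial⟩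
    by_cases hth : LB ≤ L'
    · have hflag : u4.x5 = [true] := by simp [u4, hth]
      have h5 := runs_sfClass h hN1 hn T hI { u4 with x5 := [] } hL'1 hlM1 hlL' (by simp [u4, u3, u2, hsfm]) (by simp [u4, u3]) (by simp [u4, u3, u2, hx2])
        (by simp [u4, u3, u2, hx3]) (by simp) (by simp [u4, u3, u2, hx6]) (by simp [u4, u3, u2, hfl1]) (by simp [u4, u3, u2, hl2]) (by simp [u4, u3, u2, hu1])
        (by simp [u4, u3, u2, hsfcand]) (by simp [u4, u3, u2, hd2]) (by simp [u4, u3, u2, hd2]) (by simp [u4, u3, u2, hsfdivs]) (by simp [u4, u3, u2, hsfd])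
      have hpop : Runs (Com.pop (Sum.inr (h .X5)) (sfClass h) skip skip) (base (hSt h T u4)) (base (hSt h T (({ u4 with x5 := [] } : HSlots).classRes N L' (M / L'))))
          (sfClassCost n M L' + 2) :=
        Runs.opop_true _ _ (by rw [hSt_X5]; exact hflag) (by rw [update_hSt_X5]; exact h5)
      have hw := runs_whenCons_nil h .SFBETA (sfF2 h) (hSt h T u2) (by simp [u2, hd2]) (h3.seq (h4.seq hpop))
      have hcm := sfClassCost_mono (n := n) (M := M) hLB hth
      refine (h0.seq (h1.seq (h2.seq hw))).of_eq ?_ ?_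
      · simp only [sfEOut, hd2, ← hL'0, hth, if_true, HSlots.classRes]
        cases hfc : firstHit (classHit N L') (M / L') with
        | none => simp [u4, u3, u2, hx5, encOpt, flagOpt, hsfk, hsfcand, hsfe, hx1, hd2]
        | some x₀ => simp [u4, u3, u2, hx5, encOpt, flagOpt, hsfk, hsfcand, hsfe, hx1]
      · simp only [sfECost, ← hc3]; omega
    · have hflag : u4.x5 = [] := by simp [u4, hth]
      have hpop : Runs (Com.pop (Sum.inr (h .X5)) (sfClass h) skip skip) (base (hSt h T u4)) (base (hSt h T u4)) (0 + 2) :=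
        Runs.opop_nil _ _ (by rw [hSt_X5]; exact hflag) (Runs.skip _)
      have hw := runs_whenCons_nil h .SFBETA (sfF2 h) (hSt h T u2) (by simp [u2, hd2]) (h3.seq (h4.seq hpop))
      refine (h0.seq (h1.seq (h2.seq hw))).of_eq ?_ ?_
      · simp only [sfEOut, hd2, ← hL'0, hth, if_false]
        simp [u4, u3, u2, hd2, hx5, hth, show encodeNat 0 = [] from rfl, encOpt, flagOpt, hsfk, hsfcand, hsfe, hx1, hsfd, hsfdivs]
      · simp only [sfECost, ← hc3]; omega

/-- Cost of the dispatch. [folklore] -/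
def sfDispatchCost (n e M LB : ℕ) : ℕ := 51 * (n + 1) ^ 3 + 7 + sfECost n e M LB

/-- **The dispatch on the outcome of Algorithm 1.** [folklore] -/
theorem runs_sfDispatch {N n e α L LB M : ℕ} (o : Option ℕ × Option ℕ × Option ℕ) (hN1 : 1 < N) (hn : (encodeNat N).length + 1 ≤ n) (hen : 2 * e + 4 ≤ n)
    (T : Regs β) (hI : DrvInv (rGH h) N T) (u : HSlots) (hαN : α < N) (hbla : u.bla = encodeNat α) (hL : 1 ≤ L) (hLB : 1 ≤ LB)
    (hlLn : (encodeNat (L * 2 ^ (2 * e))).length ≤ n) (hlLB : (encodeNat LB).length ≤ n) (hlM1 : (encodeNat (M + 1)).length ≤ n)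
    (ho1 : ∀ g, o.1 = some g → 0 < g ∧ g ≤ N) (ho2 : ∀ i₀, o.2.1 = some i₀ → i₀ < 2 ^ e) (ho3 : ∀ h₀, o.2.2 = some h₀ → h₀ < 2 ^ e)
    (ho23 : o.2.1 = none → o.2.2 = none)
    (ha1g : u.a1g = encOpt o.1) (hblfp : u.blfp = flagOpt o.2.1) (hblg : u.blg = encOpt o.2.1) (ha1ai : u.a1ai = flagOpt o.2.2) (ha1i : u.a1i = encOpt o.2.2)
    (ha1p : u.a1p = encodeNat e) (hsfl : u.sfl = encodeNat L) (hsfbmax : u.sfbmax = encodeNat LB) (hsfm : u.sfm = encodeNat M)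
    (hx1 : u.x1 = []) (hx2 : u.x2 = []) (hx3 : u.x3 = []) (hx4 : u.x4 = []) (hx5 : u.x5 = []) (hx6 : u.x6 = []) (hfl1 : u.fl1 = []) (hfl2 : u.fl2 = [])
    (hl2 : u.l2 = []) (hu1 : u.u1 = []) (hsfe : u.sfe = []) (hsfk : u.sfk = []) (hsft : u.sft = []) (hsfr : u.sfr = []) (hsfbeta : u.sfbeta = [])
    (hsfcand : u.sfcand = []) (hsfdivs : u.sfdivs = []) (hsfd : u.sfd = []) :
    Runs (sfDispatch h) (base (hSt h T u))
      (base (hSt h T (let out := sfDispOut N α e L LB M o;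
        { u with a1g := [], blfp := [], blg := [], a1ai := [], a1i := [], sfl := encodeNat out.L, sfd := encodeNat out.code,
                 sfdivs := (if out.stop then [true] else []), sfr := encOpt out.fac, sfbeta := flagOpt out.fac })))
      (sfDispatchCost n e M LB) := by
  have hhq : ∀ {i j : HReg}, i ≠ j → h i ≠ h j := fun hij => hq_ne h hij
  have hN0 : 0 < N := by omega
  set c := (n + 1) ^ 3 with hc3
  have hc1 : n + 1 ≤ c := by
    rw [hc3]; calc n + 1 = (n + 1) ^ 1 := (pow_one _).symm
      _ ≤ (n + 1) ^ 3 := Nat.pow_le_pow_right (by omega) (by omega)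
  have hlN : (encodeNat N).length ≤ n := by omega
  have e1 : encodeNat 1 = [true] := by simpa using encodeNat_two_pow 0
  have hl1n : (encodeNat 1).length ≤ n := by rw [e1]; simp only [List.length_cons, List.length_nil]; omega
  have e2 : encodeNat 2 = [false, true] := by simpa using encodeNat_two_pow 1
  have hl2n : (encodeNat 2).length ≤ n := by rw [e2]; simp only [List.length_cons, List.length_nil]; omega
  have hl2k : ∀ x, x ≤ 2 ^ (2 * e) → (encodeNat x).length ≤ n := fun x hx => length_le_of_le_two_pow_two_mul hx hen
  have hek : 2 ^ e ≤ 2 ^ (2 * e) := Nat.pow_le_pow_right (by omega) (by omega)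
  have hlo2 : (encOpt o.2.1).length ≤ n := by
    cases h2 : o.2.1 with
    | none => simp [encOpt]
    | some i₀ => simpa [encOpt] using hl2k _ ((ho2 i₀ h2).le.trans hek)
  have hlo3 : (encOpt o.2.2).length ≤ n := by
    cases h3 : o.2.2 with
    | none => simp [encOpt]
    | some h₀ => simpa [encOpt] using hl2k _ ((ho3 h₀ h3).le.trans hek)
  have hlf2 : (flagOpt o.2.1).length ≤ n := by cases h2 : o.2.1 <;> simp [flagOpt]; omega
  have hlf3 : (flagOpt o.2.2).length ≤ n := by cases h3 : o.2.2 <;> simp [flagOpt]; omega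
  -- the clear branch, generic
  have hC : ∀ (v : HSlots), v.blg = encOpt o.2.1 → v.sfd = [] → v.sfdivs = [] →
      Runs (sfC h) (base (hSt h T v)) (base (hSt h T { v with blg := [], sfd := encodeNat 2, sfdivs := [true] })) (11 * c) := by
    intro v e1' e2' e3'
    refine NS.runs_of_eq (N := n) _ _ ?_ (by simp) (by simp [hc3])
    simp (config := { decide := true }) only [NS.ofList, NS.ok, NOp.ok, NS.eval, NOp.eval, hSt_BLG, hSt_SFD, hSt_SFDIVS, update_hSt_BLG, update_hSt_SFD,
      e1', e2', e3', List.length_nil, List.length_cons, zero_le, true_and, and_true, and_self, hlo2, hl2n]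
    omega
  cases h1 : o.1 with
  | some g =>
    obtain ⟨hg0, hgN⟩ := ho1 g h1
    have hlg : (encodeNat g).length ≤ n := (Brick.length_encodeNat_mono hgN).trans hlN
    obtain ⟨bb, w, hgw⟩ := encodeNat_eq_cons hg0
    have hag : u.a1g = encodeNat g := by rw [ha1g, h1]; rfl
    have hF : Runs (sfF h) (base (hSt h T u))
        (base (hSt h T { u with a1g := [], sfr := encodeNat g, sfd := encodeNat 1, sfdivs := [true], sfbeta := [true], blfp := [], blg := [], a1ai := [], a1i := [] })) (40 * c) := by
      refine NS.runs_of_eq (N := n) _ _ ?_ ?_ (by simp [hc3])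
      · simp (config := { decide := true }) only [NS.ofList, NS.ok, NOp.ok, NS.eval, NOp.eval, hSt_A1G, hSt_SFR, hSt_SFD, hSt_SFDIVS, hSt_SFBETA, hSt_BLFP, hSt_BLG,
          hSt_A1AI, hSt_A1I, update_hSt_A1G, update_hSt_SFR, update_hSt_SFD, update_hSt_SFDIVS, update_hSt_SFBETA, update_hSt_BLFP, update_hSt_BLG, update_hSt_A1AI,
          hag, hsfr, hsfd, hsfdivs, hsfbeta, hblfp, hblg, ha1ai, ha1i, ne_eq, EmbeddingLike.apply_eq_iff_eq, List.length_nil, List.length_cons, List.append_nil,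
          zero_le, true_and, and_true, and_self, hlg, hl1n, hlo2, hlo3, hlf2, hlf3, not_false_eq_true]
        omega
      · simp [hag, hsfr]
    have hw := runs_whenCons_cons h .A1G (Com.pop (Sum.inr (h .BLFP)) (Com.pop (Sum.inr (h .A1AI)) (sfE h) skip (sfC h)) skip (sfC h)) (hSt h T u)
      (bb := bb) (w := w) (by simp [ha1g, h1, encOpt, hgw]) hF
    refine hw.of_eq ?_ ?_
    · simp only [sfDispOut, h1]; simp [encOpt, flagOpt, hsfl]
    · simp only [sfDispatchCost, ← hc3]; omega
  | none =>
    have ha1g' : hSt h T u (h .A1G) = [] := by simp [ha1g, h1, encOpt]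
    cases h2 : o.2.1 with
    | none =>
      have h3 : o.2.2 = none := ho23 h2
      have hpop : Runs (Com.pop (Sum.inr (h .BLFP)) (Com.pop (Sum.inr (h .A1AI)) (sfE h) skip (sfC h)) skip (sfC h)) (base (hSt h T u))
          (base (hSt h T { u with blg := [], sfd := encodeNat 2, sfdivs := [true] })) (11 * c + 2) :=
        Runs.opop_nil _ _ (by rw [hSt_BLFP, hblfp, h2]; rfl) (hC u hblg hsfd hsfdivs)
      refine (runs_whenCons_nil h .A1G (sfF h) (hSt h T u) ha1g' hpop).of_eq ?_ ?_
      · simp only [sfDispOut, h1, h2]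
        simp [encOpt, flagOpt, hsfl, ha1g, h1, hblfp, h2, ha1ai, ha1i, h3, hsfr, hsfbeta]
      · simp only [sfDispatchCost, ← hc3]; omega
    | some i₀ =>
      have hi₀ := ho2 i₀ h2
      let u1 : HSlots := { u with blfp := [] }
      have hblfp' : hSt h T u (h .BLFP) = true :: [] := by rw [hSt_BLFP, hblfp, h2]; rfl
      cases h3 : o.2.2 with
      | none =>
        have hA : Runs (Com.pop (Sum.inr (h .A1AI)) (sfE h) skip (sfC h)) (base (hSt h T u1)) (base (hSt h T { u1 with blg := [], sfd := encodeNat 2, sfdivs := [true] })) (11 * c + 2) :=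
          Runs.opop_nil _ _ (by rw [hSt_A1AI]; simp [u1, ha1ai, h3, flagOpt]) (hC u1 (by simp [u1, hblg]) (by simp [u1, hsfd]) (by simp [u1, hsfdivs]))
        have hpop : Runs (Com.pop (Sum.inr (h .BLFP)) (Com.pop (Sum.inr (h .A1AI)) (sfE h) skip (sfC h)) skip (sfC h)) (base (hSt h T u))
            (base (hSt h T { u1 with blg := [], sfd := encodeNat 2, sfdivs := [true] })) (11 * c + 2 + 2) :=
          Runs.opop_true _ _ hblfp' (by rw [update_hSt_BLFP]; exact hA)
        refine (runs_whenCons_nil h .A1G (sfF h) (hSt h T u) ha1g' hpop).of_eq ?_ ?_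
        · simp only [sfDispOut, h1, h2, h3]
          simp [u1, encOpt, flagOpt, hsfl, ha1g, h1, ha1ai, ha1i, h3, hsfr, hsfbeta]
        · simp only [sfDispatchCost, ← hc3]; omega
      | some h₀ =>
        have hh₀ := ho3 h₀ h3
        let u2 : HSlots := { u1 with a1ai := [] }
        have hE := runs_sfE h hN1 hn hen T hI u2 hαN (by simp [u2, u1, hbla]) hh₀ hi₀ hL hLB hlLn hlLB hlM1 (by simp [u2, u1, ha1i, h3, encOpt])
          (by simp [u2, u1, hblg, h2, encOpt]) (by simp [u2, u1, ha1p]) (by simp [u2, u1, hsfl]) (by simp [u2, u1, hsfbmax]) (by simp [u2, u1, hsfm])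
          (by simp [u2, u1, hx1]) (by simp [u2, u1, hx2]) (by simp [u2, u1, hx3]) (by simp [u2, u1, hx4]) (by simp [u2, u1, hx5]) (by simp [u2, u1, hx6])
          (by simp [u2, u1, hfl1]) (by simp [u2, u1, hfl2]) (by simp [u2, u1, hl2]) (by simp [u2, u1, hu1]) (by simp [u2, u1, hsfe]) (by simp [u2, u1, hsfk])
          (by simp [u2, u1, hsft]) (by simp [u2, u1, hsfr]) (by simp [u2, u1, hsfbeta]) (by simp [u2, u1, hsfcand]) (by simp [u2, u1, hsfdivs]) (by simp [u2, u1, hsfd])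
        have hA : Runs (Com.pop (Sum.inr (h .A1AI)) (sfE h) skip (sfC h)) (base (hSt h T u1)) _ (sfECost n e M LB + 2) :=
          Runs.opop_true (w := []) _ _ (by rw [hSt_A1AI]; simp [u1, ha1ai, h3, flagOpt]) (by rw [update_hSt_A1AI]; exact hE)
        have hpop := Runs.opop_true (k := h .BLFP) (ct := Com.pop (Sum.inr (h .A1AI)) (sfE h) skip (sfC h)) skip (sfC h) (T := hSt h T u) hblfp'
          (by rw [update_hSt_BLFP]; exact hA)
        refine (runs_whenCons_nil h .A1G (sfF h) (hSt h T u) ha1g' hpop).of_eq ?_ ?_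
        · simp only [sfDispOut, h1, h2, h3]
          simp [u2, u1, ha1g, h1, encOpt]
        · simp only [sfDispatchCost, ← hc3]; omega

/-- Index facts of the outcome of Algorithm 1. [folklore] -/
theorem alg1Out_index_facts (N α cc m k e : ℕ) (b vs : List ℕ) :
    (∀ i₀, (alg1Out N α cc m k e b vs).2.1 = some i₀ → i₀ < m) ∧ (∀ h₀, (alg1Out N α cc m k e b vs).2.2 = some h₀ → h₀ < 2 ^ e) ∧
    ((alg1Out N α cc m k e b vs).2.1 = none → (alg1Out N α cc m k e b vs).2.2 = none) := by
  have hfi : ∀ i₀, firstHit (gcdHit N (NegFFT.bluesteinValues N α m k (a1Coefs N cc b (2 ^ e + 1)))) m = some i₀ → i₀ < m := fun i₀ hf => by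
    rcases firstHit_spec (gcdHit N (NegFFT.bluesteinValues N α m k (a1Coefs N cc b (2 ^ e + 1)))) m with ⟨hn', -⟩ | ⟨i₁, hs', hi₁, -, -⟩
    · rw [hf] at hn'; simp at hn'
    · rw [hf] at hs'; obtain rfl : i₀ = i₁ := Option.some.inj hs'; exact hi₁
  have hfh : ∀ i₀ h₀, firstHit (gcdHit N (a1Resids N (α ^ i₀ % N * cc % N) vs)) (2 ^ e) = some h₀ → h₀ < 2 ^ e := fun i₀ h₀ hf => by
    rcases firstHit_spec (gcdHit N (a1Resids N (α ^ i₀ % N * cc % N) vs)) (2 ^ e) with ⟨hn', -⟩ | ⟨h₁, hs', hh₁, -, -⟩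
    · rw [hf] at hn'; simp at hn'
    · rw [hf] at hs'; obtain rfl : h₀ = h₁ := Option.some.inj hs'; exact hh₁
  rcases alg1Out_shape N α cc m k e b vs with ⟨-, ho⟩ | ⟨i₀, -, -, ho⟩ | ⟨i₀, hf1, -, ⟨-, ho⟩ | ⟨h₀, hf2, -, ho⟩ | ⟨h₀, -, -, ho⟩⟩ <;> rw [ho]
  · simp
  · simp
  · refine ⟨fun i hi => ?_, fun hh hhh => ?_, fun hz => ?_⟩
    · obtain rfl : i₀ = i := Option.some.inj hi; exact hfi _ hf1
    · simp at hhh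
    · simp at hz
  · refine ⟨fun i hi => ?_, fun hh hhh => ?_, fun hz => ?_⟩
    · obtain rfl : i₀ = i := Option.some.inj hi; exact hfi _ hf1
    · obtain rfl : h₀ = hh := Option.some.inj hhh; exact hfh _ _ hf2
    · simp at hz
  · refine ⟨fun i hi => ?_, fun hh hhh => ?_, fun hz => ?_⟩
    · obtain rfl : i₀ = i := Option.some.inj hi; exact hfi _ hf1
    · simp at hhh
    · simp at hz

/-- The outcome of one base `α` of the search. [folklore] -/
def sfBaseOut (N α e L LB M : ℕ) : SFOut :=
  let vs := sfValList N (α ^ 2 ^ e % N) (2 ^ e)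
  sfDispOut N α e L LB M (alg1Out N α 1 (2 ^ e) (e + 2) e ((NegFFT.prodTreeH N e vs).headD []) vs)

/-- Cost of one base. [folklore] -/
def sfBaseCost (n e M LB : ℕ) : ℕ := sfSetupCost n e + (alg1Cost n e (e + 2) (2 ^ e) + (6 * (n + 1) ^ 3 + sfDispatchCost n e M LB))

/-- **One base of the search.** [folklore] -/
theorem runs_sfBase {N n e α L LB M : ℕ} (hNodd : Odd N) (hN1 : 1 < N) (hn : (encodeNat N).length + 1 ≤ n) (hen : 2 * e + 8 ≤ n)
    (T : Regs β) (hI : DrvInv (rGH h) N T) (hCI : T (h (.g .CINV)) = encodeNat (NegFFT.inv2N N))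
    (u : HSlots) (hw : u.gw.Clean) (hsched : u.gw.sched = []) (hhist : u.gw.hist = []) (hbg : u.gw.bg = []) (hkn' : u.gw.kn = []) (hbf : u.gw.bf = [])
    (hαN : α < N) (hL : 1 ≤ L) (hLB : 1 ≤ LB) (hlLn : (encodeNat (L * 2 ^ (2 * e))).length ≤ n) (hlLB : (encodeNat LB).length ≤ n) (hlM1 : (encodeNat (M + 1)).length ≤ n)
    (hbla : u.bla = encodeNat α) (ha1p : u.a1p = encodeNat e) (hblpow : u.blpow = encodeNat 2) (hsfl : u.sfl = encodeNat L) (hsfbmax : u.sfbmax = encodeNat LB)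
    (hsfm : u.sfm = encodeNat M)
    (hl1 : u.l1 = []) (hx1 : u.x1 = []) (hx2 : u.x2 = []) (hx3 : u.x3 = []) (hx4 : u.x4 = []) (hx5 : u.x5 = []) (hx6 : u.x6 = [])
    (hfl1 : u.fl1 = []) (hfl2 : u.fl2 = []) (hl2 : u.l2 = []) (hu1 : u.u1 = []) (hl4 : u.l4 = []) (hptk : u.ptk = []) (hptu : u.ptu = []) (hblf : u.blf = [])
    (hble : u.ble = []) (hblc1 : u.blc1 = []) (hblc2 : u.blc2 = []) (hblout : u.blout = []) (ha1i : u.a1i = []) (ha1ai : u.a1ai = []) (ha1g : u.a1g = [])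
    (hblg : u.blg = []) (hblfp : u.blfp = []) (ha1v : u.a1v = []) (ha1c : u.a1c = []) (hblm : u.blm = []) (hblk : u.blk = [])
    (hsfe : u.sfe = []) (hsfk : u.sfk = []) (hsft : u.sft = []) (hsfr : u.sfr = []) (hsfbeta : u.sfbeta = []) (hsfcand : u.sfcand = []) (hsfdivs : u.sfdivs = []) (hsfd : u.sfd = []) :
    Runs (sfBase h) (base (hSt h T u)) (base (hSt h T (u.sfFinal (sfBaseOut N α e L LB M)))) (sfBaseCost n e M LB) := by
  have hN0 : 0 < N := by omega
  set c := (n + 1) ^ 3 with hc3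
  set vs := sfValList N (α ^ 2 ^ e % N) (2 ^ e) with hvs0
  have hvs : vs.length = 2 ^ e := by simp [hvs0, sfValList]
  have hvN : ∀ v ∈ vs, v < N := fun v hv => by
    simp only [hvs0, sfValList, List.mem_map, List.mem_range] at hv; obtain ⟨j, -, rfl⟩ := hv; exact Nat.mod_lt _ hN0
  obtain ⟨b, hb, -, -, -⟩ := NegFFT.prodTreeH_spec hNodd hN1 (e := e) hvs
  have hhead : (NegFFT.prodTreeH N e vs).headD [] = b := by rw [hb]; rfl
  have h1 := runs_sfSetup h hN1 hn (by omega) T hI u hαN hbla ha1p hx2 hx3 hx4 hx5 hx6 hu1 hl4 ha1v ha1c hblm hblk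
  rw [← hvs0] at h1
  let u1 : HSlots := { u with a1v := encVec vs, a1c := encodeNat 1, blm := encodeNat (2 ^ e), blk := encodeNat (e + 2) }
  have h2 := runs_alg1 h (e := e) (k := e + 2) (cc := 1) (m := 2 ^ e) hNodd hN1 hn (by omega) (by omega) (by omega) Nat.one_le_two_pow
    (by rw [show e + 2 - 1 = e + 1 by omega, pow_succ]; omega) hαN hN1 T hI hCI u1 hw hsched hhist hbg hkn' hbf hvs hvN hb
    (by simp [u1]) (by simp [u1, ha1p]) (by simp [u1, hbla]) (by simp [u1]) (by simp [u1]) (by simp [u1]) (by simp [u1, hblpow])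
    (by simp [u1, hl1]) (by simp [u1, hx1]) (by simp [u1, hx2]) (by simp [u1, hx3]) (by simp [u1, hx4]) (by simp [u1, hx5]) (by simp [u1, hx6])
    (by simp [u1, hfl1]) (by simp [u1, hfl2]) (by simp [u1, hu1]) (by simp [u1, hl4]) (by simp [u1, hptk]) (by simp [u1, hptu]) (by simp [u1, hblf])
    (by simp [u1, hble]) (by simp [u1, hblc1]) (by simp [u1, hblc2]) (by simp [u1, hblout]) (by simp [u1, ha1i]) (by simp [u1, ha1ai]) (by simp [u1, ha1g])
    (by simp [u1, hblg]) (by simp [u1, hblfp])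
  set o := alg1Out N α 1 (2 ^ e) (e + 2) e b vs with ho0
  let u2 : HSlots := u1.alg1Final o
  let u3 : HSlots := { u2 with a1c := [], blk := [] }
  have hle2 : (encodeNat (e + 2)).length ≤ n := (length_encodeNat_le_succ (show e + 2 ≤ 2 ^ (e + 2) from (le_two_pow_self _))).trans (by omega)
  have e1 : encodeNat 1 = [true] := by simpa using encodeNat_two_pow 0
  have h3 : Runs ((NS.ofList [.clear (h .A1C), .clear (h .BLK)] : NS β).com) (base (hSt h T u2)) (base (hSt h T u3)) (6 * c) := by
    refine NS.runs_of_eq (N := n) _ _ ?_ (by simp [u2, u3]) (by simp [hc3])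
    simp only [NS.ofList, NS.ok, NOp.ok, NS.eval, NOp.eval, hSt_A1C, hSt_BLK, update_hSt_A1C, u2, u1, HSlots.alg1Final, e1, List.length_cons, List.length_nil, and_true]
    exact ⟨by omega, hle2⟩
  obtain ⟨hx2', hx3', hx23⟩ := alg1Out_index_facts N α 1 (2 ^ e) (e + 2) e b vs
  have h4 := runs_sfDispatch h o hN1 hn (by omega) T hI u3 hαN (by simp [u3, u2, u1, HSlots.alg1Final, hbla]) hL hLB hlLn hlLB hlM1
    (fun g hg => by have := alg1Out_factor (α := α) (cc := 1) (m := 2 ^ e) (k := e + 2) (e := e) (b := b) (vs := vs) hN1 (by rw [← ho0]; exact hg); omega)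
    (fun i₀ hi => hx2' i₀ (by rw [← ho0]; exact hi)) (fun h₀ hh => hx3' h₀ (by rw [← ho0]; exact hh)) (fun hz => by rw [ho0] at hz ⊢; exact hx23 hz)
    (by simp [u3, u2, HSlots.alg1Final]) (by simp [u3, u2, HSlots.alg1Final]) (by simp [u3, u2, HSlots.alg1Final]) (by simp [u3, u2, HSlots.alg1Final])
    (by simp [u3, u2, HSlots.alg1Final]) (by simp [u3, u2, u1, HSlots.alg1Final, ha1p]) (by simp [u3, u2, u1, HSlots.alg1Final, hsfl])
    (by simp [u3, u2, u1, HSlots.alg1Final, hsfbmax]) (by simp [u3, u2, u1, HSlots.alg1Final, hsfm]) (by simp [u3, u2, HSlots.alg1Final])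
    (by simp [u3, u2, u1, HSlots.alg1Final, hx2]) (by simp [u3, u2, u1, HSlots.alg1Final, hx3]) (by simp [u3, u2, u1, HSlots.alg1Final, hx4])
    (by simp [u3, u2, u1, HSlots.alg1Final, hx5]) (by simp [u3, u2, u1, HSlots.alg1Final, hx6]) (by simp [u3, u2, u1, HSlots.alg1Final, hfl1])
    (by simp [u3, u2, HSlots.alg1Final]) (by simp [u3, u2, u1, HSlots.alg1Final, hl2]) (by simp [u3, u2, u1, HSlots.alg1Final, hu1])
    (by simp [u3, u2, u1, HSlots.alg1Final, hsfe]) (by simp [u3, u2, u1, HSlots.alg1Final, hsfk]) (by simp [u3, u2, u1, HSlots.alg1Final, hsft])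
    (by simp [u3, u2, u1, HSlots.alg1Final, hsfr]) (by simp [u3, u2, u1, HSlots.alg1Final, hsfbeta]) (by simp [u3, u2, u1, HSlots.alg1Final, hsfcand])
    (by simp [u3, u2, u1, HSlots.alg1Final, hsfdivs]) (by simp [u3, u2, u1, HSlots.alg1Final, hsfd])
  refine (h1.seq (h2.seq (h3.seq h4))).of_eq ?_ ?_
  · simp only [HSlots.sfFinal, sfBaseOut, ← hvs0, hhead, ← ho0]
    simp [u3, u2, u1, HSlots.alg1Final, hsfe, hsfk, hsfcand]
  · simp only [sfBaseCost, ← hc3]; omega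

/-! #### The loop over the bases -/

/-- One base of the loop: unless stopped, `α := α + 1` and the per-base procedure. [folklore] -/
def sfStep : Com (EReg ⊕ β) :=
  whenNot h .SFDIVS (((NS.ofList [.succ (h .X2) (h .BLA), .clear (h .BLA), .move (h .X2) (h .BLA)] : NS β).com) ;; sfBase h)

/-- The loop over `B` bases (count on `U2`). [folklore] -/
def sfLoop : Com (EReg ⊕ β) := countLoop (Sum.inr (h .U2)) (sfStep h)

/-- The state of the search after `j` bases: the current base, the modulus, the outcome if stopped. [folklore] -/
def sfRun (N e LB M : ℕ) : ℕ → ℕ × ℕ × Option SFOut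
  | 0 => (1, 1, none)
  | j + 1 =>
    match sfRun N e LB M j with
    | (α, L, some out) => (α, L, some out)
    | (α, L, none) =>
      let out := sfBaseOut N (α + 1) e L LB M
      if out.stop then (α + 1, out.L, some out) else (α + 1, out.L, none)

/-- The registers of the search from its state, `i` bases to go. [folklore] -/
def HSlots.sfAt (u : HSlots) (i : ℕ) (st : ℕ × ℕ × Option SFOut) : HSlots :=
  match st.2.2 with
  | none => { u with u2 := List.replicate i true, bla := encodeNat st.1, sfl := encodeNat st.2.1 }
  | some out => { u with u2 := List.replicate i true, bla := encodeNat st.1, sfl := encodeNat st.2.1, sfd := encodeNat out.code, sfdivs := [true],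
                         sfr := encOpt out.fac, sfbeta := flagOpt out.fac }

/-- The base counter. [folklore] -/
theorem sfRun_fst (N e LB M : ℕ) : ∀ j, (sfRun N e LB M j).1 ≤ 1 + j
  | 0 => by simp [sfRun]
  | j + 1 => by
    have ih := sfRun_fst N e LB M j
    rw [sfRun]
    generalize sfRun N e LB M j = st at ih ⊢
    obtain ⟨α, L, r⟩ := st
    cases r with
    | some out => simp only at ih ⊢; omega
    | none =>
      simp only at ih ⊢
      by_cases hs : (sfBaseOut N (α + 1) e L LB M).stop = true
      · rw [if_pos hs]; show α + 1 ≤ 1 + (j + 1); omega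
      · rw [if_neg hs]; show α + 1 ≤ 1 + (j + 1); omega

/-- A stopped outcome is a stop. [folklore] -/
theorem sfRun_stop (N e LB M : ℕ) : ∀ j out, (sfRun N e LB M j).2.2 = some out → out.stop = true
  | 0, out, h0 => by simp [sfRun] at h0
  | j + 1, out, h0 => by
    rw [sfRun] at h0
    generalize hst : sfRun N e LB M j = st at h0
    obtain ⟨α, L, r⟩ := st
    cases r with
    | some out' => simp only at h0; obtain rfl := Option.some.inj h0; exact sfRun_stop N e LB M j _ (by rw [hst])
    | none =>
      simp only at h0
      by_cases hs : (sfBaseOut N (α + 1) e L LB M).stop = true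
      · rw [if_pos hs] at h0; obtain rfl := Option.some.inj h0; exact hs
      · rw [if_neg hs] at h0; simp at h0

/-- The step of the search at a stopped state. [folklore] -/
theorem sfRun_succ_some {N e LB M j α L : ℕ} {out : SFOut} (hst : sfRun N e LB M j = (α, L, some out)) : sfRun N e LB M (j + 1) = (α, L, some out) := by
  rw [sfRun, hst]

/-- The step of the search at a running state. [folklore] -/
theorem sfRun_succ_none {N e LB M j α L : ℕ} (hst : sfRun N e LB M j = (α, L, none)) :
    sfRun N e LB M (j + 1) = if (sfBaseOut N (α + 1) e L LB M).stop then (α + 1, (sfBaseOut N (α + 1) e L LB M).L, some (sfBaseOut N (α + 1) e L LB M))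
      else (α + 1, (sfBaseOut N (α + 1) e L LB M).L, none) := by
  rw [sfRun, hst]

/-- The modulus while searching: `1 ≤ L ≤ LB` (for `2 ≤ LB`... `1 ≤ LB`). [folklore] -/
theorem sfRun_L (N e LB M : ℕ) (hLB : 1 ≤ LB) (hout : ∀ α L, 1 ≤ L → 1 ≤ (sfBaseOut N α e L LB M).L ∧ ((sfBaseOut N α e L LB M).stop = false → (sfBaseOut N α e L LB M).L < LB)) :
    ∀ j, (sfRun N e LB M j).2.2 = none → 1 ≤ (sfRun N e LB M j).2.1 ∧ (sfRun N e LB M j).2.1 ≤ LB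
  | 0, _ => by simp [sfRun]; exact hLB
  | j + 1, h0 => by
    have ih := sfRun_L N e LB M hLB hout j
    rw [sfRun] at h0 ⊢
    generalize hst : sfRun N e LB M j = st at h0 ih ⊢
    obtain ⟨α, L, r⟩ := st
    cases r with
    | some out' => simp at h0
    | none =>
      obtain ⟨ih1, ih2⟩ := ih rfl
      simp only at h0 ih1 ih2 ⊢
      by_cases hs : (sfBaseOut N (α + 1) e L LB M).stop = true
      · rw [if_pos hs] at h0; simp at h0
      · rw [if_neg hs]
        obtain ⟨h1, h2⟩ := hout (α + 1) L ih1
        simp only [Bool.not_eq_true] at hs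
        exact ⟨h1, (h2 hs).le⟩

/-- A continuing outcome has code `0` and no factor; every outcome keeps `L ≥ 1`, and continues only below `LB`. [folklore] -/
theorem sfDispOut_facts (N α e L LB M : ℕ) (o : Option ℕ × Option ℕ × Option ℕ) (hL : 1 ≤ L)
    (ho2 : ∀ i₀, o.2.1 = some i₀ → i₀ < 2 ^ e) :
    let out := sfDispOut N α e L LB M o
    1 ≤ out.L ∧ (out.stop = false → out.L < LB ∧ out.code = 0 ∧ out.fac = none) := by
  intro out
  have hE : ∀ i₀ h₀, i₀ < 2 ^ e → let out' := sfEOut N L LB M (divRun N α ((h₀ + 1) * 2 ^ e - i₀) (2 ^ e));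
      1 ≤ out'.L ∧ (out'.stop = false → out'.L < LB ∧ out'.code = 0 ∧ out'.fac = none) := by
    intro i₀ h₀ hi₀ out'
    have hes1 : 1 ≤ (h₀ + 1) * 2 ^ e - i₀ := by
      have : 2 ^ e ≤ (h₀ + 1) * 2 ^ e := Nat.le_mul_of_pos_left _ (by omega); omega
    have hK1 := divRun_fst_pos N α hes1 (2 ^ e)
    have hlcm : 1 ≤ Nat.lcm L (divRun N α ((h₀ + 1) * 2 ^ e - i₀) (2 ^ e)).1 := Nat.pos_of_ne_zero (Nat.lcm_ne_zero (by omega) (by omega))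
    simp only [out', sfEOut]
    cases hd : (divRun N α ((h₀ + 1) * 2 ^ e - i₀) (2 ^ e)).2 with
    | some g => simp; exact hL
    | none =>
      simp only
      by_cases hth : LB ≤ Nat.lcm L (divRun N α ((h₀ + 1) * 2 ^ e - i₀) (2 ^ e)).1
      · rw [if_pos hth]
        cases firstHit (classHit N (Nat.lcm L (divRun N α ((h₀ + 1) * 2 ^ e - i₀) (2 ^ e)).1)) (M / Nat.lcm L (divRun N α ((h₀ + 1) * 2 ^ e - i₀) (2 ^ e)).1) with
        | none => simp; exact hlcm
        | some x₀ => simp; exact hlcm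
      · rw [if_neg hth]; simp; exact ⟨hlcm, by omega⟩
  simp only [out, sfDispOut]
  cases h1 : o.1 with
  | some g => simp; exact hL
  | none =>
    simp only
    cases h2 : o.2.1 with
    | none => simp; exact hL
    | some i₀ =>
      cases h3 : o.2.2 with
      | none => simp; exact hL
      | some h₀ => exact hE i₀ h₀ (ho2 i₀ h2)

/-- The per-base outcome keeps `1 ≤ L` and continues only below `LB` with code `0` and no factor. [folklore] -/
theorem sfBaseOut_facts (N α e L LB M : ℕ) (hL : 1 ≤ L) :
    let out := sfBaseOut N α e L LB M
    1 ≤ out.L ∧ (out.stop = false → out.L < LB ∧ out.code = 0 ∧ out.fac = none) := by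
  intro out
  simp only [out, sfBaseOut]
  exact sfDispOut_facts N α e L LB M _ hL (alg1Out_index_facts N α 1 (2 ^ e) (e + 2) e _ _).1

/-- Cost of one base of the loop. [folklore] -/
def sfStepCost (n e M LB : ℕ) : ℕ := 83 * (n + 1) ^ 3 + sfBaseCost n e M LB + 2

/-- **One base of the loop.** [folklore] -/
theorem runs_sfStep {N n e LB M B : ℕ} (hNodd : Odd N) (hN1 : 1 < N) (hn : (encodeNat N).length + 1 ≤ n) (hen : 2 * e + 8 ≤ n)
    (T : Regs β) (hI : DrvInv (rGH h) N T) (hCI : T (h (.g .CINV)) = encodeNat (NegFFT.inv2N N))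
    (u : HSlots) (hw : u.gw.Clean) (hsched : u.gw.sched = []) (hhist : u.gw.hist = []) (hbg : u.gw.bg = []) (hkn' : u.gw.kn = []) (hbf : u.gw.bf = [])
    (hLB : 1 ≤ LB) (hlLBn : (encodeNat (LB * 2 ^ (2 * e))).length ≤ n) (hlM1 : (encodeNat (M + 1)).length ≤ n) (hBN : B + 2 ≤ N)
    (ha1p : u.a1p = encodeNat e) (hblpow : u.blpow = encodeNat 2) (hsfbmax : u.sfbmax = encodeNat LB) (hsfm : u.sfm = encodeNat M)
    (hl1 : u.l1 = []) (hx1 : u.x1 = []) (hx2 : u.x2 = []) (hx3 : u.x3 = []) (hx4 : u.x4 = []) (hx5 : u.x5 = []) (hx6 : u.x6 = [])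
    (hfl1 : u.fl1 = []) (hfl2 : u.fl2 = []) (hl2 : u.l2 = []) (hu1 : u.u1 = []) (hl4 : u.l4 = []) (hptk : u.ptk = []) (hptu : u.ptu = []) (hblf : u.blf = [])
    (hble : u.ble = []) (hblc1 : u.blc1 = []) (hblc2 : u.blc2 = []) (hblout : u.blout = []) (ha1i : u.a1i = []) (ha1ai : u.a1ai = []) (ha1g : u.a1g = [])
    (hblg : u.blg = []) (hblfp : u.blfp = []) (ha1v : u.a1v = []) (ha1c : u.a1c = []) (hblm : u.blm = []) (hblk : u.blk = [])
    (hsfe : u.sfe = []) (hsfk : u.sfk = []) (hsft : u.sft = []) (hsfr : u.sfr = []) (hsfbeta : u.sfbeta = []) (hsfcand : u.sfcand = []) (hsfdivs : u.sfdivs = []) (hsfd : u.sfd = [])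
    {j i : ℕ} (hj : j + 1 ≤ B) :
    Runs (sfStep h) (base (hSt h T { u.sfAt (i + 1) (sfRun N e LB M j) with u2 := List.replicate i true })) (base (hSt h T (u.sfAt i (sfRun N e LB M (j + 1))))) (sfStepCost n e M LB) := by
  have hN0 : 0 < N := by omega
  set c := (n + 1) ^ 3 with hc3
  have hc1 : n + 1 ≤ c := by
    rw [hc3]; calc n + 1 = (n + 1) ^ 1 := (pow_one _).symm
      _ ≤ (n + 1) ^ 3 := Nat.pow_le_pow_right (by omega) (by omega)
  have hlN : (encodeNat N).length ≤ n := by omega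
  have hlLB : (encodeNat LB).length ≤ n := (Brick.length_encodeNat_mono (Nat.le_mul_of_pos_right _ Nat.one_le_two_pow)).trans hlLBn
  have hout : ∀ α L, 1 ≤ L → 1 ≤ (sfBaseOut N α e L LB M).L ∧ ((sfBaseOut N α e L LB M).stop = false → (sfBaseOut N α e L LB M).L < LB) :=
    fun α L hL => ⟨(sfBaseOut_facts N α e L LB M hL).1, fun hs => ((sfBaseOut_facts N α e L LB M hL).2 hs).1⟩
  have hαj := sfRun_fst N e LB M j
  rcases hst : sfRun N e LB M j with ⟨α, L, r⟩
  rw [hst] at hαj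
  simp only at hαj
  cases r with
  | some out =>
    rw [sfRun_succ_some hst]
    have hs : hSt h T { u.sfAt (i + 1) (α, L, some out) with u2 := List.replicate i true } (h .SFDIVS) = [true] := by simp [HSlots.sfAt]
    refine (runs_whenNot_true h _ _ hs).of_eq ?_ (by simp only [sfStepCost]; omega)
    simp [HSlots.sfAt]
  | none =>
    rw [sfRun_succ_none hst]
    obtain ⟨hL1, hLLB⟩ := sfRun_L N e LB M hLB hout j (by rw [hst])
    rw [hst] at hL1 hLLB
    simp only at hL1 hLLB
    have hα1N : α + 1 < N := by omega
    have hlα : (encodeNat α).length ≤ n := (Brick.length_encodeNat_mono (by omega : α ≤ N)).trans hlN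
    have hlα1 : (encodeNat (α + 1)).length ≤ n := (Brick.length_encodeNat_mono hα1N.le).trans hlN
    have hlLn : (encodeNat (L * 2 ^ (2 * e))).length ≤ n := (Brick.length_encodeNat_mono (Nat.mul_le_mul_right _ hLLB)).trans hlLBn
    have hs : hSt h T { u.sfAt (i + 1) (α, L, none) with u2 := List.replicate i true } (h .SFDIVS) = [] := by simp [HSlots.sfAt, hsfdivs]
    let v : HSlots := { u with u2 := List.replicate i true, bla := encodeNat (α + 1), sfl := encodeNat L }
    have h1 : Runs ((NS.ofList [.succ (h .X2) (h .BLA), .clear (h .BLA), .move (h .X2) (h .BLA)] : NS β).com)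
        (base (hSt h T { u.sfAt (i + 1) (α, L, none) with u2 := List.replicate i true })) (base (hSt h T v)) (83 * c) := by
      refine NS.runs_of_eq (N := n) _ _ ?_ ?_ (by simp [hc3])
      · simp (config := { decide := true }) only [NS.ofList, NS.ok, NOp.ok, NS.eval, NOp.eval, hSt_X2, hSt_BLA, update_hSt_X2, update_hSt_BLA, HSlots.sfAt, hx2,
          bitsToNat_encodeNat, ne_eq, EmbeddingLike.apply_eq_iff_eq, List.length_nil, zero_le, and_self, hlα, hlα1, not_false_eq_true]
      · simp [HSlots.sfAt, v, hx2]
    have h2 := runs_sfBase h (N := N) (e := e) (α := α + 1) (L := L) (LB := LB) (M := M) hNodd hN1 hn hen T hI hCI v hw hsched hhist hbg hkn' hbf hα1N hL1 hLB hlLn hlLB hlM1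
      (by simp [v]) (by simp [v, ha1p]) (by simp [v, hblpow]) (by simp [v]) (by simp [v, hsfbmax]) (by simp [v, hsfm])
      (by simp [v, hl1]) (by simp [v, hx1]) (by simp [v, hx2]) (by simp [v, hx3]) (by simp [v, hx4]) (by simp [v, hx5]) (by simp [v, hx6])
      (by simp [v, hfl1]) (by simp [v, hfl2]) (by simp [v, hl2]) (by simp [v, hu1]) (by simp [v, hl4]) (by simp [v, hptk]) (by simp [v, hptu]) (by simp [v, hblf])
      (by simp [v, hble]) (by simp [v, hblc1]) (by simp [v, hblc2]) (by simp [v, hblout]) (by simp [v, ha1i]) (by simp [v, ha1ai]) (by simp [v, ha1g])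
      (by simp [v, hblg]) (by simp [v, hblfp]) (by simp [v, ha1v]) (by simp [v, ha1c]) (by simp [v, hblm]) (by simp [v, hblk])
      (by simp [v, hsfe]) (by simp [v, hsfk]) (by simp [v, hsft]) (by simp [v, hsfr]) (by simp [v, hsfbeta]) (by simp [v, hsfcand]) (by simp [v, hsfdivs]) (by simp [v, hsfd])
    refine (runs_whenNot_nil h _ hs (h1.seq h2)).of_eq ?_ (by simp only [sfStepCost, ← hc3]; omega)
    set out := sfBaseOut N (α + 1) e L LB M with hout0
    by_cases hstop : out.stop = true
    · rw [if_pos hstop]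
      simp [HSlots.sfAt, HSlots.sfFinal, v, hstop, hl1, hx1, hfl2, hptk, hptu, hblf, hblout, ha1i, ha1ai, ha1g, hblg, hblfp, ha1v, ha1c, hblm, hblk, hsfe, hsfk, hsfcand]
    · rw [if_neg hstop]
      obtain ⟨-, hc0, hf0⟩ := (sfBaseOut_facts N (α + 1) e L LB M hL1).2 (by simpa using hstop)
      rw [← hout0] at hc0 hf0
      simp [HSlots.sfAt, HSlots.sfFinal, v, hstop, hc0, hf0, encOpt, flagOpt, show encodeNat 0 = [] from rfl, hl1, hx1, hfl2, hptk, hptu, hblf, hblout, ha1i, ha1ai,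
        ha1g, hblg, hblfp, ha1v, ha1c, hblm, hblk, hsfe, hsfk, hsfcand, hsfd, hsfdivs, hsfr, hsfbeta]

/-- The search: `BLA := 1`, `SFL := 1`, the count `B` (from `SFB`) in unary, the loop. [folklore] -/
def sfSearch : Com (EReg ⊕ β) :=
  ((NS.ofList [.const (h .BLA) (encodeNat 1), .const (h .SFL) (encodeNat 1)] : NS β).com) ;; (nToUnary (h .U2) (h .SFB) ;; sfLoop h)

/-- Cost of the search over `B` bases. [folklore] -/
def sfSearchCost (n e M LB B : ℕ) : ℕ := 8 * (n + 1) ^ 3 + ((encodeNat B).length * (16 * B + 21) + 5) + (B * (sfStepCost n e M LB + 2) + 1)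

/-- **The base search**: after `B` bases the registers are `u.sfAt 0 (sfRun N e LB M B)`. [folklore] -/
theorem runs_sfSearch {N n e LB M B : ℕ} (hNodd : Odd N) (hN1 : 1 < N) (hn : (encodeNat N).length + 1 ≤ n) (hen : 2 * e + 8 ≤ n)
    (T : Regs β) (hI : DrvInv (rGH h) N T) (hCI : T (h (.g .CINV)) = encodeNat (NegFFT.inv2N N))
    (u : HSlots) (hw : u.gw.Clean) (hsched : u.gw.sched = []) (hhist : u.gw.hist = []) (hbg : u.gw.bg = []) (hkn' : u.gw.kn = []) (hbf : u.gw.bf = [])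
    (hLB : 1 ≤ LB) (hlLBn : (encodeNat (LB * 2 ^ (2 * e))).length ≤ n) (hlM1 : (encodeNat (M + 1)).length ≤ n) (hBN : B + 2 ≤ N)
    (ha1p : u.a1p = encodeNat e) (hblpow : u.blpow = encodeNat 2) (hsfbmax : u.sfbmax = encodeNat LB) (hsfm : u.sfm = encodeNat M) (hsfb : u.sfb = encodeNat B)
    (hbla : u.bla = []) (hsfl : u.sfl = []) (hu2 : u.u2 = [])
    (hl1 : u.l1 = []) (hx1 : u.x1 = []) (hx2 : u.x2 = []) (hx3 : u.x3 = []) (hx4 : u.x4 = []) (hx5 : u.x5 = []) (hx6 : u.x6 = [])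
    (hfl1 : u.fl1 = []) (hfl2 : u.fl2 = []) (hl2 : u.l2 = []) (hu1 : u.u1 = []) (hl4 : u.l4 = []) (hptk : u.ptk = []) (hptu : u.ptu = []) (hblf : u.blf = [])
    (hble : u.ble = []) (hblc1 : u.blc1 = []) (hblc2 : u.blc2 = []) (hblout : u.blout = []) (ha1i : u.a1i = []) (ha1ai : u.a1ai = []) (ha1g : u.a1g = [])
    (hblg : u.blg = []) (hblfp : u.blfp = []) (ha1v : u.a1v = []) (ha1c : u.a1c = []) (hblm : u.blm = []) (hblk : u.blk = [])
    (hsfe : u.sfe = []) (hsfk : u.sfk = []) (hsft : u.sft = []) (hsfr : u.sfr = []) (hsfbeta : u.sfbeta = []) (hsfcand : u.sfcand = []) (hsfdivs : u.sfdivs = []) (hsfd : u.sfd = []) :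
    Runs (sfSearch h) (base (hSt h T u)) (base (hSt h T (u.sfAt 0 (sfRun N e LB M B)))) (sfSearchCost n e M LB B) := by
  have hN0 : 0 < N := by omega
  set c := (n + 1) ^ 3 with hc3
  have hlN : (encodeNat N).length ≤ n := by omega
  have e1 : encodeNat 1 = [true] := by simpa using encodeNat_two_pow 0
  have hl1n : (encodeNat 1).length ≤ n := by rw [e1]; simp only [List.length_cons, List.length_nil]; omega
  let u0 : HSlots := { u with bla := encodeNat 1, sfl := encodeNat 1 }
  have h0 : Runs ((NS.ofList [.const (h .BLA) (encodeNat 1), .const (h .SFL) (encodeNat 1)] : NS β).com) (base (hSt h T u)) (base (hSt h T u0)) (8 * c) := by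
    refine NS.runs_of_eq (N := n) _ _ ?_ (by simp [u0]) (by simp [hc3])
    simp only [NS.ofList, NS.ok, NOp.ok, NS.eval, NOp.eval, hSt_BLA, hSt_SFL, update_hSt_BLA, hbla, hsfl, List.length_nil, and_true]
    exact ⟨⟨by omega, hl1n⟩, by omega, hl1n⟩
  have hstart : u.sfAt B (sfRun N e LB M 0) = { u0 with u2 := List.replicate B true } := by simp [HSlots.sfAt, sfRun, u0]
  have h1 : Runs (nToUnary (h .U2) (h .SFB)) (base (hSt h T u0)) (base (hSt h T (u.sfAt B (sfRun N e LB M 0)))) ((encodeNat B).length * (16 * B + 21) + 5) := by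
    refine (runs_nToUnary (h .U2) (h .SFB) (hSt h T u0) (by simp [u0, hu2])).of_eq ?_ ?_
    · rw [hstart]; simp [u0, hsfb]
    · simp only [hSt_SFB, u0, hsfb, bitsToNat_encodeNat]; exact le_rfl
  have hL := runs_countLoop (U := (Sum.inr (h .U2) : EReg ⊕ β)) (body := sfStep h) (fun i R => i ≤ B ∧ R = base (hSt h T (u.sfAt i (sfRun N e LB M (B - i))))) (sfStepCost n e M LB)
    (by
      rintro i R ⟨hi, rfl⟩ -
      have hupd : Function.update (base (hSt h T (u.sfAt (i + 1) (sfRun N e LB M (B - (i + 1)))))) (Sum.inr (h .U2)) (List.replicate i true) =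
          base (hSt h T { u.sfAt (i + 1) (sfRun N e LB M (B - (i + 1))) with u2 := List.replicate i true }) := by
        rcases hq : sfRun N e LB M (B - (i + 1)) with ⟨α, L, r⟩
        cases r <;> simp [HSlots.sfAt]
      rw [hupd]
      have hstep := runs_sfStep h (j := B - (i + 1)) (i := i) hNodd hN1 hn hen T hI hCI u hw hsched hhist hbg hkn' hbf hLB hlLBn hlM1 hBN ha1p hblpow hsfbmax hsfm
        hl1 hx1 hx2 hx3 hx4 hx5 hx6 hfl1 hfl2 hl2 hu1 hl4 hptk hptu hblf hble hblc1 hblc2 hblout ha1i ha1ai ha1g hblg hblfp ha1v ha1c hblm hblk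
        hsfe hsfk hsft hsfr hsfbeta hsfcand hsfdivs hsfd (by omega)
      have hj : B - (i + 1) + 1 = B - i := by omega
      rw [hj] at hstep
      refine ⟨_, hstep, ?_, by omega, rfl⟩
      rcases hq : sfRun N e LB M (B - i) with ⟨α, L, r⟩
      cases r <;> simp [HSlots.sfAt])
    B (base (hSt h T (u.sfAt B (sfRun N e LB M 0)))) ⟨le_rfl, by simp⟩ (by rw [hstart]; simp [u0])
  obtain ⟨R', hR, -, -, rfl⟩ := hL
  simp only [Nat.sub_zero] at hR
  refine (h0.seq (h1.seq hR)).of_eq rfl ?_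
  simp only [sfSearchCost, ← hc3]; omega

end BaseSearch

/-! ### What the base search proves

The arithmetic behind the casework: with `α` a unit of `ℤ/N` and `α^{e*} = 1`, if no divisor `u`
of `e*` has a proper `gcd(α^u − 1, N)`, then the least divisor `K` with `α^K = 1` is the order of
`α` modulo `N` *and modulo every prime factor of `N`*, so every prime factor is `≡ 1 (mod K)`. -/

section BaseSearchMath

/-- The residue `α^u − 1` of `powGcd` in `ℤ/N`. [folklore] -/
theorem powGcd_residue_cast {N : ℕ} (hN1 : 1 < N) (α u : ℕ) :
    ((((α ^ u % N + N - 1) % N : ℕ)) : ZMod N) = (α : ZMod N) ^ u - 1 := by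
  rw [ZMod.natCast_mod, Nat.cast_sub (by omega)]
  push_cast
  simp [ZMod.natCast_mod]

/-- `g_u = N` iff `α^u = 1` in `ℤ/N`. [folklore] -/
theorem powGcd_eq_self_iff {N : ℕ} (hN1 : 1 < N) (α u : ℕ) : powGcd N α u = N ↔ (α : ZMod N) ^ u = 1 := by
  have hN0 : 0 < N := by omega
  rw [powGcd, gcd_eq_self_iff_of_lt (Nat.mod_lt _ hN0)]
  constructor
  · intro h0
    have hc := powGcd_residue_cast hN1 α u
    rw [h0, Nat.cast_zero] at hc
    exact (sub_eq_zero.1 hc.symm)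
  · intro h1
    have hc := powGcd_residue_cast hN1 α u
    rw [h1, sub_self] at hc
    have hdvd := (ZMod.natCast_eq_zero_iff _ _).1 hc
    exact Nat.eq_zero_of_dvd_of_lt hdvd (Nat.mod_lt _ hN0)

/-- If `α^u = 1` modulo a prime factor of `N` then `g_u ≠ 1`. [folklore] -/
theorem powGcd_ne_one_of_prime {N p α u : ℕ} (hN1 : 1 < N) (hp : p.Prime) (hpN : p ∣ N) (h1 : (α : ZMod p) ^ u = 1) : powGcd N α u ≠ 1 := by
  have hN0 : 0 < N := by omega
  set r := (α ^ u % N + N - 1) % N with hr0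
  have hc := powGcd_residue_cast hN1 α u
  rw [← hr0] at hc
  have hrp : ((r : ℕ) : ZMod p) = 0 := by
    have := congrArg (ZMod.castHom hpN (ZMod p)) hc
    rw [map_natCast, map_sub, map_pow, map_natCast, map_one, h1, sub_self] at this
    exact this
  have hpr : p ∣ r := (ZMod.natCast_eq_zero_iff _ _).1 hrp
  intro hg
  have : p ∣ Nat.gcd r N := Nat.dvd_gcd hpr hpN
  rw [powGcd, ← hr0] at hg
  rw [hg] at this
  exact hp.one_lt.ne' (Nat.dvd_one.1 this)

/-- A found factor is kept by the later rounds. [folklore] -/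
theorem sfDivStep_of_some {N α es t : ℕ} (s : ℕ × Option ℕ) {g : ℕ} (h : s.2 = some g) : sfDivStep N α es t s = s := by
  obtain ⟨K, f⟩ := s
  simp only at h
  subst h
  rfl

/-- A round at a non-divisor. [folklore] -/
theorem sfDivStep_none_of_not_dvd {N α es t K : ℕ} (hd : ¬ es % t = 0) : sfDivStep N α es t (K, none) = (K, none) := by
  unfold sfDivStep; simp [hd]

/-- A round at a divisor whose first exponent yields a factor. [folklore] -/
theorem sfDivStep_none_of_fst {N α es t K g : ℕ} (hd : es % t = 0) (hp : (procSpec N α t K).2 = some g) :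
    sfDivStep N α es t (K, none) = ((procSpec N α t K).1, some g) := by
  unfold sfDivStep
  simp only [hd, if_true]
  rcases hq : procSpec N α t K with ⟨K1, f1⟩
  rw [hq] at hp
  simp only at hp
  subst hp
  rfl

/-- A round at a divisor whose first exponent yields no factor. [folklore] -/
theorem sfDivStep_none_of_snd {N α es t K : ℕ} (hd : es % t = 0) (hp : (procSpec N α t K).2 = none) :
    sfDivStep N α es t (K, none) = procSpec N α (es / t) (procSpec N α t K).1 := by
  unfold sfDivStep
  simp only [hd, if_true]
  rcases hq : procSpec N α t K with ⟨K1, f1⟩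
  rw [hq] at hp
  simp only at hp
  subst hp
  rfl

/-- One exponent without a factor: `g ∈ {1, N}`, and the new `K`. [folklore] -/
theorem procSpec_none_facts {N α u K₀ : ℕ} (hN1 : 1 < N) (hu : (procSpec N α u K₀).2 = none) :
    (powGcd N α u = 1 ∨ powGcd N α u = N) ∧ ((procSpec N α u K₀).1 = K₀ ∨ ((procSpec N α u K₀).1 = u ∧ powGcd N α u = N)) ∧
    (procSpec N α u K₀).1 ≤ K₀ ∧ (powGcd N α u = N → (procSpec N α u K₀).1 ≤ u) := by
  unfold procSpec at hu ⊢
  split_ifs at hu ⊢ with g1 gN hlt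
  · exact ⟨Or.inl g1, Or.inl rfl, le_rfl, fun h => by have := g1.symm.trans h; omega⟩
  · exact ⟨Or.inr gN, Or.inr ⟨rfl, gN⟩, hlt.le, fun _ => le_rfl⟩
  · exact ⟨Or.inr gN, Or.inl rfl, le_rfl, fun _ => by show K₀ ≤ u; omega⟩

/-- The rounds before a factor-free round are factor-free. [folklore] -/
theorem divRun_none_prev {N α es j : ℕ} (hnone : (divRun N α es (j + 1)).2 = none) : (divRun N α es j).2 = none := by
  cases hq : (divRun N α es j).2 with
  | none => rfl
  | some g => rw [divRun, sfDivStep_of_some _ hq, hq] at hnone; exact absurd hnone (by simp)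

/-- The invariant of the casework when no factor is found: all processed divisors `t ≤ j` of `e*`
and their cofactors have `g ∈ {1, N}`, and `K` is `e*` or a processed exponent with `g_K = N`, below
all of them. [folklore] -/
theorem divRun_none_inv {N α es : ℕ} (hN1 : 1 < N) : ∀ j, (divRun N α es j).2 = none →
    (∀ t, 1 ≤ t → t ≤ j → es % t = 0 →
      (powGcd N α t = 1 ∨ powGcd N α t = N) ∧ (powGcd N α (es / t) = 1 ∨ powGcd N α (es / t) = N) ∧
      (powGcd N α t = N → (divRun N α es j).1 ≤ t) ∧ (powGcd N α (es / t) = N → (divRun N α es j).1 ≤ es / t)) ∧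
    ((divRun N α es j).1 = es ∨ ((divRun N α es j).1 ∣ es ∧ powGcd N α (divRun N α es j).1 = N))
  | 0, _ => ⟨fun t h1 h2 _ => by omega, Or.inl rfl⟩
  | j + 1, hnone => by
    have hprev := divRun_none_prev hnone
    obtain ⟨ih1, ih2⟩ := divRun_none_inv hN1 j hprev
    have hpair : divRun N α es j = ((divRun N α es j).1, none) := by rw [← hprev]
    set K := (divRun N α es j).1 with hK0
    rw [divRun, hpair] at hnone ⊢
    by_cases hd : es % (j + 1) = 0
    · cases hp1 : (procSpec N α (j + 1) K).2 with
      | some g => rw [sfDivStep_none_of_fst hd hp1] at hnone; simp at hnone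
      | none =>
        rw [sfDivStep_none_of_snd hd hp1] at hnone ⊢
        obtain ⟨hg1, hK1, hK1le, hK1min⟩ := procSpec_none_facts (K₀ := K) hN1 hp1
        obtain ⟨hg2, hK2, hK2le, hK2min⟩ := procSpec_none_facts (K₀ := (procSpec N α (j + 1) K).1) hN1 hnone
        refine ⟨fun t ht1 ht2 htd => ?_, ?_⟩
        · rcases Nat.lt_succ_iff_lt_or_eq.1 (Nat.lt_succ_iff.2 ht2) with ht | rfl
          · obtain ⟨a1, a2, a3, a4⟩ := ih1 t ht1 (by omega) htd
            exact ⟨a1, a2, fun h => hK2le.trans (hK1le.trans (a3 h)), fun h => hK2le.trans (hK1le.trans (a4 h))⟩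
          · exact ⟨hg1, hg2, fun h => hK2le.trans (hK1min h), fun h => hK2min h⟩
        · rcases hK2 with hK2 | ⟨hK2, hgK2⟩
          · rw [hK2]
            rcases hK1 with hK1 | ⟨hK1, hgK1⟩
            · rw [hK1]; exact ih2
            · rw [hK1]; exact Or.inr ⟨Nat.dvd_of_mod_eq_zero hd, hgK1⟩
          · rw [hK2]; exact Or.inr ⟨Nat.div_dvd_of_dvd (Nat.dvd_of_mod_eq_zero hd), hgK2⟩
    · rw [sfDivStep_none_of_not_dvd hd] at hnone ⊢
      refine ⟨fun t ht1 ht2 htd => ?_, ih2⟩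
      rcases Nat.lt_succ_iff_lt_or_eq.1 (Nat.lt_succ_iff.2 ht2) with ht | rfl
      · exact ih1 t ht1 (by omega) htd
      · exact absurd htd hd

/-- Every divisor of `e* ≤ d²` is processed by the `d` rounds (as `t` or as `e*/t`). [folklore] -/
theorem divRun_none_processed {N α es d : ℕ} (hN1 : 1 < N) (hes1 : 1 ≤ es) (hesd : es ≤ d * d) (hnone : (divRun N α es d).2 = none)
    {u : ℕ} (hu1 : 1 ≤ u) (hu : u ∣ es) :
    (powGcd N α u = 1 ∨ powGcd N α u = N) ∧ (powGcd N α u = N → (divRun N α es d).1 ≤ u) := by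
  obtain ⟨hinv, -⟩ := divRun_none_inv hN1 d hnone
  by_cases hud : u ≤ d
  · obtain ⟨a1, -, a3, -⟩ := hinv u hu1 hud (Nat.mod_eq_zero_of_dvd hu)
    exact ⟨a1, a3⟩
  · have hes0 : es ≠ 0 := by omega
    set t := es / u with ht0
    have htu : es / t = u := by rw [ht0, Nat.div_div_self hu hes0]
    have ht1 : 1 ≤ t := Nat.div_pos (Nat.le_of_dvd (by omega) hu) (by omega)
    have htd : t ≤ d := by
      rw [ht0]; apply Nat.lt_succ_iff.1; apply Nat.div_lt_of_lt_mul
      calc es ≤ d * d := hesd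
        _ < u * (d + 1) := by nlinarith
    have htdvd : es % t = 0 := Nat.mod_eq_zero_of_dvd (Nat.div_dvd_of_dvd hu)
    obtain ⟨-, a2, -, a4⟩ := hinv t ht1 htd htdvd
    rw [htu] at a2 a4
    exact ⟨a2, a4⟩

/-- **The casework finds the order.** With `α` a unit, `α^{e*} = 1`, `1 ≤ e* ≤ d²` and no factor in
the `d` rounds: `K` is the order of `α` in `ℤ/N`, it is the order of `α` modulo every prime factor
`p` of `N`, hence `K ∣ p − 1`. [folklore] -/
theorem divRun_none_order {N α es d : ℕ} (hN1 : 1 < N) (hcop : Nat.Coprime α N) (hes1 : 1 ≤ es) (hesd : es ≤ d * d)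
    (hpow : (α : ZMod N) ^ es = 1) (hnone : (divRun N α es d).2 = none) :
    1 ≤ (divRun N α es d).1 ∧ (divRun N α es d).1 ∣ es ∧ (α : ZMod N) ^ (divRun N α es d).1 = 1 ∧
    (∀ u, 1 ≤ u → (α : ZMod N) ^ u = 1 → (divRun N α es d).1 ≤ u) ∧
    ∀ p, p.Prime → p ∣ N → (divRun N α es d).1 ∣ p - 1 := by
  haveI : NeZero N := ⟨by omega⟩
  obtain ⟨-, hK⟩ := divRun_none_inv hN1 d hnone
  set K := (divRun N α es d).1 with hK0
  have hK1 : 1 ≤ K := divRun_fst_pos N α hes1 d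
  have hKes : K ∣ es := by
    rcases hK with hK | ⟨hK, -⟩
    · rw [hK]
    · exact hK
  have hαK : (α : ZMod N) ^ K = 1 := by
    rcases hK with hK | ⟨-, hK⟩
    · rw [hK]; exact hpow
    · exact (powGcd_eq_self_iff hN1 α K).1 hK
  -- the order in ℤ/N
  set αu : (ZMod N)ˣ := ZMod.unitOfCoprime α hcop with hαu0
  have hαu : ((αu : (ZMod N)ˣ) : ZMod N) = (α : ZMod N) := ZMod.coe_unitOfCoprime α hcop
  have hord : orderOf (α : ZMod N) = orderOf αu := by rw [← hαu, orderOf_units]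
  have hordpos : 1 ≤ orderOf (α : ZMod N) := by rw [hord]; exact orderOf_pos αu
  have hmin : ∀ u, 1 ≤ u → (α : ZMod N) ^ u = 1 → K ≤ u := by
    intro u hu1 hu
    have hdvd : orderOf (α : ZMod N) ∣ u := orderOf_dvd_of_pow_eq_one hu
    have hdes : orderOf (α : ZMod N) ∣ es := orderOf_dvd_of_pow_eq_one hpow
    obtain ⟨h1, h2⟩ := divRun_none_processed hN1 hes1 hesd hnone hordpos hdes
    have hgN : powGcd N α (orderOf (α : ZMod N)) = N := (powGcd_eq_self_iff hN1 α _).2 (pow_orderOf_eq_one _)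
    exact (h2 hgN).trans (Nat.le_of_dvd (by omega) hdvd)
  refine ⟨hK1, hKes, hαK, hmin, fun p hp hpN => ?_⟩
  haveI : Fact p.Prime := ⟨hp⟩
  have hαp : (α : ZMod p) ≠ 0 := by
    intro h0
    have hpα : p ∣ α := (ZMod.natCast_eq_zero_iff _ _).1 h0
    have := Nat.dvd_gcd hpα hpN
    rw [hcop] at this
    exact hp.one_lt.ne' (Nat.dvd_one.1 this)
  have hcast : ∀ m, (α : ZMod N) ^ m = 1 → (α : ZMod p) ^ m = 1 := fun m hm => by
    have := congrArg (ZMod.castHom hpN (ZMod p)) hm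
    rwa [map_pow, map_natCast, map_one] at this
  set kp := orderOf (α : ZMod p) with hkp0
  have hkpK : kp ∣ K := orderOf_dvd_of_pow_eq_one (hcast K hαK)
  have hkp1 : 1 ≤ kp := by
    have hu : IsUnit (α : ZMod p) := Ne.isUnit hαp
    obtain ⟨w, hw⟩ := hu
    rw [hkp0, ← hw, orderOf_units]; exact orderOf_pos w
  have hKkp : K ≤ kp := by
    obtain ⟨h1, h2⟩ := divRun_none_processed hN1 hes1 hesd hnone hkp1 (hkpK.trans hKes)
    have hne : powGcd N α kp ≠ 1 := powGcd_ne_one_of_prime hN1 hp hpN (pow_orderOf_eq_one _)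
    rcases h1 with h1 | h1
    · exact absurd h1 hne
    · exact h2 h1
  have hKeq : K = kp := le_antisymm hKkp (Nat.le_of_dvd (by omega) hkpK)
  rw [hKeq, hkp0]
  exact ZMod.orderOf_dvd_card_sub_one hαp

/-- **A factor from the casework is a proper divisor.** [folklore] -/
theorem divRun_some_factor {N α es : ℕ} (hN1 : 1 < N) : ∀ j {g : ℕ}, (divRun N α es j).2 = some g → 1 < g ∧ g < N ∧ g ∣ N
  | 0, g, h0 => by simp [divRun] at h0
  | j + 1, g, h0 => by
    have hN0 : 0 < N := by omega
    have key : ∀ u K₀ g', (procSpec N α u K₀).2 = some g' → 1 < g' ∧ g' < N ∧ g' ∣ N := by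
      intro u K₀ g' hp
      unfold procSpec at hp
      by_cases g1 : powGcd N α u = 1
      · simp [g1] at hp
      · by_cases gN : powGcd N α u = N
        · rw [if_neg g1, if_pos gN] at hp; simp at hp
        · rw [if_neg g1, if_neg gN] at hp
          simp only [Option.some.injEq] at hp
          rw [← hp]
          have hle : powGcd N α u ≤ N := Nat.gcd_le_right _ hN0
          have hpos : 0 < powGcd N α u := Nat.gcd_pos_of_pos_right _ hN0
          exact ⟨by omega, by omega, Nat.gcd_dvd_right _ _⟩
    cases hq : (divRun N α es j).2 with
    | some g' =>
      rw [divRun, sfDivStep_of_some _ hq, hq] at h0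
      obtain rfl := Option.some.inj h0
      exact divRun_some_factor hN1 j hq
    | none =>
      have hpair : divRun N α es j = ((divRun N α es j).1, none) := by rw [← hq]
      rw [divRun, hpair] at h0
      by_cases hd : es % (j + 1) = 0
      · cases hp1 : (procSpec N α (j + 1) (divRun N α es j).1).2 with
        | some g1 =>
          rw [sfDivStep_none_of_fst hd hp1] at h0
          obtain rfl := Option.some.inj h0
          exact key _ _ _ hp1
        | none =>
          rw [sfDivStep_none_of_snd hd hp1] at h0
          exact key _ _ _ h0
      · rw [sfDivStep_none_of_not_dvd hd] at h0; simp at h0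

/-! #### The meaning of the per-base outcome -/

/-- The giant-step values are the powers `α^{d(j+1)}` modulo any factor of `N`. [folklore] -/
theorem sfValList_cast {N p α d j : ℕ} (hpN : p ∣ N) (hj : j < d) :
    (((sfValList N (α ^ d % N) d).getD j 0 : ℕ) : ZMod p) = (α : ZMod p) ^ (d * (j + 1)) := by
  have hget : (sfValList N (α ^ d % N) d).getD j 0 = (α ^ d % N) ^ (j + 1) % N := by
    rw [sfValList, List.getD_eq_getElem _ _ (by simpa using hj)]; simp
  rw [hget]
  have h1 : ((((α ^ d % N) ^ (j + 1) % N : ℕ)) : ZMod N) = (α : ZMod N) ^ (d * (j + 1)) := by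
    rw [ZMod.natCast_mod, Nat.cast_pow, ZMod.natCast_mod, Nat.cast_pow, ← pow_mul]
  have := congrArg (ZMod.castHom hpN (ZMod p)) h1
  rwa [map_natCast, map_pow, map_natCast] at this

/-- Membership of the giant-step values. [folklore] -/
theorem sfValList_getD_mem {N β d j : ℕ} (hj : j < d) : (sfValList N β d).getD j 0 ∈ sfValList N β d := by
  rw [List.getD_eq_getElem _ _ (by simpa [sfValList] using hj)]; exact List.getElem_mem _

/-- **"Clear" certifies**: if Algorithm 1 on the giant steps `α^{d(j+1)}` against the baby steps `α^i`
(`d = 2^e`) finds nothing, then `α^x ≠ 1` modulo every prime factor of `N` for all `1 ≤ x ≤ d²`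
(write `x = (j+1)d − i`). [folklore] -/
theorem sfBase_clear_pow_ne_one {N e α : ℕ} (hNodd : Odd N) (hN1 : 1 < N) {b : List ℕ}
    (hb : NegFFT.prodTreeH N e (sfValList N (α ^ 2 ^ e % N) (2 ^ e)) = [b])
    (h1 : (alg1Out N α 1 (2 ^ e) (e + 2) e b (sfValList N (α ^ 2 ^ e % N) (2 ^ e))).1 = none)
    (h2 : (alg1Out N α 1 (2 ^ e) (e + 2) e b (sfValList N (α ^ 2 ^ e % N) (2 ^ e))).2.1 = none)
    {p : ℕ} (hp : p.Prime) (hpN : p ∣ N) {x : ℕ} (hx1 : 1 ≤ x) (hx : x ≤ 2 ^ e * 2 ^ e) : (α : ZMod p) ^ x ≠ 1 := by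
  set d := 2 ^ e with hd0
  have hd1 : 1 ≤ d := Nat.one_le_two_pow
  have hvs : (sfValList N (α ^ d % N) d).length = 2 ^ e := by simp [sfValList, hd0]
  have hclear := fun (i : ℕ) (hi : i < d) (v : ℕ) (hv : v ∈ sfValList N (α ^ d % N) d) =>
    alg1Out_clear (N := N) (α := α) (cc := 1) (m := d) (k := e + 2) (e := e) hNodd hN1 (by omega)
      (by rw [show e + 2 - 1 = e + 1 by omega, pow_succ]; omega) hvs hb h1 h2 hp hpN hi hv
  intro hαx
  -- x = (j+1)·d − i with j < d, i < d
  obtain ⟨j, i, hj, hi, hji⟩ : ∃ j i, j < d ∧ i < d ∧ (j + 1) * d = x + i := by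
    have h1 := Nat.div_mul_le_self (x - 1) d
    have h2 := Nat.lt_mul_div_succ (x - 1) (show 0 < d by omega)
    have h3 : ((x - 1) / d + 1) * d = (x - 1) / d * d + d := by ring
    have h4 : d * ((x - 1) / d + 1) = (x - 1) / d * d + d := by ring
    refine ⟨(x - 1) / d, ((x - 1) / d + 1) * d - x, ?_, ?_, ?_⟩
    · exact (Nat.div_lt_iff_lt_mul (by omega)).2 (by omega)
    · omega
    · omega
  have hv := sfValList_getD_mem (N := N) (β := α ^ d % N) hj
  have hcast := sfValList_cast (N := N) (α := α) (d := d) hpN hj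
  apply hclear i hi _ hv
  rw [Nat.cast_one, one_mul, hcast, show d * (j + 1) = x + i by rw [mul_comm]; exact hji, pow_add, hαx, one_mul]

/-- **An exact hit gives `α^{e*} = 1`** with `e* = (h+1)·2^e − i`, `1 ≤ e* ≤ 4^e`. [folklore] -/
theorem sfBase_exact_pow_eq_one {N e α : ℕ} (hN1 : 1 < N) (hcop : Nat.Coprime α N) {b : List ℕ} {i₀ h₀ : ℕ}
    (h2 : (alg1Out N α 1 (2 ^ e) (e + 2) e b (sfValList N (α ^ 2 ^ e % N) (2 ^ e))).2.1 = some i₀)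
    (h3 : (alg1Out N α 1 (2 ^ e) (e + 2) e b (sfValList N (α ^ 2 ^ e % N) (2 ^ e))).2.2 = some h₀) :
    i₀ < 2 ^ e ∧ h₀ < 2 ^ e ∧ (α : ZMod N) ^ ((h₀ + 1) * 2 ^ e - i₀) = 1 := by
  have hN0 : 0 < N := by omega
  have hvs : (sfValList N (α ^ 2 ^ e % N) (2 ^ e)).length = 2 ^ e := by simp [sfValList]
  have hvN : ∀ v ∈ sfValList N (α ^ 2 ^ e % N) (2 ^ e), v < N := fun v hv => by
    simp only [sfValList, List.mem_map, List.mem_range] at hv; obtain ⟨j, -, rfl⟩ := hv; exact Nat.mod_lt _ hN0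
  obtain ⟨hi₀, hh₀, heq⟩ := alg1Out_exact (N := N) (α := α) (cc := 1) (m := 2 ^ e) (k := e + 2) (e := e) hN1 hvs hvN h2 h3
  rw [sfValList_cast (dvd_refl N) hh₀, Nat.cast_one, one_mul] at heq
  refine ⟨hi₀, hh₀, ?_⟩
  have hsplit : 2 ^ e * (h₀ + 1) = ((h₀ + 1) * 2 ^ e - i₀) + i₀ := by
    have : i₀ ≤ (h₀ + 1) * 2 ^ e := by nlinarith
    rw [mul_comm]; omega
  rw [hsplit, pow_add] at heq
  have hu : IsUnit ((α : ZMod N) ^ i₀) := ((ZMod.isUnit_iff_coprime _ _).2 hcop).pow _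
  exact hu.mul_right_cancel (heq.trans (one_mul _).symm)

/-- The paths of the exact-hit branch. [folklore] -/
theorem sfEOut_shape (N L LB M : ℕ) (dr : ℕ × Option ℕ) :
    (∃ g, dr.2 = some g ∧ sfEOut N L LB M dr = ⟨true, 1, L, some g⟩) ∨
    (dr.2 = none ∧ LB ≤ Nat.lcm L dr.1 ∧
      ((∃ x₀, firstHit (classHit N (Nat.lcm L dr.1)) (M / Nat.lcm L dr.1) = some x₀ ∧
          sfEOut N L LB M dr = ⟨true, 1, Nat.lcm L dr.1, some (1 + (x₀ + 1) * Nat.lcm L dr.1)⟩) ∨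
       (firstHit (classHit N (Nat.lcm L dr.1)) (M / Nat.lcm L dr.1) = none ∧ sfEOut N L LB M dr = ⟨true, 3, Nat.lcm L dr.1, none⟩))) ∨
    (dr.2 = none ∧ ¬ LB ≤ Nat.lcm L dr.1 ∧ sfEOut N L LB M dr = ⟨false, 0, Nat.lcm L dr.1, none⟩) := by
  cases hd : dr.2 with
  | some g => exact Or.inl ⟨g, rfl, by simp only [sfEOut, hd]⟩
  | none =>
    by_cases hth : LB ≤ Nat.lcm L dr.1
    · cases hf : firstHit (classHit N (Nat.lcm L dr.1)) (M / Nat.lcm L dr.1) with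
      | some x₀ => exact Or.inr (Or.inl ⟨rfl, hth, Or.inl ⟨x₀, rfl, by simp only [sfEOut, hd, if_pos hth, hf]⟩⟩)
      | none => exact Or.inr (Or.inl ⟨rfl, hth, Or.inr ⟨rfl, by simp only [sfEOut, hd, if_pos hth, hf]⟩⟩)
    · exact Or.inr (Or.inr ⟨rfl, hth, by simp only [sfEOut, hd, if_neg hth]⟩)

/-- The paths of the dispatch. [folklore] -/
theorem sfDispOut_shape (N α e L LB M : ℕ) (o : Option ℕ × Option ℕ × Option ℕ) :
    (∃ g, o.1 = some g ∧ sfDispOut N α e L LB M o = ⟨true, 1, L, some g⟩) ∨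
    (o.1 = none ∧ (o.2.1 = none ∨ ∃ i₀, o.2.1 = some i₀ ∧ o.2.2 = none) ∧ sfDispOut N α e L LB M o = ⟨true, 2, L, none⟩) ∨
    (∃ i₀ h₀, o.1 = none ∧ o.2.1 = some i₀ ∧ o.2.2 = some h₀ ∧
      sfDispOut N α e L LB M o = sfEOut N L LB M (divRun N α ((h₀ + 1) * 2 ^ e - i₀) (2 ^ e))) := by
  cases h1 : o.1 with
  | some g => exact Or.inl ⟨g, rfl, by simp only [sfDispOut, h1]⟩
  | none =>
    cases h2 : o.2.1 with
    | none => exact Or.inr (Or.inl ⟨rfl, Or.inl rfl, by simp only [sfDispOut, h1, h2]⟩)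
    | some i₀ =>
      cases h3 : o.2.2 with
      | none => exact Or.inr (Or.inl ⟨rfl, Or.inr ⟨i₀, rfl, rfl⟩, by simp only [sfDispOut, h1, h2, h3]⟩)
      | some h₀ => exact Or.inr (Or.inr ⟨i₀, h₀, rfl, rfl, rfl, by simp only [sfDispOut, h1, h2, h3]⟩)

/-- A hit of the class search is a proper divisor. [folklore] -/
theorem classHit_factor {N L x : ℕ} (hL : 1 ≤ L) (h : classHit N L x = true) :
    1 < 1 + (x + 1) * L ∧ 1 + (x + 1) * L < N ∧ 1 + (x + 1) * L ∣ N := by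
  simp only [classHit, decide_eq_true_eq] at h
  exact ⟨by nlinarith, h.2, Nat.dvd_of_mod_eq_zero h.1⟩

/-- **What one base proves.** For an odd `N > 1`, a unit base `α`, `1 ≤ L`: a reported factor is a
proper divisor; code `2` certifies `α^x ≠ 1` modulo every prime factor for `x ≤ 4^e`; the modulus
only grows (`L ∣ L'`) and keeps dividing `q − 1` for every prime factor `q` for which `L` did; while
continuing `α^{L'} = 1`; code `3` certifies that every prime factor `q ≤ M` with `L' ∣ q − 1` is `N`
itself. [folklore] -/
theorem sfBaseOut_spec {N α e L LB M : ℕ} (hNodd : Odd N) (hN1 : 1 < N) (hcop : Nat.Coprime α N) (hL : 1 ≤ L) :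
    let out := sfBaseOut N α e L LB M
    (∀ g, out.fac = some g → 1 < g ∧ g < N ∧ g ∣ N) ∧
    (out.code = 2 → ∀ p, p.Prime → p ∣ N → ∀ x, 1 ≤ x → x ≤ 2 ^ e * 2 ^ e → (α : ZMod p) ^ x ≠ 1) ∧
    (L ∣ out.L) ∧
    (∀ q, q.Prime → q ∣ N → L ∣ q - 1 → out.L ∣ q - 1) ∧
    (out.stop = false → ((α : ZMod N)) ^ out.L = 1) ∧
    (out.code = 3 → ∀ q, q.Prime → q ∣ N → q ≤ M → out.L ∣ q - 1 → q = N) ∧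
    (out.stop = true → (out.code = 1 ∧ out.fac ≠ none) ∨ (out.code = 2 ∧ out.fac = none) ∨ (out.code = 3 ∧ out.fac = none)) := by
  intro out
  have hN0 : 0 < N := by omega
  set vs := sfValList N (α ^ 2 ^ e % N) (2 ^ e) with hvs0
  have hvs : vs.length = 2 ^ e := by simp [hvs0, sfValList]
  have hvN : ∀ v ∈ vs, v < N := fun v hv => by
    simp only [hvs0, sfValList, List.mem_map, List.mem_range] at hv; obtain ⟨j, -, rfl⟩ := hv; exact Nat.mod_lt _ hN0
  obtain ⟨b, hb, -, -, -⟩ := NegFFT.prodTreeH_spec hNodd hN1 (e := e) hvs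
  have hhead : (NegFFT.prodTreeH N e vs).headD [] = b := by rw [hb]; rfl
  have hout : out = sfDispOut N α e L LB M (alg1Out N α 1 (2 ^ e) (e + 2) e b vs) := by
    show sfBaseOut N α e L LB M = _; simp only [sfBaseOut, ← hvs0, hhead]
  set o := alg1Out N α 1 (2 ^ e) (e + 2) e b vs with ho0
  rcases sfDispOut_shape N α e L LB M o with ⟨g, h1, ho⟩ | ⟨h1, h23, ho⟩ | ⟨i₀, h₀, h1, h2, h3, ho⟩
  · -- factor from Algorithm 1
    rw [hout, ho]
    have hg := alg1Out_factor (N := N) (α := α) (cc := 1) (m := 2 ^ e) (k := e + 2) (e := e) (b := b) (vs := vs) hN1 (by rw [← ho0]; exact h1)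
    refine ⟨fun g' hg' => ?_, by simp, dvd_refl L, fun q _ _ hq => hq, by simp, by simp, by simp⟩
    obtain rfl : g = g' := Option.some.inj hg'; exact hg
  · -- clear (or the impossible unresolved hit)
    rw [hout, ho]
    refine ⟨by simp, fun _ p hp hpN x hx1 hx => ?_, dvd_refl L, fun q _ _ hq => hq, by simp, by simp, by simp⟩
    rcases h23 with h2 | ⟨i₀, h2, h3⟩
    · exact sfBase_clear_pow_ne_one hNodd hN1 hb (by rw [← ho0]; exact h1) (by rw [← ho0]; exact h2) hp hpN hx1 hx
    · exfalso
      exact alg1Out_hit_resolved (N := N) (α := α) (cc := 1) (m := 2 ^ e) (k := e + 2) (e := e) hNodd hN1 (by omega)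
        (by rw [show e + 2 - 1 = e + 1 by omega, pow_succ]; omega) hcop hvs hvN hb (by rw [← ho0]; exact h1) (by rw [← ho0]; exact h2)
        (by rw [← ho0]; exact h3)
  · -- exact hit: the casework
    obtain ⟨hi₀, hh₀, hpow⟩ := sfBase_exact_pow_eq_one (N := N) (e := e) (α := α) hN1 hcop (b := b) (by rw [← ho0]; exact h2) (by rw [← ho0]; exact h3)
    set es := (h₀ + 1) * 2 ^ e - i₀ with hes0
    have hes1 : 1 ≤ es := by have : 2 ^ e ≤ (h₀ + 1) * 2 ^ e := Nat.le_mul_of_pos_left _ (by omega); omega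
    have hesd : es ≤ 2 ^ e * 2 ^ e := (Nat.sub_le _ _).trans (Nat.mul_le_mul_right _ hh₀)
    set dr := divRun N α es (2 ^ e) with hdr0
    rw [hout, ho]
    rcases sfEOut_shape N L LB M dr with ⟨g, hd, hE⟩ | ⟨hd, hth, hcl⟩ | ⟨hd, hth, hE⟩
    · rw [hE]
      have hg := divRun_some_factor (α := α) (es := es) hN1 (2 ^ e) (by rw [← hdr0]; exact hd)
      refine ⟨fun g' hg' => ?_, by simp, dvd_refl L, fun q _ _ hq => hq, by simp, by simp, by simp⟩
      obtain rfl : g = g' := Option.some.inj hg'; exact hg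
    · obtain ⟨hK1, hKes, hαK, -, hKq⟩ := divRun_none_order hN1 hcop hes1 hesd hpow (by rw [← hdr0]; exact hd)
      rw [← hdr0] at hK1 hKes hαK hKq
      have hdvq : ∀ q, q.Prime → q ∣ N → L ∣ q - 1 → Nat.lcm L dr.1 ∣ q - 1 := fun q hq hqN hLq => Nat.lcm_dvd hLq (hKq q hq hqN)
      have hL'1 : 1 ≤ Nat.lcm L dr.1 := Nat.pos_of_ne_zero (Nat.lcm_ne_zero (by omega) (by omega))
      rcases hcl with ⟨x₀, hf, hE⟩ | ⟨hf, hE⟩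
      · rw [hE]
        refine ⟨fun g' hg' => ?_, by simp, Nat.dvd_lcm_left _ _, hdvq, by simp, by simp, by simp⟩
        obtain rfl := Option.some.inj hg'
        rcases firstHit_spec (classHit N (Nat.lcm L dr.1)) (M / Nat.lcm L dr.1) with ⟨hn', -⟩ | ⟨x₁, hs', -, hx₁, -⟩
        · rw [hf] at hn'; simp at hn'
        · rw [hf] at hs'; obtain rfl : x₀ = x₁ := Option.some.inj hs'
          exact classHit_factor hL'1 hx₁
      · rw [hE]
        refine ⟨by simp, by simp, Nat.dvd_lcm_left _ _, hdvq, by simp, fun _ q hq hqN hqM hLq => ?_, by simp⟩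
        -- the class search saw q = 1 + x L'
        simp only at hLq
        set L' := Nat.lcm L dr.1 with hL'0
        rcases firstHit_spec (classHit N L') (M / L') with ⟨-, hall⟩ | ⟨x₁, hs', -, -, -⟩
        · have hq2 := hq.two_le
          obtain ⟨y, hy⟩ := hLq
          have hy1 : 1 ≤ y := by
            by_contra h0; have : y = 0 := by omega
            rw [this, mul_zero] at hy; omega
          have hqy : q = 1 + y * L' := by rw [mul_comm]; omega
          have hyX : y - 1 < M / L' := by
            apply Nat.lt_of_lt_of_le (Nat.sub_lt hy1 Nat.one_pos)
            exact (Nat.le_div_iff_mul_le (by omega)).2 (by nlinarith)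
          have hc := hall (y - 1) hyX
          simp only [classHit, Nat.sub_add_cancel hy1, decide_eq_false_iff_not, not_and, not_lt] at hc
          have hNq : N % q = 0 := Nat.mod_eq_zero_of_dvd hqN
          rw [hqy] at hNq
          have hle := hc hNq
          rw [← hqy] at hle
          exact le_antisymm (Nat.le_of_dvd hN0 hqN) hle
        · rw [hf] at hs'; simp at hs'
    · rw [hE]
      obtain ⟨hK1, hKes, hαK, -, hKq⟩ := divRun_none_order hN1 hcop hes1 hesd hpow (by rw [← hdr0]; exact hd)
      rw [← hdr0] at hK1 hKes hαK hKq
      refine ⟨by simp, by simp, Nat.dvd_lcm_left _ _, fun q hq hqN hLq => Nat.lcm_dvd hLq (hKq q hq hqN), fun _ => ?_, by simp, by simp⟩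
      simp only
      obtain ⟨w, hw⟩ := Nat.dvd_lcm_right L dr.1
      rw [hw, pow_mul, hαK, one_pow]

/-! #### The meaning of the whole search -/

/-- **What the base search proves** after `B` bases, all of them units of `ℤ/N` (i.e. `N` has no
prime factor `≤ B + 1`): the modulus `L` divides `q − 1` for every prime factor `q`; a reported
factor is a proper divisor; code `2` at the final base `α` certifies `α^x ≠ 1 (mod p)` for all prime
factors `p` and `1 ≤ x ≤ 4^e`; code `3` certifies that every prime factor `≤ M` is `N`; and if the
search ran out of bases, every base `a ≤ B + 1` satisfies `a^L = 1` in `ℤ/N` with `L ≤ LB`. [folklore] -/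
theorem sfRun_spec {N e LB M : ℕ} (hNodd : Odd N) (hN1 : 1 < N) (hLB : 1 ≤ LB) {B : ℕ} (hcop : ∀ a, 2 ≤ a → a ≤ B + 1 → Nat.Coprime a N) :
    ∀ j, j ≤ B → let st := sfRun N e LB M j
      (st.2.2 = none → st.1 = 1 + j) ∧ 1 ≤ st.2.1 ∧
      (∀ q, q.Prime → q ∣ N → st.2.1 ∣ q - 1) ∧
      (∀ out g, st.2.2 = some out → out.fac = some g → 1 < g ∧ g < N ∧ g ∣ N) ∧
      (∀ out, st.2.2 = some out → out.code = 2 → ∀ p, p.Prime → p ∣ N → ∀ x, 1 ≤ x → x ≤ 2 ^ e * 2 ^ e → ((st.1 : ℕ) : ZMod p) ^ x ≠ 1) ∧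
      (∀ out, st.2.2 = some out → out.code = 3 → ∀ q, q.Prime → q ∣ N → q ≤ M → q = N) ∧
      (∀ out, st.2.2 = some out → (out.code = 1 ∧ out.fac ≠ none) ∨ (out.code = 2 ∧ out.fac = none) ∨ (out.code = 3 ∧ out.fac = none)) ∧
      (st.2.2 = none → st.2.1 ≤ LB ∧ ∀ a, 2 ≤ a → a ≤ 1 + j → ((a : ℕ) : ZMod N) ^ st.2.1 = 1)
  | 0, _ => by
    refine ⟨fun _ => rfl, le_rfl, fun q _ _ => one_dvd _, by simp [sfRun], by simp [sfRun], by simp [sfRun], by simp [sfRun], fun _ => ⟨hLB, fun a h1 h2 => ?_⟩⟩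
    simp only [sfRun] at h2 ⊢; omega
  | j + 1, hj => by
    obtain ⟨ihα, ihL1, ihq, ihfac, ihclear, ihclass, ihcode, ihnone⟩ := sfRun_spec hNodd hN1 hLB hcop j (by omega)
    rcases hst : sfRun N e LB M j with ⟨α, L, r⟩
    rw [hst] at ihα ihL1 ihq ihfac ihclear ihclass ihcode ihnone
    simp only at ihα ihL1 ihq ihfac ihclear ihclass ihcode ihnone
    cases r with
    | some out =>
      rw [sfRun_succ_some hst]
      exact ⟨fun h0 => absurd h0 (by simp), ihL1, ihq, ihfac, ihclear, ihclass, ihcode, fun h0 => absurd h0 (by simp)⟩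
    | none =>
      have hαj : α = 1 + j := ihα rfl
      rw [sfRun_succ_none hst]
      have hα2 : 2 ≤ α + 1 := by omega
      have hαB : α + 1 ≤ B + 1 := by omega
      have hcopα := hcop (α + 1) hα2 hαB
      obtain ⟨sfac, sclear, sLdvd, sq, spow, sclass, scode⟩ := sfBaseOut_spec (e := e) (LB := LB) (M := M) hNodd hN1 hcopα ihL1
      set out := sfBaseOut N (α + 1) e L LB M with hout0
      obtain ⟨hLLB, hpows⟩ := ihnone rfl
      have hL'1 : 1 ≤ out.L := (sfBaseOut_facts N (α + 1) e L LB M ihL1).1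
      have hq' : ∀ q, q.Prime → q ∣ N → out.L ∣ q - 1 := fun q hq hqN => sq q hq hqN (ihq q hq hqN)
      by_cases hs : out.stop = true
      · rw [if_pos hs]
        refine ⟨fun h0 => absurd h0 (by simp), hL'1, hq', fun out' g ho hg => ?_, fun out' ho hc => ?_, fun out' ho hc q hq hqN hqM => ?_,
          fun out' ho => ?_, fun h0 => absurd h0 (by simp)⟩
        · obtain rfl : out = out' := Option.some.inj ho; exact sfac g hg
        · obtain rfl : out = out' := Option.some.inj ho; exact sclear hc
        · obtain rfl : out = out' := Option.some.inj ho; exact sclass hc q hq hqN hqM (hq' q hq hqN)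
        · obtain rfl : out = out' := Option.some.inj ho; exact scode hs
      · rw [if_neg hs]
        have hs' : out.stop = false := by simpa using hs
        obtain ⟨hLt, -, -⟩ := (sfBaseOut_facts N (α + 1) e L LB M ihL1).2 hs'
        refine ⟨fun _ => by show α + 1 = 1 + (j + 1); omega, hL'1, hq', by simp, by simp, by simp, by simp, fun _ => ⟨hLt.le, fun a ha1 ha2 => ?_⟩⟩
        show ((a : ℕ) : ZMod N) ^ out.L = 1
        rcases Nat.lt_or_ge a (1 + j + 1) with hlt | hge
        · obtain ⟨w, hw⟩ := sLdvd
          rw [hw, pow_mul, hpows a ha1 (by omega), one_pow]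
        · have : a = α + 1 := by omega
          subst this
          exact spow hs'

end BaseSearchMath

end Com

end Literature.Computability.Complexity
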